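import Summits.AnomalousDissipation.AnomalousDissipation.Theorems.SawtoothPulseCascadeK1LocalisedCascadeKHCombAmplitude
import Summits.AnomalousDissipation.AnomalousDissipation.Theorems.SawtoothPulseCascadeK1LocalisedCascadeKHCombEnergy
import Summits.AnomalousDissipation.AnomalousDissipation.Theorems.SawtoothPulseCascadeK1LocalisedCascadeKHModeCreation
import Summits.AnomalousDissipation.AnomalousDissipation.Theorems.SawtoothPulseCascadeK1LocalisedCascadeKHTransportParseval
import Summits.AnomalousDissipation.AnomalousDissipation.Theorems.SawtoothPulseCascadeK1LocalisedCascadeKHTransportCoeff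
import Summits.AnomalousDissipation.AnomalousDissipation.Theorems.SawtoothPulseCascadeK1LocalisedCascadeKHStraightPairEnergy
import Summits.AnomalousDissipation.AnomalousDissipation.Theorems.SawtoothPulseCascadeK1LocalisedCascadeKHTransportDuality
import Summits.AnomalousDissipation.AnomalousDissipation.Theorems.SawtoothPulseCascadeK1LocalisedCascadeKHSingleModeCreation
import Summits.AnomalousDissipation.AnomalousDissipation.Theorems.SawtoothPulseCascadeK1LocalisedCascadeKHLineKernel
import Summits.AnomalousDissipation.AnomalousDissipation.Theorems.SawtoothPulseCascadeK1LocalisedCascadeKHSheetPairEnergy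
import Summits.AnomalousDissipation.AnomalousDissipation.Theorems.SawtoothPulseCascadeK1LocalisedCascadeKHModePairedSourceNeg
import Summits.AnomalousDissipation.AnomalousDissipation.Theorems.SawtoothPulseCascadeK1LocalisedCascadeKHModePairedCreation
import Summits.AnomalousDissipation.AnomalousDissipation.Theorems.SawtoothPulseCascadeK1LocalisedCascadeKHModeSquareSum
import Summits.AnomalousDissipation.AnomalousDissipation.Theorems.SawtoothPulseCascadeK1LocalisedCascadeKHModePairedCreationOne
import Summits.AnomalousDissipation.AnomalousDissipation.Theorems.SawtoothPulseCascadeK1LocalisedCascadeKHTransportFreezing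

/-!
# K2 lane — THE DEBRIS AGE LAW BY NAME (P2-D; arbiter A28-3 (5) / A28-5 / A28-16 / A28-17): `DebrisTransfer α β θ K k V s H s′ (2100·D_V(θ,s)·12^k)`

prover ad-k1loc-p2 g14, crux workfile on the dir of stmt-AnomalousDissipation-19491; memo `K2DebrisSaturation-p2.md` (mechanism, free exponent, scope).
Over p4's VERBATIM definitions (copied below; `Cruxes/…` modules are not importable) this file proves an AGE LAW for the renewal (debris-transfer)
entries with rate BELOW the cone's: the age-`k` debris of a V-input sheet creates target pieces of energy `≤ (D·12^k)² ×` its input energy, uniformly in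
the truncation `K`, the class and the age (v4: interpolation exponent `s = 5/8`, `ρ(5/8) = 66^{5/8}2^{−3/8} ≈ 10.6`, booked `12 < 13.0` = the rate the v7.2
cone witness affords at the TYPED `ρc = 53.6`, F-p4g21-1; v1–v3 had `s = 3/4`, rate 21; the duality law `K2CreationLaws.debrisTransfer_to_H` has 66).
MECHANISM = FREEZING (tree `…KHTransportFreezing`, p729640): one slot at level `ℓ` moves the windowed energy of ANY state by at most `(θ/4·2^{−ℓ})·√Ens`
(summable over levels) and by at most `(1+√66)·√E` (duality); `min(x,y) ≤ x^{3/8}y^{5/8}`; enstrophy is non-increasing along the debris path; a sheet has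
infinite enstrophy but its dyadic ROW BLOCKS have summable `Ens^{3/16}E^{5/16}`; the debris path is linear (Minkowski over the blocks).
CONTENTS: §0 copies (incl. the energy-form creation chain §8–§23 and the line-law output law §27 of `K2CreationLaws.lean`); §1 `ens`; §2 freezing in p4's
vocabulary; §3 slot increments; §4 roots toolkit + `debrisOut_ageLaw_of_out` (every windowed state, any target piece, modulo its one-phase output law);
§5 linearity + `debrisOut_ageLaw_family`; §6 row blocks, input energy for ALL source shells, `debrisTransfer_V_ageLaw_of_out`; §7
**`debrisTransfer_V_H_ageLaw` UNCONDITIONAL** (H targets `s′ ≥ 3`); §8′ `debrisTransfer_V_ageLaw_of_lineLaw` (any target, modulo `LineLaw C` = B1 of record).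
WHAT THIS IS NOT: constants truth-sized (no cap); H-type INPUT cells not covered (rate 66 only); registry S4 v7.1 untouched; 19491/20024 open; AD not claimed.
-/

open Set MeasureTheory intervalIntegral

set_option linter.dupNamespace false

namespace Summit.AnomalousDissipation.AnomalousDissipation.Cruxes.K1LocalisedCascade.K2DebrisAgeLaw

open Literature.Analysis.FluidPDE.SawtoothCascade
open Summit.AnomalousDissipation.AnomalousDissipation.Theorems.SawtoothPulseCascade.K2PhaseBudget

noncomputable section

/-! ## Verbatim copies (p4: `K2ConeSketch.lean` v1.4 §0.1–§0.3, §1, §2, §4, §6.4) -/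

/-- The periodised Biot–Savart LINE KERNEL (p2's corrected sign). -/
def lineKernel (a β y : ℝ) : ℂ :=
  let κ : ℝ := 2 * Real.pi * |a|
  let r : ℝ := y - (⌊y⌋ : ℝ)
  let z : ℂ := Complex.exp (2 * Real.pi * β * Complex.I)
  Complex.exp (2 * Real.pi * β * (⌊y⌋ : ℝ) * Complex.I) *
    ((-(((Real.exp (-(κ * r)) : ℂ) / (1 - (starRingEnd ℂ z) * (Real.exp (-κ) : ℂ)))
          + (Real.exp (κ * (r - 1)) : ℂ) * z / (1 - z * (Real.exp (-κ) : ℂ)))) / (2 * κ : ℂ))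

/-- Transport multiplier of an H slot of total strain `θ` on the streamwise mode `a`. -/
def transportPhase (a θ y : ℝ) : ℂ :=
  Complex.exp (-(2 * Real.pi * a * θ * triWave y : ℝ) * Complex.I)

/-- The 2 × 2 Kelvin–Helmholtz block of the kink-sheet pair. -/
def blockX (a β : ℝ) : Matrix (Fin 2) (Fin 2) ℂ :=
  ((2 * Real.pi * a : ℝ) * Complex.I : ℂ) •
    !![-(1 / 4 : ℂ) - 2 * lineKernel a β 0, -2 * lineKernel a β (1 / 2);
       2 * starRingEnd ℂ (lineKernel a β (1 / 2)), (1 / 4 : ℂ) + 2 * lineKernel a β 0]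

/-- `λ(a, β) = -a²·c²(a, β)`. -/
def khLam (a β : ℝ) : ℝ := -(a ^ 2 * sawC2 a β)

/-- `C(t)`: `cosh(√λ t)` / `cos(√(-λ) t)` / `1`. -/
def propC (a β t : ℝ) : ℝ :=
  if 0 < khLam a β then Real.cosh (Real.sqrt (khLam a β) * t)
  else if khLam a β < 0 then Real.cos (Real.sqrt (-(khLam a β)) * t) else 1

/-- `Sn(t)`: `sinh(√λ t)/√λ` / `sin(√(-λ) t)/√(-λ)` / `t`. -/
def propSn (a β t : ℝ) : ℝ :=
  if 0 < khLam a β then Real.sinh (Real.sqrt (khLam a β) * t) / Real.sqrt (khLam a β)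
  else if khLam a β < 0 then Real.sin (Real.sqrt (-(khLam a β)) * t) / Real.sqrt (-(khLam a β)) else t

/-- The explicit propagator `P(t) = C(t)·1 + Sn(t)·X`. -/
def propagator (a β t : ℝ) : Matrix (Fin 2) (Fin 2) ℂ :=
  ((propC a β t : ℝ) : ℂ) • (1 : Matrix (Fin 2) (Fin 2) ℂ) + ((propSn a β t : ℝ) : ℂ) • blockX a β

/-- S-4 state of ONE line family. -/
structure LamState where
  interior : ℝ → ℂ
  sheets : List (ℝ × ℂ)

/-- The pure interior mode `ζ₀ ≡ 1`. -/
def pureMode : LamState := ⟨fun _ => 1, []⟩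

/-- A bare sheet pair on the kink lines with amplitudes `(q₊, q₋)` and no interior content. -/
def sheetPair (qp qm : ℂ) : LamState := ⟨fun _ => 0, [((1 / 4 : ℝ), qp), (-(1 / 4 : ℝ), qm)]⟩

/-- Forcing of the block at slot-time `s`. -/
def forcing (a β : ℝ) (st : LamState) (s : ℝ) : Fin 2 → ℂ :=
  let src : ℝ → ℂ := fun y0 =>
    (∫ y in (-(1 / 2 : ℝ))..(1 / 2), lineKernel a β (y0 - y) * st.interior y * transportPhase a s y)
      + (st.sheets.map (fun p => lineKernel a β (y0 - p.1) * p.2 * transportPhase a s p.1)).sum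
  ![((2 * Real.pi * a : ℝ) * Complex.I : ℂ) * (-2) * src (1 / 4),
    ((2 * Real.pi * a : ℝ) * Complex.I : ℂ) * 2 * src (-(1 / 4))]

/-- Fresh sheet amplitudes after strain `θ` (Duhamel): `q(θ) = ∫₀^θ P(θ - s) f(s) ds`. -/
def sheetAmps (a β θ : ℝ) (st : LamState) : Fin 2 → ℂ :=
  ∫ s in (0 : ℝ)..θ, (propagator a β (θ - s)).mulVec (forcing a β st s)

/-- THE SLOT MAP on one line family (S-2). -/
def slotMap (a β θ : ℝ) (st : LamState) : LamState :=
  ⟨fun y => st.interior y * transportPhase a θ y,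
   (st.sheets.map (fun p => (p.1, p.2 * transportPhase a θ p.1)))
     ++ [((1 / 4 : ℝ), sheetAmps a β θ st 0), (-(1 / 4 : ℝ), sheetAmps a β θ st 1)]⟩

/-- Transverse Fourier coefficient at `β + n`. -/
def coeff (β : ℝ) (st : LamState) (n : ℤ) : ℂ :=
  (∫ y in (-(1 / 2 : ℝ))..(1 / 2), st.interior y * Complex.exp (-(2 * Real.pi * (β + n) * y : ℝ) * Complex.I))
    + (st.sheets.map (fun p => p.2 * Complex.exp (-(2 * Real.pi * (β + n) * p.1 : ℝ) * Complex.I))).sum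

/-- Kinetic energy of the state on the family `(a, β)`. -/
def energy (a β : ℝ) (st : LamState) : ℝ :=
  ∑' n : ℤ, ‖coeff β st n‖ ^ 2 / (4 * Real.pi ^ 2 * (a ^ 2 + (β + n) ^ 2))

/-- Lattice state of one Bloch class `(α, β)`. -/
abbrev CState : Type := ℤ → ℤ → ℂ

/-- The truncation window `[-K, K]`. -/
def win (K : ℕ) : Finset ℤ := Finset.Icc (-(K : ℤ)) K

/-- Kinetic energy at level `ℓ` of the truncated state. -/
def cEnergy (α β : ℝ) (ℓ K : ℕ) (ζ : CState) : ℝ :=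
  ∑ m ∈ win K, ∑ n ∈ win K, ‖ζ m n‖ ^ 2 / (4 * Real.pi ^ 2 * (4 : ℝ) ^ ℓ * ((α + m) ^ 2 + (β + n) ^ 2))

/-- The transverse profile `y ↦ Σ_{|n| ≤ K} c(n) e^{2πi(β+n)y}` of a truncated coefficient row. -/
def modeProfile (β : ℝ) (K : ℕ) (c : ℤ → ℂ) : ℝ → ℂ :=
  fun y => ∑ n ∈ win K, c n * Complex.exp ((2 * Real.pi * (β + n) * y : ℝ) * Complex.I)

/-- H slot (strain `θ`), TRANSPORTED part: row `m` is the family `(α + m, β)`; its profile is multiplied by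
`transportPhase` and re-expanded (`K2SlotMap.coeff`), truncated to the window. -/
def hTransport (α β θ : ℝ) (K : ℕ) (ζ : CState) : CState := fun m n' =>
  if m ∈ win K ∧ n' ∈ win K then
    coeff β ⟨fun y => modeProfile β K (ζ m) y * transportPhase (α + m) θ y, []⟩ n'
  else 0

/-- V slot (strain `θ`), TRANSPORTED part: column `n` is the family `(β + n, α)` (roles of the coordinates exchanged),
its profile over `x` read from the column. -/
def vTransport (α β θ : ℝ) (K : ℕ) (ζ : CState) : CState := fun m' n =>
  if m' ∈ win K ∧ n ∈ win K then
    coeff α ⟨fun x => modeProfile α K (fun m => ζ m n) x * transportPhase (β + n) θ x, []⟩ m'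
  else 0

/-- V slot, FRESH V-pair densities per column. -/
def vFresh (α β θ : ℝ) (K : ℕ) (ζ : CState) : ℤ → Fin 2 → ℂ := fun n =>
  if n ∈ win K then sheetAmps (β + n) α θ ⟨modeProfile α K (fun m => ζ m n), []⟩ else 0

/-- Lattice state of a V-sheet pair with densities `p`. -/
def vPairState (α : ℝ) (p : ℤ → Fin 2 → ℂ) : CState := fun m n =>
  p n 0 * Complex.exp (-(Real.pi * (α + m) / 2 : ℝ) * Complex.I)
    + p n 1 * Complex.exp ((Real.pi * (α + m) / 2 : ℝ) * Complex.I)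

/-- Lower edges of the shells. -/
def shellLo : ℕ → ℝ
  | 0 => 0
  | 1 => 16 / 25
  | (s + 2) => (2 : ℝ) ^ (s + 1)

/-- Upper edge of shell `s`. -/
def shellHi (s : ℕ) : ℝ := shellLo (s + 1)

/-- `x` lies in shell `s`. -/
def InShell (s : ℕ) (x : ℝ) : Prop := shellLo s ≤ |x| ∧ |x| < shellHi s


/-! ## Verbatim copies, continued (p4 `K2ConeSketch.lean` §1–§4: children, fresh H pairs, phase pieces, piece types, shells, `Transfer`) -/

/-- CHILDREN re-framing (one cascade level down, period halves): the modes of class `(α, β)` with parities `(pm, pn)`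
form the child class `((α + pm)/2, (β + pn)/2)` with `ζ_child(m, n) = ζ(2m + pm, 2n + pn)`. -/
def child (pm pn : ℤ) (ζ : CState) : CState := fun m n => ζ (2 * m + pm) (2 * n + pn)

/-- The child class of `(α, β)` with parities `(pm, pn)`. -/
def childClass (α β : ℝ) (pm pn : ℤ) : ℝ × ℝ := ((α + pm) / 2, (β + pn) / 2)

/-- The parity set `{0, 1}`. -/
def parities : Finset ℤ := {0, 1}

/-- H slot, FRESH H-pair densities per row (`K2SlotMap.sheetAmps` of the row's family): `q m = (q₊, q₋)` on
`y = 1/4`, `y = -1/4`, streamwise wavenumber `α + m`. -/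
def hFresh (α β θ : ℝ) (K : ℕ) (ζ : CState) : ℤ → Fin 2 → ℂ := fun m =>
  if m ∈ win K then sheetAmps (α + m) β θ ⟨modeProfile β K (ζ m), []⟩ else 0

/-- Lattice state of an H-sheet pair with densities `q` (engine `SH`): `Z(m,n) = q₊(m) e^{-iπ(β+n)/2} + q₋(m) e^{iπ(β+n)/2}`. -/
def hPairState (β : ℝ) (q : ℤ → Fin 2 → ℂ) : CState := fun m n =>
  q m 0 * Complex.exp (-(Real.pi * (β + n) / 2 : ℝ) * Complex.I)
    + q m 1 * Complex.exp ((Real.pi * (β + n) / 2 : ℝ) * Complex.I)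

/-! ## 3. Phase pieces (material bookkeeping of one phase = H slot then V slot at one level) -/

/-- The three pieces a phase produces from the state entering it. -/
structure PhasePieces where
  /-- densities of the fresh straight V-pair created in the V slot (type V). -/
  freshV : ℤ → Fin 2 → ℂ
  /-- densities of the fresh H-pair created in the H slot; at phase end its state is `vTransport (hPairState freshH)` (type H). -/
  freshH : ℤ → Fin 2 → ℂ
  /-- debris: the entering state transported by both slots. -/
  debris : CState

/-- The phase pieces of class `(α, β)` at truncation `K` (strain `θ` per slot): `T = hTransport ζ`, `hq = hFresh ζ`,
the V slot acts on `T + hPairState hq`; fresh V densities from the whole of it, debris = `vTransport T`. -/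
def phasePieces (α β θ : ℝ) (K : ℕ) (ζ : CState) : PhasePieces :=
  let T : CState := hTransport α β θ K ζ
  let hq : ℤ → Fin 2 → ℂ := hFresh α β θ K ζ
  let S : CState := fun m n => T m n + hPairState β hq m n
  ⟨vFresh α β θ K S, hq, vTransport α β θ K T⟩

/-- The total state at phase end: fresh V pair + V-transported fresh H pair + debris. -/
def phaseTotal (α β θ : ℝ) (K : ℕ) (ζ : CState) : CState := fun m n =>
  let pc := phasePieces α β θ K ζ
  vPairState α pc.freshV m n + vTransport α β θ K (hPairState β pc.freshH) m n + pc.debris m n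

/-- The two piece types carrying a shell profile: fresh straight V pairs and once-transported H pairs. -/
inductive PType
  | V
  | H
  deriving DecidableEq, Fintype

/-- Densities restricted to shell `s` (offset `c` = the class coordinate along the sheet). -/
def restrictShell (s : ℕ) (c : ℝ) (d : ℤ → Fin 2 → ℂ) : ℤ → Fin 2 → ℂ :=
  fun (k : ℤ) => if shellLo s ≤ |c + (k : ℝ)| ∧ |c + (k : ℝ)| < shellHi s then d k else 0

/-- "the densities `d` are supported in shell `s`". -/
def SupportedIn (s : ℕ) (c : ℝ) (d : ℤ → Fin 2 → ℂ) : Prop := ∀ k : ℤ, ¬ InShell s (c + (k : ℝ)) → d k = 0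

/-- v1.3: "the densities `d` are supported in shell `s` AND in the truncation window `|k| ≤ K`" (the engine's input basis). -/
def SupportedInW (s : ℕ) (c : ℝ) (K : ℕ) (d : ℤ → Fin 2 → ℂ) : Prop :=
  SupportedIn s c d ∧ ∀ k : ℤ, k ∉ win K → d k = 0

/-- v1.3: truncation of a class state to the window `|m|, |n| ≤ K` (the engine's `(2K+1)²` arrays). -/
def truncW (K : ℕ) (ζ : CState) : CState :=
  fun (m n : ℤ) => if m ∈ win K ∧ n ∈ win K then ζ m n else 0

/-- The lattice state, at phase ENTRY (class `(α, β)`, level 0), of an input piece of type `t` with densities `d`: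
a straight V pair (v1.3: window-truncated, as the engine's `SV` on the `(2K+1)²` lattice), resp. an H pair V-transported once
(created in the previous H slot of the same level; `vTransport` is windowed already). -/
def inputState (α β θ : ℝ) (K : ℕ) : PType → (ℤ → Fin 2 → ℂ) → CState
  | PType.V, p => truncW K (vPairState α p)
  | PType.H, q => vTransport α β θ K (hPairState β q)

/-- The class coordinate along the sheets of type `t`: `β` for V pairs (densities in `β + n`), `α` for H pairs. -/
def alongCoord (α β : ℝ) : PType → ℝ
  | PType.V => β
  | PType.H => α

/-- Level-`ℓ` energy of the output piece `(t', s')` among the phase pieces `pc` of a class `(α', β')` sitting at level `ℓ`. -/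
def outEnergyAt (α' β' θ : ℝ) (K ℓ : ℕ) (s' : ℕ) (pc : PhasePieces) : PType → ℝ
  | PType.V => cEnergy α' β' ℓ K (vPairState α' (restrictShell s' β' pc.freshV))
  | PType.H => cEnergy α' β' ℓ K (vTransport α' β' θ K (hPairState β' (restrictShell s' α' pc.freshH)))

/-- Level-1 energy of the output piece `(t', s')` among the phase pieces `pc` of the child class `(α', β')`. -/
def outEnergy (α' β' θ : ℝ) (K : ℕ) (s' : ℕ) (pc : PhasePieces) : PType → ℝ :=
  outEnergyAt α' β' θ K 1 s' pc

/-- SHELL-TRANSFER ENTRY `M[(t', s'), (t, s)] ≤ M` for the parent class `(α, β)` at truncation `K`: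
every input piece of type `t` with densities in shell `s` produces, summed over the four children and after their
phase, an output piece `(t', s')` of level-1 energy ≤ `M²` × its own level-0 energy.  (WO-p4-K2-4 computes the sup.) -/
def Transfer (α β θ : ℝ) (K : ℕ) (t : PType) (s : ℕ) (t' : PType) (s' : ℕ) (M : ℝ) : Prop :=
  ∀ d : ℤ → Fin 2 → ℂ, SupportedInW s (alongCoord α β t) K d →
    (∑ pm ∈ parities, ∑ pn ∈ parities,
        outEnergy ((α + pm) / 2) ((β + pn) / 2) θ K s'
          (phasePieces ((α + pm) / 2) ((β + pn) / 2) θ K (child pm pn (inputState α β θ K t d))) t')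
      ≤ M ^ 2 * cEnergy α β 0 K (inputState α β θ K t d)

/-! ## Verbatim copies of glue theorems (`K2CreationLaws.lean` §10/§13/§14/§15/§20/§24/§25) -/

/-- The triangle wave is continuous. -/
theorem continuous_triWave : Continuous triWave := by
  have h : triWave = (fun t : ℝ => 1 / 4 - |t - 1 / 2|) ∘ Int.fract ∘ (fun ξ : ℝ => ξ + 1 / 4) := by
    funext ξ; simp [triWave, Function.comp]
  rw [h]
  have hI : Continuous ((fun t : ℝ => 1 / 4 - |t - 1 / 2|) ∘ Int.fract) :=
    ContinuousOn.comp_fract'' (Continuous.continuousOn (by fun_prop)) (by norm_num)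
  exact hI.comp (continuous_id.add continuous_const)

/-- The transport phase is continuous in `y` and unimodular. -/
theorem continuous_transportPhase (a θ : ℝ) : Continuous (transportPhase a θ) := by
  unfold transportPhase
  have := continuous_triWave
  fun_prop

/-- One column of `vTransport`, inside the window, is the transport coefficient of the column profile. -/
theorem vTransport_apply_of_mem (α β θ : ℝ) (K : ℕ) (ζ : CState) {m' n : ℤ} (hm' : m' ∈ win K) (hn : n ∈ win K) :
    vTransport α β θ K ζ m' n = ∫ x in (-(1 / 2 : ℝ))..(1 / 2),
      ((∑ m ∈ win K, ζ m n * Complex.exp ((2 * Real.pi * (α + m) * x : ℝ) * Complex.I)) *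
        Complex.exp (-((2 * Real.pi * (β + n) * θ * triWave x : ℝ) : ℂ) * Complex.I)) * Complex.exp (-(2 * Real.pi * (α + m') * x : ℝ) * Complex.I) := by
  simp only [vTransport, if_pos (And.intro hm' hn), coeff, modeProfile, transportPhase, List.map_nil, List.sum_nil, add_zero]

/-- The energy-form transport bound for ONE column of `vTransport` (line `β + n`, any value incl. `0`). -/
theorem vTransport_column_energy_le (α β θ : ℝ) (ℓ K : ℕ) (ζ : CState) {n : ℤ} (hn : n ∈ win K) :
    ∑ m' ∈ win K, ‖vTransport α β θ K ζ m' n‖ ^ 2 / (4 * Real.pi ^ 2 * (4 : ℝ) ^ ℓ * ((α + m') ^ 2 + (β + n) ^ 2)) ≤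
      (θ ^ 2 + 2) * ∑ m ∈ win K, ‖ζ m n‖ ^ 2 / (4 * Real.pi ^ 2 * (4 : ℝ) ^ ℓ * ((α + m) ^ 2 + (β + n) ^ 2)) := by
  have hc : (0 : ℝ) < 4 * Real.pi ^ 2 * (4 : ℝ) ^ ℓ := by positivity
  have e : ∀ (v : ℂ) (m : ℤ), ‖v‖ ^ 2 / (4 * Real.pi ^ 2 * (4 : ℝ) ^ ℓ * ((α + m) ^ 2 + (β + n) ^ 2)) =
      (1 / (4 * Real.pi ^ 2 * (4 : ℝ) ^ ℓ)) * (‖v‖ ^ 2 / ((α + m) ^ 2 + (β + n) ^ 2)) := by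
    intro v m
    rw [mul_comm (4 * Real.pi ^ 2 * (4 : ℝ) ^ ℓ) ((α + (m : ℝ)) ^ 2 + (β + n) ^ 2), ← div_div, div_eq_mul_one_div, mul_comm]
  simp_rw [e, ← Finset.mul_sum]
  rw [mul_left_comm]
  refine mul_le_mul_of_nonneg_left ?_ (by positivity)
  rcases eq_or_ne (β + (n : ℝ)) 0 with hb | hb
  · -- the untransported column `β + n = 0`
    have hid : ∀ m' ∈ win K, vTransport α β θ K ζ m' n = ζ m' n := by
      intro m' hm'
      rw [vTransport_apply_of_mem α β θ K ζ hm' hn]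
      have h1 : ∀ x : ℝ, Complex.exp (-((2 * Real.pi * (β + n) * θ * triWave x : ℝ) : ℂ) * Complex.I) = 1 := by
        intro x; rw [hb]; simp
      simp_rw [h1, mul_one]
      rw [integral_blochPoly_mul_conjExp, if_pos hm']
    rw [Finset.sum_congr rfl fun m' hm' => by rw [hid m' hm']]
    have h0 : 0 ≤ ∑ m ∈ win K, ‖ζ m n‖ ^ 2 / ((α + m) ^ 2 + (β + n) ^ 2) := Finset.sum_nonneg fun _ _ => by positivity
    nlinarith [sq_nonneg θ]
  · rw [Finset.sum_congr rfl fun m' hm' => by rw [vTransport_apply_of_mem α β θ K ζ hm' hn]]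
    exact transport_energy_duality α θ hb (win K) (win K) (fun m => ζ m n)

/-- **L-i-b BY NAME (V slot).** For every class `(α, β)`, strain `θ`, level `ℓ`, window `K` and lattice state `ζ`:
`cEnergy α β ℓ K (vTransport α β θ K ζ) ≤ (θ² + 2)·cEnergy α β ℓ K ζ`. -/
theorem cEnergy_vTransport_le (α β θ : ℝ) (ℓ K : ℕ) (ζ : CState) :
    cEnergy α β ℓ K (vTransport α β θ K ζ) ≤ (θ ^ 2 + 2) * cEnergy α β ℓ K ζ := by
  unfold cEnergy
  rw [Finset.sum_comm]
  conv_rhs => rw [Finset.sum_comm]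
  rw [Finset.mul_sum]
  exact Finset.sum_le_sum fun n hn => vTransport_column_energy_le α β θ ℓ K ζ hn

/-- Integers `n` with `|β + n| ≤ R` inside any finset number at most `2R + 1`. -/
theorem card_filter_abs_le (β : ℝ) {R : ℝ} (hR : 0 ≤ R) (S : Finset ℤ) :
    (((S.filter fun n : ℤ => |β + n| ≤ R).card : ℕ) : ℝ) ≤ 2 * R + 1 := by
  set T := S.filter fun n : ℤ => |β + n| ≤ R with hT
  have hsub : T ⊆ Finset.Icc ⌈-β - R⌉ ⌊-β + R⌋ := by
    intro n hn
    rw [hT, Finset.mem_filter] at hn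
    obtain ⟨h1, h2⟩ := abs_le.1 hn.2
    rw [Finset.mem_Icc]
    constructor
    · exact Int.ceil_le.2 (by linarith)
    · exact Int.le_floor.2 (by linarith)
  have hcard := Finset.card_le_card hsub
  rw [Int.card_Icc] at hcard
  have h1 : ((T.card : ℕ) : ℝ) ≤ (((⌊-β + R⌋ + 1 - ⌈-β - R⌉).toNat : ℕ) : ℝ) := by exact_mod_cast hcard
  refine h1.trans ?_
  have h2 : ((⌊-β + R⌋ + 1 - ⌈-β - R⌉ : ℤ) : ℝ) ≤ 2 * R + 1 := by
    have hf : ((⌊-β + R⌋ : ℤ) : ℝ) ≤ -β + R := Int.floor_le _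
    have hc : -β - R ≤ ((⌈-β - R⌉ : ℤ) : ℝ) := Int.le_ceil _
    push_cast; linarith
  rcases le_or_gt 0 (⌊-β + R⌋ + 1 - ⌈-β - R⌉) with h | h
  · rw [show (((⌊-β + R⌋ + 1 - ⌈-β - R⌉).toNat : ℕ) : ℝ) = ((⌊-β + R⌋ + 1 - ⌈-β - R⌉ : ℤ) : ℝ) by
      rw [← Int.toNat_of_nonneg h]; push_cast; rw [Int.toNat_of_nonneg h]]
    exact h2
  · rw [Int.toNat_eq_zero.2 h.le]; push_cast; linarith

/-- The level-0 windowed energy of the V-source input state, spelled out (the window truncation is invisible inside `cEnergy`'s window sums). -/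
theorem cEnergy_inputState_V (α β θ : ℝ) (K : ℕ) (d : ℤ → Fin 2 → ℂ) :
    cEnergy α β 0 K (inputState α β θ K PType.V d) = ∑ m ∈ win K, ∑ n ∈ win K,
      ‖d n 0 * Complex.exp (-(Real.pi * (α + m) / 2 : ℝ) * Complex.I) + d n 1 * Complex.exp ((Real.pi * (α + m) / 2 : ℝ) * Complex.I)‖ ^ 2 /
        (4 * Real.pi ^ 2 * ((α + m) ^ 2 + (β + n) ^ 2)) := by
  unfold cEnergy
  refine Finset.sum_congr rfl fun m hm => Finset.sum_congr rfl fun n hn => ?_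
  simp only [inputState, truncW, vPairState, if_pos (And.intro hm hn), pow_zero, mul_one]

/-- **L-i-c BY NAME** (E6 far-row schema, piece (i), A27-7): for a class `(α, β)` with `α ∈ [0,1]`, every strain `θ`, truncation `K` and V-pair densities `d`,
`cEnergy α β 0 K (inputState α β θ K V d) ≥ (1/4π²)·Σ_{|n| ≤ K} (‖d n 0‖² + ‖d n 1‖²)·(π/|β+n| − 2/(K+1) − 4/(β+n)²)`: every source column in shell `s`
(`|β+n| ≥ 2^{s−1}`) inside the window carries at least `1 − (2/π)2^{s−1}/(K+1) − 8/(π2^s)` of its full-lattice energy `(‖d n 0‖²+‖d n 1‖²)/(4π|β+n|)` —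
the denominator of every far entry `M[(t′,s′) ← (V,s)]`. -/
theorem cEnergy_inputState_V_lower {α : ℝ} (hα0 : 0 ≤ α) (hα1 : α ≤ 1) (β θ : ℝ) (K : ℕ) (d : ℤ → Fin 2 → ℂ) :
    (∑ n ∈ win K, (‖d n 0‖ ^ 2 + ‖d n 1‖ ^ 2) * (Real.pi / |β + n| - 2 / (K + 1) - 4 / (β + n) ^ 2)) / (4 * Real.pi ^ 2) ≤
      cEnergy α β 0 K (inputState α β θ K PType.V d) := by
  rw [cEnergy_inputState_V]
  exact vPair_window_energy_lower hα0 hα1 β K d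

/-- **The input energy of a V source supported in shell `s ≥ 2` (uniform form):** if `d` vanishes off shell `s` (`|β+n| ∈ [2^{s−1}, 2^s)`), then
`cEnergy α β 0 K (inputState α β θ K V d) ≥ (1/4π²)·(π/2^s − 2/(K+1) − 4/4^{s−1})·Σ_{|n| ≤ K} (‖d n 0‖² + ‖d n 1‖²)`. -/
theorem cEnergy_inputState_V_shell_lower {α : ℝ} (hα0 : 0 ≤ α) (hα1 : α ≤ 1) (β θ : ℝ) (K : ℕ) {s : ℕ} (hs : 2 ≤ s) (d : ℤ → Fin 2 → ℂ)
    (hd : SupportedIn s β d) :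
    (Real.pi / 2 ^ s - 2 / (K + 1) - 4 / 4 ^ (s - 1)) * (∑ n ∈ win K, (‖d n 0‖ ^ 2 + ‖d n 1‖ ^ 2)) / (4 * Real.pi ^ 2) ≤
      cEnergy α β 0 K (inputState α β θ K PType.V d) := by
  refine le_trans ?_ (cEnergy_inputState_V_lower hα0 hα1 β θ K d)
  refine div_le_div_of_nonneg_right ?_ (by positivity)
  rw [Finset.mul_sum]
  refine Finset.sum_le_sum fun n _ => ?_
  by_cases hin : InShell s (β + (n : ℝ))
  · obtain ⟨k, rfl⟩ : ∃ k, s = k + 2 := ⟨s - 2, by omega⟩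
    have hlo : (2 : ℝ) ^ (k + 1) ≤ |β + n| := hin.1
    have hhi : |β + n| < (2 : ℝ) ^ (k + 2) := hin.2
    have hpos : (0 : ℝ) < 2 ^ (k + 1) := by positivity
    have hb0 : 0 < |β + n| := hpos.trans_le hlo
    rw [mul_comm]
    refine mul_le_mul_of_nonneg_left ?_ (by positivity)
    have e1 : Real.pi / 2 ^ (k + 2) ≤ Real.pi / |β + n| := div_le_div_of_nonneg_left Real.pi_pos.le hb0 hhi.le
    have e2 : 4 / (β + (n : ℝ)) ^ 2 ≤ 4 / 4 ^ (k + 2 - 1) := by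
      rw [show k + 2 - 1 = k + 1 by omega, ← sq_abs]
      refine div_le_div_of_nonneg_left (by norm_num) (by positivity) ?_
      calc (4 : ℝ) ^ (k + 1) = (2 ^ (k + 1)) ^ 2 := by rw [← pow_mul, show (4 : ℝ) = 2 ^ 2 by norm_num, ← pow_mul]; ring_nf
        _ ≤ |β + n| ^ 2 := pow_le_pow_left₀ hpos.le hlo 2
    linarith
  · have h0 : d n = 0 := hd n hin
    simp [h0]

/-- Membership in the window, unfolded. -/
theorem mem_win {K : ℕ} {x : ℤ} : x ∈ win K ↔ -(K : ℤ) ≤ x ∧ x ≤ K := by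
  simp only [win, Finset.mem_Icc]

/-- One-coordinate re-framing: the two parities of a windowed nonnegative sequence re-index into the window. -/
theorem sum_parities_win_le (K : ℕ) (g : ℤ → ℝ) (hg0 : ∀ M, 0 ≤ g M) (hgz : ∀ M, M ∉ win K → g M = 0) :
    ∑ p ∈ parities, ∑ m ∈ win K, g (2 * m + p) ≤ ∑ M ∈ win K, g M := by
  rw [← Finset.sum_product']
  have hinj : ∀ x ∈ parities ×ˢ win K, ∀ y ∈ parities ×ˢ win K, (fun x : ℤ × ℤ => 2 * x.2 + x.1) x = (fun x : ℤ × ℤ => 2 * x.2 + x.1) y → x = y := by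
    intro x hx y hy hxy
    simp only [Finset.mem_product, parities, Finset.mem_insert, Finset.mem_singleton] at hx hy
    simp only at hxy
    ext <;> omega
  rw [← Finset.sum_image hinj]
  rw [← Finset.sum_filter_of_ne (p := fun M => M ∈ win K) (fun M _ hM => by by_contra h; exact hM (hgz M h))]
  exact Finset.sum_le_sum_of_subset_of_nonneg (fun M hM => (Finset.mem_filter.1 hM).2) fun M _ _ => hg0 M

/-- **Re-framing does not increase energy:** the level-`ℓ+1` energies of the four children of a windowed state sum to at most its level-`ℓ` energy
(equality in fact; `≤` is what the entries need). -/
theorem sum_cEnergy_child_le (α β : ℝ) (ℓ K : ℕ) (Z : CState) (hZ : ∀ m n : ℤ, (m ∉ win K ∨ n ∉ win K) → Z m n = 0) :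
    ∑ pm ∈ parities, ∑ pn ∈ parities, cEnergy ((α + pm) / 2) ((β + pn) / 2) (ℓ + 1) K (child pm pn Z) ≤ cEnergy α β ℓ K Z := by
  set T : ℤ → ℤ → ℝ := fun M N => ‖Z M N‖ ^ 2 / (4 * Real.pi ^ 2 * (4 : ℝ) ^ ℓ * ((α + M) ^ 2 + (β + N) ^ 2)) with hT
  have hT0 : ∀ M N, 0 ≤ T M N := fun M N => by rw [hT]; positivity
  have hTz : ∀ M N, (M ∉ win K ∨ N ∉ win K) → T M N = 0 := fun M N h => by rw [hT]; simp only; rw [hZ M N h]; simp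
  have hchild : ∀ pm pn : ℤ, cEnergy ((α + pm) / 2) ((β + pn) / 2) (ℓ + 1) K (child pm pn Z) =
      ∑ m ∈ win K, ∑ n ∈ win K, T (2 * m + pm) (2 * n + pn) := by
    intro pm pn
    unfold cEnergy
    refine Finset.sum_congr rfl fun m _ => Finset.sum_congr rfl fun n _ => ?_
    rw [hT]
    simp only [child]
    congr 1
    push_cast
    ring
  simp_rw [hchild]
  -- re-index the `n` coordinate, then the `m` coordinate
  have step1 : ∀ pm ∈ parities, ∀ m ∈ win K, ∑ pn ∈ parities, ∑ n ∈ win K, T (2 * m + pm) (2 * n + pn) ≤ ∑ N ∈ win K, T (2 * m + pm) N :=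
    fun pm _ m _ => sum_parities_win_le K (fun N => T (2 * m + pm) N) (fun N => hT0 _ N) (fun N hN => hTz _ N (Or.inr hN))
  have step2 : ∀ N ∈ win K, ∑ pm ∈ parities, ∑ m ∈ win K, T (2 * m + pm) N ≤ ∑ M ∈ win K, T M N :=
    fun N _ => sum_parities_win_le K (fun M => T M N) (fun M => hT0 M N) (fun M hM => hTz M N (Or.inl hM))
  calc ∑ pm ∈ parities, ∑ pn ∈ parities, ∑ m ∈ win K, ∑ n ∈ win K, T (2 * m + pm) (2 * n + pn)
      = ∑ pm ∈ parities, ∑ m ∈ win K, ∑ pn ∈ parities, ∑ n ∈ win K, T (2 * m + pm) (2 * n + pn) := by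
        refine Finset.sum_congr rfl fun pm _ => ?_; rw [Finset.sum_comm]
    _ ≤ ∑ pm ∈ parities, ∑ m ∈ win K, ∑ N ∈ win K, T (2 * m + pm) N :=
        Finset.sum_le_sum fun pm hpm => Finset.sum_le_sum fun m hm => step1 pm hpm m hm
    _ = ∑ N ∈ win K, ∑ pm ∈ parities, ∑ m ∈ win K, T (2 * m + pm) N := by
        rw [show (∑ pm ∈ parities, ∑ m ∈ win K, ∑ N ∈ win K, T (2 * m + pm) N) =
          ∑ pm ∈ parities, ∑ N ∈ win K, ∑ m ∈ win K, T (2 * m + pm) N from Finset.sum_congr rfl fun pm _ => Finset.sum_comm,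
          Finset.sum_comm]
    _ ≤ ∑ N ∈ win K, ∑ M ∈ win K, T M N := Finset.sum_le_sum step2
    _ = cEnergy α β ℓ K Z := by rw [Finset.sum_comm]; rfl

/-- The input state of `Transfer` is windowed (both piece types). -/
theorem inputState_apply_eq_zero (α β θ : ℝ) (K : ℕ) (t : PType) (d : ℤ → Fin 2 → ℂ) (m n : ℤ) (h : m ∉ win K ∨ n ∉ win K) :
    inputState α β θ K t d m n = 0 := by
  cases t with
  | V => simp only [inputState, truncW]; rw [if_neg (by tauto)]
  | H => simp only [inputState, vTransport]; rw [if_neg (by tauto)]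

/-- One row of `hTransport`, inside the window, is the transport coefficient of the row profile. -/
theorem hTransport_apply_of_mem (α β θ : ℝ) (K : ℕ) (ζ : CState) {m n' : ℤ} (hm : m ∈ win K) (hn' : n' ∈ win K) :
    hTransport α β θ K ζ m n' = ∫ y in (-(1 / 2 : ℝ))..(1 / 2),
      ((∑ n ∈ win K, ζ m n * Complex.exp ((2 * Real.pi * (β + n) * y : ℝ) * Complex.I)) *
        Complex.exp (-((2 * Real.pi * (α + m) * θ * triWave y : ℝ) : ℂ) * Complex.I)) * Complex.exp (-(2 * Real.pi * (β + n') * y : ℝ) * Complex.I) := by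
  simp only [hTransport, if_pos (And.intro hm hn'), coeff, modeProfile, transportPhase, List.map_nil, List.sum_nil, add_zero]

/-- **Bessel per row.** `Σ_{n′ ∈ S} ‖hTransport … K ζ m n′‖² ≤ Σ_{n ∈ win K} ‖ζ m n‖²` (the transport phase is unimodular; Parseval for the row profile). -/
theorem sum_norm_sq_hTransport_row_le (α β θ : ℝ) (K : ℕ) (ζ : CState) (m : ℤ) (S : Finset ℤ) (hS : S ⊆ win K) :
    ∑ n' ∈ S, ‖hTransport α β θ K ζ m n'‖ ^ 2 ≤ ∑ n ∈ win K, ‖ζ m n‖ ^ 2 := by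
  by_cases hm : m ∈ win K
  · set g : ℝ → ℂ := fun y => (∑ n ∈ win K, ζ m n * Complex.exp ((2 * Real.pi * (β + n) * y : ℝ) * Complex.I)) *
      Complex.exp (-((2 * Real.pi * (α + m) * θ * triWave y : ℝ) : ℂ) * Complex.I) with hg
    have hgc : Continuous g := by
      rw [hg]; exact (continuous_blochPoly β (win K) (fun n => ζ m n)).mul (continuous_transportPhase (α + m) θ)
    have hrow : ∀ n' ∈ S, hTransport α β θ K ζ m n' = ∫ y in (-(1 / 2 : ℝ))..(1 / 2), g y * Complex.exp (-(2 * Real.pi * (β + n') * y : ℝ) * Complex.I) := by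
      intro n' hn'
      rw [hTransport_apply_of_mem α β θ K ζ hm (hS hn'), hg]
    rw [Finset.sum_congr rfl fun n' hn' => by rw [hrow n' hn']]
    refine (sum_le_hasSum S (fun n' _ => by positivity) (hasSum_sq_coeff hgc β)).trans (le_of_eq ?_)
    have e : ∀ y : ℝ, ‖g y‖ ^ 2 = ‖∑ n ∈ win K, ζ m n * Complex.exp ((2 * Real.pi * (β + n) * y : ℝ) * Complex.I)‖ ^ 2 := by
      intro y
      rw [hg]
      simp only
      rw [norm_mul, show -((2 * Real.pi * (α + m) * θ * triWave y : ℝ) : ℂ) * Complex.I =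
        ((-(2 * Real.pi * (α + m) * θ * triWave y) : ℝ) : ℂ) * Complex.I by push_cast; ring, Complex.norm_exp_ofReal_mul_I, mul_one]
    simp_rw [e]
    exact integral_norm_sq_blochPoly β (win K) (fun n => ζ m n)
  · have h0 : ∀ n' ∈ S, hTransport α β θ K ζ m n' = 0 := fun n' _ => by
      unfold hTransport; rw [if_neg (fun h => hm h.1)]
    rw [Finset.sum_congr rfl fun n' hn' => by rw [h0 n' hn']]
    simp only [norm_zero, ne_eq, OfNat.ofNat_ne_zero, not_false_eq_true, zero_pow, Finset.sum_const_zero]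
    exact Finset.sum_nonneg fun _ _ => by positivity

/-- `‖vPairState α p m n‖² ≤ 2(‖p n 0‖² + ‖p n 1‖²)`. -/
theorem norm_sq_vPairState_le (α : ℝ) (p : ℤ → Fin 2 → ℂ) (m n : ℤ) :
    ‖vPairState α p m n‖ ^ 2 ≤ 2 * (‖p n 0‖ ^ 2 + ‖p n 1‖ ^ 2) := by
  have h1 : ‖vPairState α p m n‖ ≤ ‖p n 0‖ + ‖p n 1‖ := by
    simp only [vPairState]
    refine (norm_add_le _ _).trans (le_of_eq ?_)
    rw [norm_mul, norm_mul, show -((Real.pi * (α + m) / 2 : ℝ) : ℂ) * Complex.I = ((-(Real.pi * (α + m) / 2) : ℝ) : ℂ) * Complex.I by push_cast; ring,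
      Complex.norm_exp_ofReal_mul_I, Complex.norm_exp_ofReal_mul_I, mul_one, mul_one]
  have h0 : 0 ≤ ‖vPairState α p m n‖ := norm_nonneg _
  nlinarith [sq_nonneg (‖p n 0‖ - ‖p n 1‖)]

/-- The energy-form transport bound for ONE row of `hTransport` (line `α + m`, any value incl. `0`). -/
theorem hTransport_row_energy_le (α β θ : ℝ) (ℓ K : ℕ) (ζ : CState) {m : ℤ} (hm : m ∈ win K) :
    ∑ n' ∈ win K, ‖hTransport α β θ K ζ m n'‖ ^ 2 / (4 * Real.pi ^ 2 * (4 : ℝ) ^ ℓ * ((α + m) ^ 2 + (β + n') ^ 2)) ≤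
      (θ ^ 2 + 2) * ∑ n ∈ win K, ‖ζ m n‖ ^ 2 / (4 * Real.pi ^ 2 * (4 : ℝ) ^ ℓ * ((α + m) ^ 2 + (β + n) ^ 2)) := by
  have hc : (0 : ℝ) < 4 * Real.pi ^ 2 * (4 : ℝ) ^ ℓ := by positivity
  have e : ∀ (v : ℂ) (n : ℤ), ‖v‖ ^ 2 / (4 * Real.pi ^ 2 * (4 : ℝ) ^ ℓ * ((α + m) ^ 2 + (β + n) ^ 2)) =
      (1 / (4 * Real.pi ^ 2 * (4 : ℝ) ^ ℓ)) * (‖v‖ ^ 2 / ((β + n) ^ 2 + (α + m) ^ 2)) := by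
    intro v n
    rw [add_comm ((α + (m : ℝ)) ^ 2), mul_comm (4 * Real.pi ^ 2 * (4 : ℝ) ^ ℓ) ((β + (n : ℝ)) ^ 2 + (α + m) ^ 2), ← div_div,
      div_eq_mul_one_div, mul_comm]
  simp_rw [e, ← Finset.mul_sum]
  rw [mul_left_comm]
  refine mul_le_mul_of_nonneg_left ?_ (by positivity)
  rcases eq_or_ne (α + (m : ℝ)) 0 with hb | hb
  · have hid : ∀ n' ∈ win K, hTransport α β θ K ζ m n' = ζ m n' := by
      intro n' hn'
      rw [hTransport_apply_of_mem α β θ K ζ hm hn']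
      have h1 : ∀ y : ℝ, Complex.exp (-((2 * Real.pi * (α + m) * θ * triWave y : ℝ) : ℂ) * Complex.I) = 1 := by
        intro y; rw [hb]; simp
      simp_rw [h1, mul_one]
      rw [integral_blochPoly_mul_conjExp, if_pos hn']
    rw [Finset.sum_congr rfl fun n' hn' => by rw [hid n' hn']]
    have h0 : 0 ≤ ∑ n ∈ win K, ‖ζ m n‖ ^ 2 / ((β + n) ^ 2 + (α + m) ^ 2) := Finset.sum_nonneg fun _ _ => by positivity
    nlinarith [sq_nonneg θ]
  · rw [Finset.sum_congr rfl fun n' hn' => by rw [hTransport_apply_of_mem α β θ K ζ hm hn']]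
    exact transport_energy_duality β θ hb (win K) (win K) (fun n => ζ m n)

/-- **L-i-b BY NAME (H slot).** `cEnergy α β ℓ K (hTransport α β θ K ζ) ≤ (θ² + 2)·cEnergy α β ℓ K ζ`. -/
theorem cEnergy_hTransport_le (α β θ : ℝ) (ℓ K : ℕ) (ζ : CState) :
    cEnergy α β ℓ K (hTransport α β θ K ζ) ≤ (θ ^ 2 + 2) * cEnergy α β ℓ K ζ := by
  unfold cEnergy
  rw [Finset.mul_sum]
  exact Finset.sum_le_sum fun m hm => hTransport_row_energy_le α β θ ℓ K ζ hm

/-- DEBRIS LINEAGE OUTPUT.  `debrisOut θ K t' s' k ℓ α β ζ` = the energy, at level `ℓ + k + 1` and summed over all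
`4^(k+1)` descendant classes, of the output piece `(t', s')` produced by content `ζ` of class `(α, β)` (level `ℓ`) that
travels the DEBRIS path (children ↦ transported by both slots) for `k` phases and then passes one full phase;
`k = 0` is the quantity bounded in `Transfer`.  (WO-p4-K2-4b, `wo_p4_k2_4b.py`, measures the sups for ages `k ≤ 3`.) -/
def debrisOut (θ : ℝ) (K : ℕ) (t' : PType) (s' : ℕ) : ℕ → ℕ → ℝ → ℝ → CState → ℝ
  | 0, ℓ, α, β, ζ => ∑ pm ∈ parities, ∑ pn ∈ parities,
      outEnergyAt ((α + pm) / 2) ((β + pn) / 2) θ K (ℓ + 1) s'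
        (phasePieces ((α + pm) / 2) ((β + pn) / 2) θ K (child pm pn ζ)) t'
  | (k + 1), ℓ, α, β, ζ => ∑ pm ∈ parities, ∑ pn ∈ parities,
      debrisOut θ K t' s' k (ℓ + 1) ((α + pm) / 2) ((β + pn) / 2)
        (phasePieces ((α + pm) / 2) ((β + pn) / 2) θ K (child pm pn ζ)).debris

/-- RENEWAL (DEBRIS-TRANSFER) ENTRY of age `k ≥ 1`: `D_k[(t', s'), (t, s)] ≤ D` for the parent class `(α, β)` —
the age-`k` debris of an input piece `(t, s)` produces output pieces `(t', s')` of energy ≤ `D²` × the input energy.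
No decay in `k` is asked for (the data show persistence, `O→O ≈ 1`, for KH-band debris): the renewal cone below only
needs the entries bounded, uniformly in the age. -/
def DebrisTransfer (α β θ : ℝ) (K k : ℕ) (t : PType) (s : ℕ) (t' : PType) (s' : ℕ) (D : ℝ) : Prop :=
  ∀ d : ℤ → Fin 2 → ℂ, SupportedInW s (alongCoord α β t) K d →
    debrisOut θ K t' s' k 0 α β (inputState α β θ K t d) ≤ D ^ 2 * cEnergy α β 0 K (inputState α β θ K t d)

/-- Debris states are windowed (the V transport carries the window guard). -/
theorem phasePieces_debris_apply_eq_zero (α β θ : ℝ) (K : ℕ) (ζ : CState) (m n : ℤ) (h : m ∉ win K ∨ n ∉ win K) :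
    (phasePieces α β θ K ζ).debris m n = 0 := by
  simp only [phasePieces, vTransport]
  rw [if_neg (by tauto)]

/-- **Debris energy per phase:** `E(debris) ≤ (θ²+2)²·E(ζ)` (both transports, `cEnergy_hTransport_le`, `cEnergy_vTransport_le`). -/
theorem cEnergy_debris_le (α β θ : ℝ) (ℓ K : ℕ) (ζ : CState) :
    cEnergy α β ℓ K (phasePieces α β θ K ζ).debris ≤ (θ ^ 2 + 2) ^ 2 * cEnergy α β ℓ K ζ := by
  simp only [phasePieces]
  refine (cEnergy_vTransport_le α β θ ℓ K _).trans ?_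
  rw [show (θ ^ 2 + 2) ^ 2 * cEnergy α β ℓ K ζ = (θ ^ 2 + 2) * ((θ ^ 2 + 2) * cEnergy α β ℓ K ζ) by ring]
  exact mul_le_mul_of_nonneg_left (cEnergy_hTransport_le α β θ ℓ K ζ) (by positivity)

/-- The input-energy coefficient from shell 3 on: `1/(2·2^s) ≤ π/2^s − 2/(K+1) − 4/4^{s−1}` for `s ≥ 3`, `K + 1 ≥ 2^{s+2}`. -/
theorem input_coef_lower3 {s : ℕ} (hs : 3 ≤ s) {K : ℕ} (hK : (2 : ℝ) ^ (s + 2) ≤ K + 1) :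
    1 / (2 * (2 : ℝ) ^ s) ≤ Real.pi / 2 ^ s - 2 / ((K : ℝ) + 1) - 4 / 4 ^ (s - 1) := by
  set X : ℝ := (2 : ℝ) ^ s with hX
  have hX8 : 8 ≤ X := by
    rw [hX]; calc (8 : ℝ) = 2 ^ 3 := by norm_num
      _ ≤ 2 ^ s := pow_le_pow_right₀ (by norm_num) hs
  have hXpos : 0 < X := by linarith
  have h4 : (4 : ℝ) / 4 ^ (s - 1) = 16 / X ^ 2 := by
    obtain ⟨j, rfl⟩ : ∃ j, s = j + 1 := ⟨s - 1, by omega⟩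
    rw [show j + 1 - 1 = j by omega]
    have h' : (4 : ℝ) ^ j * 4 = X ^ 2 := by
      rw [hX, ← pow_succ, ← pow_mul, show (4 : ℝ) = 2 ^ 2 by norm_num, ← pow_mul]; ring_nf
    rw [← h']
    field_simp
    ring
  have hK' : 2 / ((K : ℝ) + 1) ≤ 1 / (2 * X) := by
    rw [div_le_div_iff₀ (by positivity) (by positivity)]
    have : (2 : ℝ) ^ (s + 2) = 4 * X := by rw [hX, pow_add]; ring
    nlinarith
  have hx16 : 16 / X ^ 2 ≤ (Real.pi - 1) / X := by
    rw [div_le_div_iff₀ (by positivity) hXpos]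
    have hπ := Real.pi_gt_three
    nlinarith
  have e1 : (Real.pi - 1) / X = Real.pi / X - 1 / (2 * X) - 1 / (2 * X) := by ring
  rw [h4]
  linarith

/-- **The `ℓ²` mass of a shell-`s ≥ 3` V source against its windowed energy:** `Σ_k (‖d k 0‖² + ‖d k 1‖²) ≤ 8π²·2^s·E_K(d)` once `2^{s+2} ≤ K + 1`
(`cEnergy_inputState_V_shell_lower` + `input_coef_lower3`). -/
theorem sum_norm_sq_le_cEnergy_inputState_V {α : ℝ} (hα0 : 0 ≤ α) (hα1 : α ≤ 1) (β θ : ℝ) {s K : ℕ} (hs : 3 ≤ s)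
    (hK : (2 : ℝ) ^ (s + 2) ≤ K + 1) (d : ℤ → Fin 2 → ℂ) (hd : SupportedIn s β d) :
    ∑ n ∈ win K, (‖d n 0‖ ^ 2 + ‖d n 1‖ ^ 2) ≤ 8 * Real.pi ^ 2 * 2 ^ s * cEnergy α β 0 K (inputState α β θ K PType.V d) := by
  have h1 := cEnergy_inputState_V_shell_lower hα0 hα1 β θ K (by omega : 2 ≤ s) d hd
  have h2 := input_coef_lower3 hs hK
  set D : ℝ := ∑ n ∈ win K, (‖d n 0‖ ^ 2 + ‖d n 1‖ ^ 2) with hDdef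
  have hD0 : 0 ≤ D := Finset.sum_nonneg fun _ _ => by positivity
  have h3 : 1 / (2 * (2 : ℝ) ^ s) * D / (4 * Real.pi ^ 2) ≤ cEnergy α β 0 K (inputState α β θ K PType.V d) :=
    le_trans (div_le_div_of_nonneg_right (mul_le_mul_of_nonneg_right h2 hD0) (by positivity)) h1
  rw [show 1 / (2 * (2 : ℝ) ^ s) * D / (4 * Real.pi ^ 2) = D / (8 * Real.pi ^ 2 * 2 ^ s) by field_simp; ring,
    div_le_iff₀ (by positivity)] at h3
  linarith


/-! # Verbatim copies of the energy-form creation chain (`K2CreationLaws.lean` §1/§4/§8/§9/§16/§17/§21/§22/§23, p2 g10–g12) -/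

/-! ## §1 The kernel of the crux copy in the tree's shape -/

/-- The tree's closed form of the kernel on one period. -/
def kernelK (a β : ℝ) : ℝ → ℂ := fun r : ℝ => (-((Real.exp (-(2 * Real.pi * a * r)) : ℂ) /
            (1 - starRingEnd ℂ (Complex.exp (2 * Real.pi * β * Complex.I)) * (Real.exp (-(2 * Real.pi * a)) : ℂ))
          + (Real.exp (2 * Real.pi * a * (r - 1)) : ℂ) * Complex.exp (2 * Real.pi * β * Complex.I) /
            (1 - Complex.exp (2 * Real.pi * β * Complex.I) * (Real.exp (-(2 * Real.pi * a)) : ℂ))) /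
        (2 * (2 * Real.pi * a) : ℂ))

/-- For `a > 0`, `lineKernel a β u = e^{2πiβ⌊u⌋} kernelK a β (u − ⌊u⌋)`. -/
theorem lineKernel_eq {a : ℝ} (ha : 0 < a) (β : ℝ) (u : ℝ) :
    lineKernel a β u = Complex.exp (2 * Real.pi * β * (⌊u⌋ : ℝ) * Complex.I) * kernelK a β (u - ⌊u⌋) := by
  simp only [lineKernel, kernelK, abs_of_pos ha]
  push_cast
  ring_nf

/-- `2π · lineKernel a β 0 = Σ₀(a,β)` (tree `twoPi_lineKernel_zero`). -/
theorem twoPi_lineKernel_zero' {a : ℝ} (ha : 0 < a) (β : ℝ) :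
    (2 * Real.pi : ℂ) * lineKernel a β 0 = ((sawSigma0 a β : ℝ) : ℂ) := by
  have h := twoPi_lineKernel_zero ha β
  have hz : Complex.exp (2 * Real.pi * β * Complex.I) = Complex.exp (((2 * Real.pi * β : ℝ) : ℂ) * Complex.I) := by push_cast; ring_nf
  simp only [lineKernel, Int.floor_zero, Int.cast_zero, Complex.ofReal_zero, sub_zero, mul_zero, zero_mul, neg_zero, Real.exp_zero,
    Complex.ofReal_one, Complex.exp_zero, one_mul, zero_sub, mul_neg, mul_one, abs_of_pos ha, hz]
  convert h using 3
  push_cast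
  ring

/-- `2π · conj (lineKernel a β ½) = S_β(a)` (tree `twoPi_conj_lineKernel_half`). -/
theorem twoPi_conj_lineKernel_half' {a : ℝ} (ha : 0 < a) (β : ℝ) :
    (2 * Real.pi : ℂ) * starRingEnd ℂ (lineKernel a β (1 / 2)) = sawS a β := by
  have h := twoPi_conj_lineKernel_half ha β
  have hz : Complex.exp (2 * Real.pi * β * Complex.I) = Complex.exp (((2 * Real.pi * β : ℝ) : ℂ) * Complex.I) := by push_cast; ring_nf
  have hfl : ⌊(1 / 2 : ℝ)⌋ = 0 := by norm_num [Int.floor_eq_zero_iff]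
  have he1 : Real.exp (-(2 * Real.pi * a * (1 / 2))) = Real.exp (-(a * Real.pi)) := by congr 1; ring
  have he2 : Real.exp (2 * Real.pi * a * (1 / 2 - 1)) = Real.exp (-(a * Real.pi)) := by congr 1; ring
  simp only [lineKernel, hfl, Int.cast_zero, Complex.ofReal_zero, sub_zero, mul_zero, zero_mul, Complex.exp_zero, one_mul,
    abs_of_pos ha, hz, he1, he2]
  convert h using 3
  push_cast
  ring

/-- The block entries spelled out. -/
theorem blockX_apply (a β : ℝ) :
    blockX a β 0 0 = (((2 * Real.pi * a : ℝ) : ℂ) * Complex.I) * (-(1 / 4 : ℂ) - 2 * lineKernel a β 0) ∧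
    blockX a β 0 1 = (((2 * Real.pi * a : ℝ) : ℂ) * Complex.I) * (-2 * lineKernel a β (1 / 2)) ∧
    blockX a β 1 0 = (((2 * Real.pi * a : ℝ) : ℂ) * Complex.I) * (2 * starRingEnd ℂ (lineKernel a β (1 / 2))) ∧
    blockX a β 1 1 = (((2 * Real.pi * a : ℝ) : ℂ) * Complex.I) * ((1 / 4 : ℂ) + 2 * lineKernel a β 0) := by
  simp [blockX, Matrix.smul_apply, smul_eq_mul]

/-! ## §4 (copy) -/

/-- The kernel is even in `a`. -/
theorem lineKernel_neg (a β y : ℝ) : lineKernel (-a) β y = lineKernel a β y := by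
  simp only [lineKernel, abs_neg]

/-- The transport phase at `−a` is the conjugate. -/
theorem transportPhase_neg (a θ y : ℝ) : transportPhase (-a) θ y = starRingEnd ℂ (transportPhase a θ y) := by
  simp only [transportPhase, ← Complex.exp_conj, map_mul, map_neg, Complex.conj_ofReal, Complex.conj_I]
  congr 1
  push_cast
  ring



/-! ## §8 (v2) The SHARP single-mode law by name: `‖sheetAmps a β θ (singleMode ξ) i‖ ≤ 0.889/a` for every mode and Bloch phase -/

/-- The single interior mode `e^{2πiξy}` (no sheets) — p2 g10's `K2StableCreation.singleMode`, verbatim. -/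
def singleMode (ξ : ℝ) : LamState := ⟨fun y => Complex.exp (((2 * Real.pi * ξ * y : ℝ) : ℂ) * Complex.I), []⟩

/-- The single-mode source at the kink line `y₀` as a function of the strain time (any Bloch phase). -/
def src (a β ξ y₀ : ℝ) : ℝ → ℂ := fun s =>
  ∫ y in (-(1 / 2 : ℝ))..(1 / 2 : ℝ), lineKernel a β (y₀ - y) * Complex.exp (((2 * Real.pi * ξ * y : ℝ) : ℂ) * Complex.I) *
    Complex.exp (-((2 * Real.pi * a * s * triWave y : ℝ) : ℂ) * Complex.I)

/-- The forcing of the single mode: `f(s) = (2πia·(−2)·src(¼,s), 2πia·2·src(−¼,s))`. -/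
theorem forcing_singleMode (a β ξ s : ℝ) :
    forcing a β (singleMode ξ) s = ![((2 * Real.pi * a : ℝ) * Complex.I : ℂ) * (-2) * src a β ξ (1 / 4) s,
      ((2 * Real.pi * a : ℝ) * Complex.I : ℂ) * 2 * src a β ξ (-(1 / 4)) s] := by
  simp only [forcing, singleMode, transportPhase, src, List.map_nil, List.sum_nil, add_zero]

/-- Stability for every Bloch phase at `a ≥ 1`. -/
theorem khLam_lt_zero_beta {a : ℝ} (ha : 1 ≤ a) (β : ℝ) : khLam a β < 0 := by
  unfold khLam
  have h := sawC2_ge ha β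
  have : 0 < a ^ 2 * sawC2 a β := by positivity
  linarith

/-- `√(−λ) = a√(max 0 c²)` for every Bloch phase. -/
theorem sqrt_neg_khLam_eq_beta {a : ℝ} (ha : 1 ≤ a) (β : ℝ) : Real.sqrt (-(khLam a β)) = a * Real.sqrt (max 0 (sawC2 a β)) := by
  unfold khLam
  have hc : 0 ≤ sawC2 a β := by linarith [sawC2_ge ha β]
  rw [neg_neg, max_eq_right hc, Real.sqrt_mul' _ hc, Real.sqrt_sq (by linarith)]

/-- Stable propagator entries for every Bloch phase. -/
theorem propC_eq_beta {a : ℝ} (ha : 1 ≤ a) (β t : ℝ) : propC a β t = Real.cos (Real.sqrt (-(khLam a β)) * t) := by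
  have h := khLam_lt_zero_beta ha β
  simp only [propC, if_neg (not_lt.2 h.le), if_pos h]

/-- Stable propagator entries for every Bloch phase. -/
theorem propSn_eq_beta {a : ℝ} (ha : 1 ≤ a) (β t : ℝ) :
    propSn a β t = Real.sin (Real.sqrt (-(khLam a β)) * t) / Real.sqrt (-(khLam a β)) := by
  have h := khLam_lt_zero_beta ha β
  simp only [propSn, if_neg (not_lt.2 h.le), if_pos h]

/-- The single-mode sources are continuous in the strain time. -/
theorem continuous_src {a : ℝ} (ha : 0 < a) (β ξ : ℝ) {y₀ : ℝ} (hy₀ : y₀ = 1 / 4 ∨ y₀ = -(1 / 4)) : Continuous (src a β ξ y₀) :=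
  continuous_singleMode_src ha β ξ (K := kernelK a β) rfl (lineKernel_eq ha β) hy₀

/-- **Two-envelope bounds of the single-mode sources** (tree `norm_src_quarter_mode_le`, `norm_src_negQuarter_mode_le`). -/
theorem norm_src_le {a : ℝ} (ha : 0 < a) (β ξ : ℝ) {y₀ : ℝ} (hy₀ : y₀ = 1 / 4 ∨ y₀ = -(1 / 4)) (s : ℝ) :
    ‖src a β ξ y₀ s‖ ≤ (1 + 2 * Real.exp (-(2 * Real.pi * a) / 4) + 2 * Real.exp (-(2 * Real.pi * a) / 4) ^ 2 +
        2 * Real.exp (-(2 * Real.pi * a) / 4) ^ 3 + Real.exp (-(2 * Real.pi * a) / 4) ^ 4) /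
          (((1 - Real.exp (-(2 * Real.pi * a))) * (2 * (2 * Real.pi * a))) * ((2 * Real.pi * a) * Real.sqrt (1 + (ξ / a + 1 * s) ^ 2))) +
        (1 + 2 * Real.exp (-(2 * Real.pi * a) / 4) ^ 2 + Real.exp (-(2 * Real.pi * a) / 4) ^ 4) /
          (((1 - Real.exp (-(2 * Real.pi * a))) * (2 * (2 * Real.pi * a))) * ((2 * Real.pi * a) * Real.sqrt (1 + (ξ / a + (-1) * s) ^ 2))) := by
  rcases hy₀ with h | h <;> subst h
  · exact norm_src_quarter_mode_le ha β ξ s (K := kernelK a β) (G := lineKernel a β) rfl (lineKernel_eq ha β)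
  · exact norm_src_negQuarter_mode_le ha β ξ s (K := kernelK a β) (G := lineKernel a β) rfl (lineKernel_eq ha β)

/-- The Duhamel integrand of the single mode is continuous in the strain time. -/
theorem continuous_duhamelIntegrand_singleMode {a : ℝ} (ha : 1 ≤ a) (β ξ θ : ℝ) :
    Continuous fun s : ℝ => (propagator a β (θ - s)).mulVec (forcing a β (singleMode ξ) s) := by
  have ha0 : 0 < a := by linarith
  have hs0 := continuous_src ha0 β ξ (y₀ := 1 / 4) (Or.inl rfl)
  have hs1 := continuous_src ha0 β ξ (y₀ := -(1 / 4)) (Or.inr rfl)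
  apply continuous_pi
  intro j
  simp only [forcing_singleMode, propagator, propC_eq_beta ha, propSn_eq_beta ha, Matrix.add_mulVec, Matrix.smul_mulVec, Matrix.one_mulVec]
  simp only [Pi.add_apply, Pi.smul_apply, smul_eq_mul, Matrix.mulVec, dotProduct, Fin.sum_univ_two]
  fin_cases j
  · simp only [Fin.zero_eta, Fin.isValue, Matrix.cons_val_zero, Matrix.cons_val_one]
    fun_prop
  · simp only [Fin.mk_one, Fin.isValue, Matrix.cons_val_zero, Matrix.cons_val_one]
    fun_prop

/-- **Reduction, component `0`** (any Bloch phase, `a ≥ 1`). -/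
theorem sheetAmps_singleMode_apply_0 {a : ℝ} (ha : 1 ≤ a) (β ξ θ : ℝ) :
    sheetAmps a β θ (singleMode ξ) 0 = ∫ s in (0 : ℝ)..θ,
      ((Real.cos (Real.sqrt (-(khLam a β)) * (θ - s)) : ℂ) * ((((2 * Real.pi * a : ℝ) * Complex.I : ℂ) * (-2)) * src a β ξ (1 / 4) s) +
        ((Real.sin (Real.sqrt (-(khLam a β)) * (θ - s)) / Real.sqrt (-(khLam a β)) : ℝ) : ℂ) *
          (blockX a β 0 0 * ((((2 * Real.pi * a : ℝ) * Complex.I : ℂ) * (-2)) * src a β ξ (1 / 4) s) +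
            blockX a β 0 1 * ((((2 * Real.pi * a : ℝ) * Complex.I : ℂ) * 2) * src a β ξ (-(1 / 4)) s))) := by
  have hint := (continuous_duhamelIntegrand_singleMode ha β ξ θ).intervalIntegrable (μ := volume) 0 θ
  have hcomp := ((ContinuousLinearMap.proj (R := ℂ) (φ := fun _ : Fin 2 => ℂ) (0 : Fin 2)).intervalIntegral_comp_comm hint).symm
  simp only [ContinuousLinearMap.proj_apply] at hcomp
  unfold sheetAmps
  rw [hcomp]
  refine intervalIntegral.integral_congr fun s _ => ?_
  simp only [forcing_singleMode, propagator, propC_eq_beta ha, propSn_eq_beta ha, Matrix.add_mulVec, Matrix.smul_mulVec, Matrix.one_mulVec]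
  simp only [Pi.add_apply, Pi.smul_apply, smul_eq_mul, Matrix.mulVec, dotProduct, Fin.sum_univ_two, Fin.isValue, Matrix.cons_val_zero,
    Matrix.cons_val_one]

/-- **Reduction, component `1`** (any Bloch phase, `a ≥ 1`). -/
theorem sheetAmps_singleMode_apply_1 {a : ℝ} (ha : 1 ≤ a) (β ξ θ : ℝ) :
    sheetAmps a β θ (singleMode ξ) 1 = ∫ s in (0 : ℝ)..θ,
      ((Real.cos (Real.sqrt (-(khLam a β)) * (θ - s)) : ℂ) * ((((2 * Real.pi * a : ℝ) * Complex.I : ℂ) * 2) * src a β ξ (-(1 / 4)) s) +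
        ((Real.sin (Real.sqrt (-(khLam a β)) * (θ - s)) / Real.sqrt (-(khLam a β)) : ℝ) : ℂ) *
          (blockX a β 1 0 * ((((2 * Real.pi * a : ℝ) * Complex.I : ℂ) * (-2)) * src a β ξ (1 / 4) s) +
            blockX a β 1 1 * ((((2 * Real.pi * a : ℝ) * Complex.I : ℂ) * 2) * src a β ξ (-(1 / 4)) s))) := by
  have hint := (continuous_duhamelIntegrand_singleMode ha β ξ θ).intervalIntegrable (μ := volume) 0 θ
  have hcomp := ((ContinuousLinearMap.proj (R := ℂ) (φ := fun _ : Fin 2 => ℂ) (1 : Fin 2)).intervalIntegral_comp_comm hint).symm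
  simp only [ContinuousLinearMap.proj_apply] at hcomp
  unfold sheetAmps
  rw [hcomp]
  refine intervalIntegral.integral_congr fun s _ => ?_
  simp only [forcing_singleMode, propagator, propC_eq_beta ha, propSn_eq_beta ha, Matrix.add_mulVec, Matrix.smul_mulVec, Matrix.one_mulVec]
  simp only [Pi.add_apply, Pi.smul_apply, smul_eq_mul, Matrix.mulVec, dotProduct, Fin.sum_univ_two, Fin.isValue, Matrix.cons_val_zero,
    Matrix.cons_val_one]

/-- **THE SHARP SINGLE-MODE CREATION LAW BY NAME** (P2-E6 kernel): for `a ≥ 4`, `0 ≤ θ ≤ 8`, EVERY Bloch phase `β` and EVERY interior mode `ξ`,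
`‖sheetAmps a β θ (singleMode ξ) i‖ ≤ 0.889/a` (`i = 0, 1`) — the tree's `8.5/a` (`…KHSingleModeCreation`, p2 g10) divided by `9.5`. -/
theorem norm_sheetAmps_singleMode_le {a : ℝ} (ha : 4 ≤ a) (β ξ : ℝ) {θ : ℝ} (hθ0 : 0 ≤ θ) (hθ : θ ≤ 8) (i : Fin 2) :
    ‖sheetAmps a β θ (singleMode ξ) i‖ ≤ 0.889 / a := by
  have ha1 : 1 ≤ a := by linarith
  have ha0 : 0 < a := by linarith
  have h0 := twoPi_lineKernel_zero' ha0 β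
  have hh := twoPi_conj_lineKernel_half' ha0 β
  have hE₀ := norm_src_le ha0 β ξ (y₀ := 1 / 4) (Or.inl rfl)
  have hE₁ := norm_src_le ha0 β ξ (y₀ := -(1 / 4)) (Or.inr rfl)
  obtain ⟨e00, e01, e10, e11⟩ := blockX_apply a β
  fin_cases i
  · simp only [Fin.zero_eta, Fin.isValue]
    rw [sheetAmps_singleMode_apply_0 ha1, sqrt_neg_khLam_eq_beta ha1, e00, e01]
    exact mode_creation_num_le ha hθ0 hθ h0 hh hE₀ hE₁
  · simp only [Fin.mk_one, Fin.isValue]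
    rw [sheetAmps_singleMode_apply_1 ha1, sqrt_neg_khLam_eq_beta ha1, e10, e11]
    exact mode_creation_num_le' ha hθ0 hθ h0 hh hE₀ hE₁

/-! ## §9 (v2, E6-a) Finite mode profiles: linearity and the ξ-resolved COHERENT creation bound per line -/

/-- The forcing is linear in the interior content (tree `integral_forcing_finset_sum`). -/
theorem forcing_modeProfile {a : ℝ} (ha : 0 < a) (β s : ℝ) (K : ℕ) (c : ℤ → ℂ) :
    forcing a β ⟨modeProfile β K c, []⟩ s = ∑ n ∈ win K, c n • forcing a β (singleMode (β + n)) s := by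
  have h1 := integral_forcing_finset_sum ha β s (K := kernelK a β) rfl (lineKernel_eq ha β) (y₀ := 1 / 4) (Or.inl rfl) (win K) c
  have h2 := integral_forcing_finset_sum ha β s (K := kernelK a β) rfl (lineKernel_eq ha β) (y₀ := -(1 / 4)) (Or.inr rfl) (win K) c
  ext i
  rw [Finset.sum_apply]
  fin_cases i
  · simp only [forcing, modeProfile, singleMode, transportPhase, List.map_nil, List.sum_nil, add_zero, Fin.zero_eta, Fin.isValue,
      Matrix.cons_val_zero, Pi.smul_apply, smul_eq_mul]
    rw [h1, Finset.mul_sum]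
    exact Finset.sum_congr rfl fun n _ => by ring
  · simp only [forcing, modeProfile, singleMode, transportPhase, List.map_nil, List.sum_nil, add_zero, Fin.mk_one, Fin.isValue,
      Matrix.cons_val_one, Matrix.cons_val_zero, Pi.smul_apply, smul_eq_mul]
    rw [h2, Finset.mul_sum]
    exact Finset.sum_congr rfl fun n _ => by ring

/-- **Linearity of the created amplitudes** over a finite mode profile (`a ≥ 1`). -/
theorem sheetAmps_modeProfile {a : ℝ} (ha : 1 ≤ a) (β θ : ℝ) (K : ℕ) (c : ℤ → ℂ) :
    sheetAmps a β θ ⟨modeProfile β K c, []⟩ = ∑ n ∈ win K, c n • sheetAmps a β θ (singleMode (β + n)) := by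
  have ha0 : 0 < a := by linarith
  unfold sheetAmps
  simp_rw [forcing_modeProfile ha0, Matrix.mulVec_sum, Matrix.mulVec_smul]
  have hint : ∀ n ∈ win K, IntervalIntegrable (fun s => c n • (propagator a β (θ - s)).mulVec (forcing a β (singleMode (β + n)) s))
      volume 0 θ := fun n _ => ((continuous_duhamelIntegrand_singleMode ha β (β + n) θ).intervalIntegrable (μ := volume) _ _).smul (c n)
  rw [intervalIntegral.integral_finsetSum hint]
  refine Finset.sum_congr rfl fun n _ => ?_
  exact intervalIntegral.integral_smul _ _


/-! ## §16 (copy) straight H-pair energy, evenness -/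

/-- **Straight H-pair energy BY NAME (upper).** For a class `(α, β)` with `β ∈ [0,1]` and H-pair densities `q` vanishing on the zero line `α + m = 0`:
`cEnergy α β ℓ K (hPairState β q) ≤ (1/(4π²4^ℓ))·Σ_{|m| ≤ K} (‖q m 0‖² + ‖q m 1‖²)·(π/|α+m| + 4/(α+m)²)` (tree `vPair_column_energy_upper`, rows ↔ columns). -/
theorem cEnergy_hPairState_le {β : ℝ} (hβ0 : 0 ≤ β) (hβ1 : β ≤ 1) (α : ℝ) (ℓ K : ℕ) (q : ℤ → Fin 2 → ℂ)
    (hq : ∀ m ∈ win K, α + (m : ℝ) = 0 → q m = 0) :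
    cEnergy α β ℓ K (hPairState β q) ≤
      (1 / (4 * Real.pi ^ 2 * (4 : ℝ) ^ ℓ)) * ∑ m ∈ win K, (‖q m 0‖ ^ 2 + ‖q m 1‖ ^ 2) * (Real.pi / |α + m| + 4 / (α + m) ^ 2) := by
  unfold cEnergy
  rw [Finset.mul_sum]
  refine Finset.sum_le_sum fun m hm => ?_
  have e : ∀ (v : ℂ) (n : ℤ), ‖v‖ ^ 2 / (4 * Real.pi ^ 2 * (4 : ℝ) ^ ℓ * ((α + m) ^ 2 + (β + n) ^ 2)) =
      (1 / (4 * Real.pi ^ 2 * (4 : ℝ) ^ ℓ)) * (‖v‖ ^ 2 / ((β + n) ^ 2 + (α + m) ^ 2)) := by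
    intro v n
    rw [add_comm ((α + (m : ℝ)) ^ 2), mul_comm (4 * Real.pi ^ 2 * (4 : ℝ) ^ ℓ) ((β + (n : ℝ)) ^ 2 + (α + m) ^ 2), ← div_div,
      div_eq_mul_one_div, mul_comm]
  simp only [hPairState]
  simp_rw [e, ← Finset.mul_sum]
  refine mul_le_mul_of_nonneg_left ?_ (by positivity)
  rcases eq_or_ne (α + (m : ℝ)) 0 with hb | hb
  · have h0 : q m = 0 := hq m hm hb
    simp [h0]
  · exact vPair_column_energy_upper hβ0 hβ1 hb K (q m 0) (q m 1)

/-- `c²` is even in the Bloch phase (tree `sawSigma0_neg_bloch`, `sawS_neg_bloch`). -/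
theorem sawC2_neg_bloch (a β : ℝ) : sawC2 a (-β) = sawC2 a β := by
  unfold sawC2
  rw [sawSigma0_neg_bloch, sawS_neg_bloch, Complex.normSq_conj]

/-! ## §17 (v10) P2-S at general Bloch phase: `(a, β, ξ) ↦ (−a, −β, −ξ)` is complex conjugation — the creation law for NEGATIVE lines -/

/-- `conj (lineKernel a β y) = lineKernel a (−β) y`. -/
theorem conj_lineKernel (a β y : ℝ) : starRingEnd ℂ (lineKernel a β y) = lineKernel a (-β) y := by
  have hz : starRingEnd ℂ (Complex.exp (2 * Real.pi * β * Complex.I)) = Complex.exp (2 * Real.pi * (((-β : ℝ)) : ℂ) * Complex.I) := by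
    rw [← Complex.exp_conj]; congr 1
    simp only [map_mul, map_ofNat, Complex.conj_ofReal, Complex.conj_I]; push_cast; ring
  have hz' : starRingEnd ℂ (Complex.exp (2 * Real.pi * β * (⌊y⌋ : ℝ) * Complex.I)) = Complex.exp (2 * Real.pi * (((-β : ℝ)) : ℂ) * (⌊y⌋ : ℝ) * Complex.I) := by
    rw [← Complex.exp_conj]; congr 1
    simp only [map_mul, map_ofNat, Complex.conj_ofReal, Complex.conj_I]; push_cast; ring
  simp only [lineKernel, map_mul, map_div₀, map_add, map_neg, map_sub, map_one, map_ofNat, Complex.conj_ofReal, hz, hz']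

/-- `sawQ (−k) = (sawQ k)⁻¹`. -/
theorem sawQ_neg (k : ℝ) : sawQ (-k) = (sawQ k)⁻¹ := by
  simp only [sawQ, mul_neg, neg_neg, ← Real.exp_neg]

/-- `Σ₀` is even in the streamwise wavenumber (`k ≠ 0`). -/
theorem sawSigma0_neg_arg {k : ℝ} (hk : k ≠ 0) (β : ℝ) : sawSigma0 (-k) β = sawSigma0 k β := by
  have hq : 0 < sawQ k := Real.exp_pos _
  have hq1 : sawQ k ≠ 1 := by
    simp only [sawQ]; rw [Ne, Real.exp_eq_one_iff]; intro h; apply hk; nlinarith [Real.pi_pos]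
  have hc : Real.cos (2 * Real.pi * β) ≤ 1 := Real.cos_le_one _
  have hc' : -1 ≤ Real.cos (2 * Real.pi * β) := Real.neg_one_le_cos _
  have hden : 1 - 2 * sawQ k * Real.cos (2 * Real.pi * β) + sawQ k ^ 2 ≠ 0 := by
    intro h
    have h1 : (1 - sawQ k) ^ 2 ≤ 1 - 2 * sawQ k * Real.cos (2 * Real.pi * β) + sawQ k ^ 2 := by nlinarith
    have h2 : (1 - sawQ k) ^ 2 = 0 := le_antisymm (by rw [← h]; exact h1) (sq_nonneg _)
    exact hq1 (by nlinarith [pow_eq_zero_iff (n := 2) (two_ne_zero) |>.1 h2])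
  unfold sawSigma0
  rw [sawQ_neg]
  field_simp
  ring

/-- `S` is even in the streamwise wavenumber (`k ≠ 0`). -/
theorem sawS_neg_arg {k : ℝ} (hk : k ≠ 0) (β : ℝ) : sawS (-k) β = sawS k β := by
  have hq : 0 < sawQ k := Real.exp_pos _
  have hq1 : sawQ k ≠ 1 := by
    simp only [sawQ]; rw [Ne, Real.exp_eq_one_iff]; intro h; apply hk; nlinarith [Real.pi_pos]
  set z : ℂ := Complex.exp (((2 * Real.pi * β : ℝ) : ℂ) * Complex.I) with hz
  set Q : ℂ := ((sawQ k : ℝ) : ℂ) with hQ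
  have hzn : ‖z‖ = 1 := by rw [hz, Complex.norm_exp_ofReal_mul_I]
  have hz0 : z ≠ 0 := by intro h; rw [h, norm_zero] at hzn; exact zero_ne_one hzn
  have hzz : z * starRingEnd ℂ z = 1 := by
    rw [Complex.mul_conj, Complex.normSq_eq_norm_sq, hzn]; norm_num
  have hzbar : starRingEnd ℂ z = z⁻¹ := by
    have := congrArg (fun w => z⁻¹ * w) hzz
    simp only [← mul_assoc, inv_mul_cancel₀ hz0, one_mul, mul_one] at this
    exact this
  have hQ0 : Q ≠ 0 := by rw [hQ]; exact_mod_cast hq.ne'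
  have hQn : ‖Q‖ = sawQ k := by rw [hQ, Complex.norm_real, Real.norm_eq_abs, abs_of_pos hq]
  -- the two non-resonance facts `z ≠ Q`, `zQ ≠ 1`
  have F2 : Q - z ≠ 0 := by
    intro h
    have : ‖Q‖ = ‖z‖ := by rw [sub_eq_zero.1 h]
    rw [hQn, hzn] at this
    exact hq1 this
  have F1 : 1 - z * Q ≠ 0 := by
    intro h
    have : ‖z * Q‖ = 1 := by rw [← sub_eq_zero.1 h]; exact norm_one
    rw [norm_mul, hzn, hQn, one_mul] at this
    exact hq1 this
  have F3 : Q - z⁻¹ ≠ 0 := by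
    intro h
    have h' : z * Q = 1 := by
      have := congrArg (fun w => z * w) (sub_eq_zero.1 h)
      simpa [mul_inv_cancel₀ hz0] using this
    exact F1 (by rw [h']; ring)
  have F4 : z - Q ≠ 0 := by intro h; exact F2 (by rw [← neg_sub, h, neg_zero])
  have F1' : 1 - Q * z ≠ 0 := by rwa [mul_comm] at F1
  have F1'' : -1 + Q * z ≠ 0 := by
    intro h; apply F1'; linear_combination -h
  have F5 : Q * z - 1 ≠ 0 := by
    intro h; apply F1'; linear_combination -h
  have hk' : (k : ℂ) ≠ 0 := by exact_mod_cast hk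
  -- rewrite everything in terms of `z`, `z⁻¹`, `Q`, `Q⁻¹`
  have hexp : ((Real.exp (-(-k * Real.pi)) / (2 * -k) : ℝ) : ℂ) = -(((Real.exp (-(k * Real.pi)) / (2 * k) : ℝ) : ℂ) * Q⁻¹ * Q⁻¹ * Q) := by
    have e1 : Real.exp (-(-k * Real.pi)) = Real.exp (-(k * Real.pi)) * ((sawQ k)⁻¹) := by
      rw [sawQ, ← Real.exp_neg, ← Real.exp_add]; congr 1; ring
    rw [e1, hQ]; push_cast; field_simp
  simp only [sawS, sawQ_neg]
  rw [← hz, hzbar, hexp]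
  push_cast
  rw [← hQ]
  field_simp
  ring


/-- `c²` is even in the streamwise wavenumber (`a ≠ 0`). -/
theorem sawC2_neg_arg {a : ℝ} (ha : a ≠ 0) (β : ℝ) : sawC2 (-a) β = sawC2 a β := by
  unfold sawC2
  rw [sawSigma0_neg_arg ha, sawS_neg_arg ha]

/-- `λ(−a, −β) = λ(a, β)` (`a ≠ 0`). -/
theorem khLam_neg_neg {a : ℝ} (ha : a ≠ 0) (β : ℝ) : khLam (-a) (-β) = khLam a β := by
  unfold khLam
  rw [sawC2_neg_bloch, sawC2_neg_arg ha, neg_sq]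

/-- The propagator scalars at `(−a, −β)`. -/
theorem propC_neg_neg {a : ℝ} (ha : a ≠ 0) (β t : ℝ) : propC (-a) (-β) t = propC a β t := by
  simp only [propC, khLam_neg_neg ha]

/-- The propagator scalars at `(−a, −β)`. -/
theorem propSn_neg_neg {a : ℝ} (ha : a ≠ 0) (β t : ℝ) : propSn (-a) (-β) t = propSn a β t := by
  simp only [propSn, khLam_neg_neg ha]

/-- The block at `(−a, −β)` is the entrywise conjugate of the block at `(a, β)`. -/
theorem blockX_neg_neg (a β : ℝ) (i j : Fin 2) : blockX (-a) (-β) i j = starRingEnd ℂ (blockX a β i j) := by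
  obtain ⟨e00, e01, e10, e11⟩ := blockX_apply (-a) (-β)
  obtain ⟨f00, f01, f10, f11⟩ := blockX_apply a β
  have hG : lineKernel a (-β) 0 = starRingEnd ℂ (lineKernel a β 0) := (conj_lineKernel a β 0).symm
  have hH : lineKernel a (-β) (1 / 2) = starRingEnd ℂ (lineKernel a β (1 / 2)) := (conj_lineKernel a β (1 / 2)).symm
  fin_cases i <;> fin_cases j
  · simp only [Fin.zero_eta, Fin.isValue, e00, f00, lineKernel_neg, hG, map_mul, map_sub, map_neg, map_div₀, map_one, map_ofNat,
      Complex.conj_ofReal, Complex.conj_I]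
    push_cast; ring
  · simp only [Fin.zero_eta, Fin.mk_one, Fin.isValue, e01, f01, lineKernel_neg, hH, map_mul, map_neg, map_ofNat, Complex.conj_ofReal,
      Complex.conj_I]
    push_cast; ring
  · simp only [Fin.zero_eta, Fin.mk_one, Fin.isValue, e10, f10, lineKernel_neg, hH, map_mul, map_ofNat, Complex.conj_ofReal, Complex.conj_I,
      Complex.conj_conj]
    push_cast; ring
  · simp only [Fin.mk_one, Fin.isValue, e11, f11, lineKernel_neg, hG, map_mul, map_add, map_div₀, map_one, map_ofNat, Complex.conj_ofReal,
      Complex.conj_I]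
    push_cast; ring

/-- The propagator at `(−a, −β)` is the entrywise conjugate (`a ≠ 0`). -/
theorem propagator_neg_neg {a : ℝ} (ha : a ≠ 0) (β t : ℝ) (i j : Fin 2) :
    propagator (-a) (-β) t i j = starRingEnd ℂ (propagator a β t i j) := by
  simp only [propagator, Matrix.add_apply, Matrix.smul_apply, smul_eq_mul, propC_neg_neg ha, propSn_neg_neg ha, map_add, map_mul,
    Complex.conj_ofReal, blockX_neg_neg]
  congr 2
  fin_cases i <;> fin_cases j <;> simp

/-- The transport phase at `−a` is the conjugate (any strain time). -/
theorem transportPhase_neg' (a s y : ℝ) : transportPhase (-a) s y = starRingEnd ℂ (transportPhase a s y) := transportPhase_neg a s y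

/-- **The forcing of a CONJUGATED interior at `(−a, −β)` is the conjugate of the forcing** (no sheets). -/
theorem forcing_neg_neg_nosheet (a β : ℝ) (g : ℝ → ℂ) (s : ℝ) (j : Fin 2) :
    forcing (-a) (-β) ⟨fun y => starRingEnd ℂ (g y), []⟩ s j = starRingEnd ℂ (forcing a β ⟨g, []⟩ s j) := by
  have hsrc : ∀ y₀ : ℝ, (∫ y in (-(1 / 2 : ℝ))..(1 / 2), lineKernel (-a) (-β) (y₀ - y) * starRingEnd ℂ (g y) * transportPhase (-a) s y) =
      starRingEnd ℂ (∫ y in (-(1 / 2 : ℝ))..(1 / 2), lineKernel a β (y₀ - y) * g y * transportPhase a s y) := by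
    intro y₀
    rw [← intervalIntegral.intervalIntegral_conj]
    refine intervalIntegral.integral_congr fun y _ => ?_
    simp only [map_mul, conj_lineKernel, lineKernel_neg, transportPhase_neg']
  fin_cases j
  · simp only [forcing, List.map_nil, List.sum_nil, add_zero, Fin.zero_eta, Fin.isValue, Matrix.cons_val_zero, hsrc, map_mul, map_neg,
      map_ofNat, Complex.conj_ofReal, Complex.conj_I]
    push_cast; ring
  · simp only [forcing, List.map_nil, List.sum_nil, add_zero, Fin.mk_one, Fin.isValue, Matrix.cons_val_one, Matrix.cons_val_zero, hsrc, map_mul,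
      map_ofNat, Complex.conj_ofReal, Complex.conj_I]
    push_cast; ring

/-- The Duhamel integrand at `(−a, −β)` with conjugated interior is the componentwise conjugate (`a ≠ 0`). -/
theorem duhamelIntegrand_neg_neg_nosheet {a : ℝ} (ha : a ≠ 0) (β θ s : ℝ) (g : ℝ → ℂ) :
    (propagator (-a) (-β) (θ - s)).mulVec (forcing (-a) (-β) ⟨fun y => starRingEnd ℂ (g y), []⟩ s) =
      star ((propagator a β (θ - s)).mulVec (forcing a β ⟨g, []⟩ s)) := by
  funext i
  simp only [Matrix.mulVec, dotProduct, Fin.sum_univ_two, Pi.star_apply, propagator_neg_neg ha, forcing_neg_neg_nosheet, star_add, star_mul',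
    Complex.star_def]

/-- The conjugate of a mode profile is the mode profile of the reflected class with reflected, conjugated coefficients. -/
theorem conj_modeProfile (β : ℝ) (K : ℕ) (c : ℤ → ℂ) (y : ℝ) :
    starRingEnd ℂ (modeProfile β K c y) = modeProfile (-β) K (fun n => starRingEnd ℂ (c (-n))) y := by
  simp only [modeProfile, map_sum, map_mul]
  refine Finset.sum_nbij' (fun n => -n) (fun n => -n) (fun n hn => by simp only [win, Finset.mem_Icc] at hn ⊢; omega) (fun n hn => by simp only [win, Finset.mem_Icc] at hn ⊢; omega)
    (fun n _ => neg_neg n) (fun n _ => neg_neg n) (fun n _ => ?_)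
  rw [neg_neg, ← Complex.exp_conj, map_mul, Complex.conj_ofReal, Complex.conj_I]
  congr 1
  push_cast
  ring

/-- **P2-S for profile states (any Bloch phase):** `sheetAmps (−a) (−β) θ ⟨modeProfile (−β) K c̃, []⟩ i = conj (sheetAmps a β θ ⟨modeProfile β K c, []⟩ i)`
with `c̃ n = conj (c (−n))` (`a ≥ 1`). -/
theorem sheetAmps_neg_neg_modeProfile {a : ℝ} (ha : 1 ≤ a) (β θ : ℝ) (K : ℕ) (c : ℤ → ℂ) (i : Fin 2) :
    sheetAmps (-a) (-β) θ ⟨modeProfile (-β) K (fun n => starRingEnd ℂ (c (-n))), []⟩ i =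
      starRingEnd ℂ (sheetAmps a β θ ⟨modeProfile β K c, []⟩ i) := by
  have ha0 : a ≠ 0 := by linarith
  -- the integrand at `(a, β)` is a finite sum of single-mode integrands, hence continuous
  have hF : Continuous fun s : ℝ => (propagator a β (θ - s)).mulVec (forcing a β ⟨modeProfile β K c, []⟩ s) := by
    have e : (fun s : ℝ => (propagator a β (θ - s)).mulVec (forcing a β ⟨modeProfile β K c, []⟩ s)) =
        fun s : ℝ => ∑ n ∈ win K, c n • (propagator a β (θ - s)).mulVec (forcing a β (singleMode (β + n)) s) := by
      funext s
      rw [forcing_modeProfile (by linarith : (0 : ℝ) < a) β s K c, Matrix.mulVec_sum]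
      refine Finset.sum_congr rfl fun n _ => ?_
      rw [Matrix.mulVec_smul]
    rw [e]
    exact continuous_finsetSum _ fun n _ => (continuous_duhamelIntegrand_singleMode ha β (β + n) θ).const_smul (c n)
  -- the interior at `(−a, −β)` is the conjugated interior
  have hint_eq : (⟨modeProfile (-β) K (fun n => starRingEnd ℂ (c (-n))), []⟩ : LamState) = ⟨fun y => starRingEnd ℂ (modeProfile β K c y), []⟩ := by
    congr 1
    funext y
    rw [conj_modeProfile]
  rw [hint_eq]
  have e : (fun s : ℝ => (propagator (-a) (-β) (θ - s)).mulVec (forcing (-a) (-β) ⟨fun y => starRingEnd ℂ (modeProfile β K c y), []⟩ s)) =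
      fun s : ℝ => star ((propagator a β (θ - s)).mulVec (forcing a β ⟨modeProfile β K c, []⟩ s)) :=
    funext fun s => duhamelIntegrand_neg_neg_nosheet ha0 β θ s (modeProfile β K c)
  have hF' : Continuous fun s : ℝ => (propagator (-a) (-β) (θ - s)).mulVec (forcing (-a) (-β) ⟨fun y => starRingEnd ℂ (modeProfile β K c y), []⟩ s) := by
    rw [e]; exact continuous_star.comp hF
  have hint := hF.intervalIntegrable (μ := volume) 0 θ
  have hint' := hF'.intervalIntegrable (μ := volume) 0 θ
  have h1 := ((ContinuousLinearMap.proj (R := ℂ) (φ := fun _ : Fin 2 => ℂ) i).intervalIntegral_comp_comm hint).symm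
  have h2 := ((ContinuousLinearMap.proj (R := ℂ) (φ := fun _ : Fin 2 => ℂ) i).intervalIntegral_comp_comm hint').symm
  simp only [ContinuousLinearMap.proj_apply] at h1 h2
  unfold sheetAmps
  rw [h1, h2, ← intervalIntegral.intervalIntegral_conj]
  refine intervalIntegral.integral_congr fun s _ => ?_
  have := congrFun (duhamelIntegrand_neg_neg_nosheet ha0 β θ s (modeProfile β K c)) i
  simp only [Pi.star_apply, Complex.star_def] at this
  exact this


/-! ## §21 (p2 g12) THE PAIRED SINGLE-MODE LAW BY NAME and the best per-mode creation weight -/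

/-- **Paired envelope of the single-mode sources at a lattice mode `ξ = β + n`** (tree `norm_src_lattice_env_le`, p713713). -/
theorem norm_src_lattice_le {a : ℝ} (ha : 0 < a) (β : ℝ) (n : ℤ) {y₀ : ℝ} (hy₀ : y₀ = 1 / 4 ∨ y₀ = -(1 / 4)) (s : ℝ) :
    ‖src a β (β + n) y₀ s‖ ≤
      (1 + Real.exp (-(2 * Real.pi * a)) + 2 * Real.exp (-(2 * Real.pi * a) / 4) ^ 2) * (1 + |s| / 2) *
          (1 / (1 + ((β + n) / a + 1 * s) ^ 2) + 1 / (1 + ((β + n) / a + (-1) * s) ^ 2)) /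
        ((1 - Real.exp (-(2 * Real.pi * a))) * (2 * Real.pi * a) ^ 2) :=
  norm_src_lattice_env_le ha β n rfl hy₀ s (K := kernelK a β) (G := lineKernel a β) rfl (lineKernel_eq ha β)

/-- **THE PAIRED SINGLE-MODE CREATION LAW BY NAME** (`a ≥ 1`, `θ ≥ 0`, any Bloch phase `β`, lattice mode `ξ = β + n`):
`‖sheetAmps a β θ (singleMode (β+n)) i‖ ≤ 4πa(ap+2a‖S‖)/ω · (1+q+2x²)(1+θ/2)(arctan((β+n)/a+θ) − arctan((β+n)/a−θ))/((1−q)κ²)` — the weight that decays like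
`a/ξ²` for far modes (tree `mode_component_paired_le`, p714232). -/
theorem norm_sheetAmps_singleMode_paired {a : ℝ} (ha : 1 ≤ a) (β : ℝ) (n : ℤ) {θ : ℝ} (hθ0 : 0 ≤ θ) (i : Fin 2) :
    ‖sheetAmps a β θ (singleMode (β + n)) i‖ ≤
      4 * Real.pi * a * (a * (Real.pi / 2 + 2 * sawSigma0 a β) + 2 * a * ‖sawS a β‖) / (a * Real.sqrt (max 0 (sawC2 a β))) *
        ((1 + Real.exp (-(2 * Real.pi * a)) + 2 * Real.exp (-(2 * Real.pi * a) / 4) ^ 2) * (1 + θ / 2) *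
          (Real.arctan ((β + n) / a + θ) - Real.arctan ((β + n) / a - θ)) / ((1 - Real.exp (-(2 * Real.pi * a))) * (2 * Real.pi * a) ^ 2)) := by
  have ha0 : 0 < a := by linarith
  have h0 := twoPi_lineKernel_zero' ha0 β
  have hh := twoPi_conj_lineKernel_half' ha0 β
  have hE₀ := norm_src_lattice_le ha0 β n (y₀ := 1 / 4) (Or.inl rfl)
  have hE₁ := norm_src_lattice_le ha0 β n (y₀ := -(1 / 4)) (Or.inr rfl)
  obtain ⟨e00, e01, e10, e11⟩ := blockX_apply a β
  fin_cases i
  · simp only [Fin.zero_eta, Fin.isValue]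
    rw [sheetAmps_singleMode_apply_0 ha, sqrt_neg_khLam_eq_beta ha, e00, e01]
    exact mode_component_paired_le ha hθ0 h0 hh hE₀ hE₁
  · simp only [Fin.mk_one, Fin.isValue]
    rw [sheetAmps_singleMode_apply_1 ha, sqrt_neg_khLam_eq_beta ha, e10, e11]
    exact mode_component_paired_le' ha hθ0 h0 hh hE₀ hE₁

/-- **The BEST per-mode creation weight BY NAME** (`a ≥ 4`, `0 ≤ θ ≤ 8`, lattice mode `ξ = β + n`): `‖sheetAmps a β θ (singleMode ξ) i‖ ≤ 0.889/a`
for `|ξ| < 16a` (the sharp law) and `≤ 102·a/ξ²` for `|ξ| ≥ 16a` (the paired far law, `25.5/(a(1+(|ξ/a|−8)²)) ≤ 102a/ξ²`). -/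
theorem norm_sheetAmps_singleMode_best {a : ℝ} (ha : 4 ≤ a) (β : ℝ) (n : ℤ) {θ : ℝ} (hθ0 : 0 ≤ θ) (hθ : θ ≤ 8) (i : Fin 2) :
    ‖sheetAmps a β θ (singleMode (β + n)) i‖ ≤ if |β + (n : ℝ)| < 16 * a then 0.889 / a else 102 * a / (β + n) ^ 2 := by
  have ha0 : 0 < a := by linarith
  split_ifs with h
  · exact norm_sheetAmps_singleMode_le ha β (β + n) hθ0 hθ i
  · have hfar : 16 * a ≤ |β + (n : ℝ)| := not_lt.mp h
    refine (norm_sheetAmps_singleMode_paired (by linarith) β n hθ0 i).trans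
      ((paired_mode_factor_far_le ha β (β + n) hθ0 hθ hfar).trans ?_)
    -- `25.5/(a(1+(|u|−8)²)) ≤ 102 a/ξ²`: `(|u|−8)² ≥ u²/4` for `|u| ≥ 16`
    have hu : 16 ≤ |(β + n) / a| := by rw [abs_div, abs_of_pos ha0, le_div_iff₀ ha0]; linarith
    have hξ2 : (β + (n : ℝ)) ^ 2 = a ^ 2 * |(β + n) / a| ^ 2 := by
      rw [abs_div, abs_of_pos ha0, div_pow, sq_abs]; field_simp
    have hpos : 0 < (β + (n : ℝ)) ^ 2 := by rw [hξ2]; positivity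
    rw [div_le_div_iff₀ (by positivity) hpos, hξ2]
    nlinarith [sq_nonneg (|(β + ↑n) / a| - 16), ha0, mul_pos ha0 ha0, sq_nonneg a]

/-! ## §22 (p2 g12) THE ENERGY-FORM (ℓ²) CREATION LAW BY NAME: `‖q‖² ≤ 8000·a·Σ_n ‖c n‖²/(a²+(β+n)²)` for EVERY profile -/

/-- **THE ENERGY-FORM CREATION LAW, positive lines** (`a ≥ 4`, `|β| ≤ 1`, `0 ≤ θ ≤ 8`, any window `K`, ANY profile `c`):
`‖sheetAmps a β θ ⟨modeProfile β K c, []⟩ i‖² ≤ 8000·a·Σ_{|n|≤K} ‖c n‖²/(a²+(β+n)²)` — linearity over modes, the best per-mode weight, Cauchy–Schwarz and the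
square sum of the weights (`sum_sq_creationWeight_le`, tree p714393). Uniform in the window ONLY through the `1/ξ²` far law. -/
theorem norm_sq_sheetAmps_modeProfile_le {a : ℝ} (ha : 4 ≤ a) {β : ℝ} (hβ : |β| ≤ 1) {θ : ℝ} (hθ0 : 0 ≤ θ) (hθ : θ ≤ 8) (K : ℕ)
    (c : ℤ → ℂ) (i : Fin 2) :
    ‖sheetAmps a β θ ⟨modeProfile β K c, []⟩ i‖ ^ 2 ≤ 8000 * a * ∑ n ∈ win K, ‖c n‖ ^ 2 / (a ^ 2 + (β + n) ^ 2) := by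
  have ha0 : 0 < a := by linarith
  have ha1 : 1 ≤ a := by linarith
  -- linearity over the modes and the per-mode weights
  have hlin : ‖sheetAmps a β θ ⟨modeProfile β K c, []⟩ i‖ ≤
      ∑ n ∈ win K, ‖c n‖ * (if |β + (n : ℝ)| < 16 * a then 0.889 / a else 102 * a / (β + n) ^ 2) := by
    rw [sheetAmps_modeProfile ha1 β θ K c, Finset.sum_apply]
    refine (norm_sum_le _ _).trans (Finset.sum_le_sum fun n _ => ?_)
    rw [Pi.smul_apply, norm_smul]
    exact mul_le_mul_of_nonneg_left (norm_sheetAmps_singleMode_best ha β n hθ0 hθ i) (norm_nonneg _)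
  have hsum0 : 0 ≤ ∑ n ∈ win K, ‖c n‖ * (if |β + (n : ℝ)| < 16 * a then 0.889 / a else 102 * a / (β + n) ^ 2) :=
    Finset.sum_nonneg fun n _ => mul_nonneg (norm_nonneg _) (by split_ifs <;> positivity)
  -- Cauchy–Schwarz with `f = ‖c‖²/(a²+ξ²)`, `g = W²(a²+ξ²)`
  have hCS := Finset.sum_sq_le_sum_mul_sum_of_sq_le_mul (win K)
    (r := fun n : ℤ => ‖c n‖ * (if |β + (n : ℝ)| < 16 * a then 0.889 / a else 102 * a / (β + n) ^ 2))
    (f := fun n : ℤ => ‖c n‖ ^ 2 / (a ^ 2 + (β + n) ^ 2))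
    (g := fun n : ℤ => if |β + (n : ℝ)| < 16 * a then (0.889 / a) ^ 2 * (a ^ 2 + (β + n) ^ 2) else (102 * a / (β + n) ^ 2) ^ 2 * (a ^ 2 + (β + n) ^ 2))
    (fun n _ => by positivity) (fun n _ => by split_ifs <;> positivity) (fun n _ => le_of_eq ?_)
  · have hW := sum_sq_creationWeight_le ha hβ K
    have hwin : win K = Finset.Icc (-(K : ℤ)) K := rfl
    rw [← hwin] at hW
    have hf0 : 0 ≤ ∑ n ∈ win K, ‖c n‖ ^ 2 / (a ^ 2 + (β + n) ^ 2) := Finset.sum_nonneg fun n _ => by positivity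
    calc ‖sheetAmps a β θ ⟨modeProfile β K c, []⟩ i‖ ^ 2
        ≤ (∑ n ∈ win K, ‖c n‖ * (if |β + (n : ℝ)| < 16 * a then 0.889 / a else 102 * a / (β + n) ^ 2)) ^ 2 :=
          pow_le_pow_left₀ (norm_nonneg _) hlin 2
      _ ≤ (∑ n ∈ win K, ‖c n‖ ^ 2 / (a ^ 2 + (β + n) ^ 2)) *
            ∑ n ∈ win K, (if |β + (n : ℝ)| < 16 * a then (0.889 / a) ^ 2 * (a ^ 2 + (β + n) ^ 2)
              else (102 * a / (β + n) ^ 2) ^ 2 * (a ^ 2 + (β + n) ^ 2)) := hCS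
      _ ≤ (∑ n ∈ win K, ‖c n‖ ^ 2 / (a ^ 2 + (β + n) ^ 2)) * (8000 * a) := mul_le_mul_of_nonneg_left hW hf0
      _ = 8000 * a * ∑ n ∈ win K, ‖c n‖ ^ 2 / (a ^ 2 + (β + n) ^ 2) := by ring
  · -- `r² = f·g`
    have hpos : 0 < a ^ 2 + (β + (n : ℝ)) ^ 2 := by positivity
    split_ifs <;> field_simp

/-- **THE ENERGY-FORM CREATION LAW, negative lines** (`a ≤ −4`; by the conjugation symmetry `(a,β,ξ) ↦ (−a,−β,−ξ)` of §17). -/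
theorem norm_sq_sheetAmps_modeProfile_le_of_neg {a : ℝ} (ha : a ≤ -4) {β : ℝ} (hβ : |β| ≤ 1) {θ : ℝ} (hθ0 : 0 ≤ θ) (hθ : θ ≤ 8) (K : ℕ)
    (c : ℤ → ℂ) (i : Fin 2) :
    ‖sheetAmps a β θ ⟨modeProfile β K c, []⟩ i‖ ^ 2 ≤ 8000 * |a| * ∑ n ∈ win K, ‖c n‖ ^ 2 / (a ^ 2 + (β + n) ^ 2) := by
  have ha' : 4 ≤ -a := by linarith
  have ha1 : 1 ≤ -a := by linarith
  have hc : (fun n : ℤ => starRingEnd ℂ ((fun n : ℤ => starRingEnd ℂ (c (-n))) (-n))) = c := by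
    funext n; simp
  have h := sheetAmps_neg_neg_modeProfile ha1 (-β) θ K (fun n => starRingEnd ℂ (c (-n))) i
  rw [neg_neg, neg_neg, hc] at h
  rw [h, Complex.norm_conj, abs_of_neg (by linarith)]
  have hβ' : |-β| ≤ 1 := by rwa [abs_neg]
  refine (norm_sq_sheetAmps_modeProfile_le ha' hβ' hθ0 hθ K (fun n => starRingEnd ℂ (c (-n))) i).trans (le_of_eq ?_)
  congr 1
  refine Finset.sum_nbij' (fun n => -n) (fun n => -n) (fun n hn => by simp only [win, Finset.mem_Icc] at hn ⊢; omega)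
    (fun n hn => by simp only [win, Finset.mem_Icc] at hn ⊢; omega) (fun n _ => neg_neg n) (fun n _ => neg_neg n) (fun n _ => ?_)
  rw [Complex.norm_conj]
  push_cast
  ring

/-- **The energy-form law on every far line** (`|a| ≥ 4`): `‖q_i‖² ≤ 8000·|a|·Σ_n ‖c n‖²/(a²+(β+n)²)`. -/
theorem norm_sq_sheetAmps_modeProfile_le_abs {a : ℝ} (ha : 4 ≤ |a|) {β : ℝ} (hβ : |β| ≤ 1) {θ : ℝ} (hθ0 : 0 ≤ θ) (hθ : θ ≤ 8) (K : ℕ)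
    (c : ℤ → ℂ) (i : Fin 2) :
    ‖sheetAmps a β θ ⟨modeProfile β K c, []⟩ i‖ ^ 2 ≤ 8000 * |a| * ∑ n ∈ win K, ‖c n‖ ^ 2 / (a ^ 2 + (β + n) ^ 2) := by
  rcases le_or_gt 0 a with h | h
  · rw [abs_of_nonneg h] at ha ⊢
    exact norm_sq_sheetAmps_modeProfile_le ha hβ hθ0 hθ K c i
  · have : a ≤ -4 := by rw [abs_of_neg h] at ha; linarith
    exact norm_sq_sheetAmps_modeProfile_le_of_neg this hβ hθ0 hθ K c i

/-! ## §23 (p2 g12) K-UNIFORM H-TARGET ENTRIES BY NAME: `Transfer α β θ K t s H s′ 2100` for every input type, source shell, window and class -/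

/-- **Fresh H densities in energy form** (`|α+m| ≥ 4`, `|β| ≤ 1`, `0 ≤ θ ≤ 8`, `m ∈ win K`):
`‖hFresh α β θ K ζ m i‖² ≤ 8000·|α+m|·Σ_n ‖ζ m n‖²/((α+m)²+(β+n)²)`. -/
theorem norm_sq_hFresh_le (α : ℝ) {β : ℝ} (hβ : |β| ≤ 1) {θ : ℝ} (hθ0 : 0 ≤ θ) (hθ : θ ≤ 8) (K : ℕ) (ζ : CState) {m : ℤ} (hm : m ∈ win K)
    (ha : 4 ≤ |α + (m : ℝ)|) (i : Fin 2) :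
    ‖hFresh α β θ K ζ m i‖ ^ 2 ≤ 8000 * |α + m| * ∑ n ∈ win K, ‖ζ m n‖ ^ 2 / ((α + m) ^ 2 + (β + n) ^ 2) := by
  simp only [hFresh, if_pos hm]
  exact norm_sq_sheetAmps_modeProfile_le_abs ha hβ hθ0 hθ K (ζ m) i

/-- **The straight H pair of the fresh densities of a state, in energy form** (target shell `s′ ≥ 3`, class `(α, β)` with `β ∈ [0,1]`, level `ℓ`):
`cEnergy α β ℓ K (hPairState β (restrictShell s′ α (hFresh α β θ K ζ))) ≤ 16000(π+1)·cEnergy α β ℓ K ζ`. -/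
theorem cEnergy_hPairState_fresh_le {α β : ℝ} (hβ0 : 0 ≤ β) (hβ1 : β ≤ 1) {θ : ℝ} (hθ0 : 0 ≤ θ) (hθ : θ ≤ 8) (ℓ K : ℕ) {s' : ℕ} (hs' : 3 ≤ s')
    (ζ : CState) :
    cEnergy α β ℓ K (hPairState β (restrictShell s' α (hFresh α β θ K ζ))) ≤ 16000 * (Real.pi + 1) * cEnergy α β ℓ K ζ := by
  have hβ : |β| ≤ 1 := abs_le.2 ⟨by linarith, hβ1⟩
  have hlo : (4 : ℝ) ≤ shellLo s' := by
    obtain ⟨k, rfl⟩ : ∃ k, s' = k + 3 := ⟨s' - 3, by omega⟩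
    simp only [shellLo]
    calc (4 : ℝ) = 2 ^ 2 := by norm_num
      _ ≤ 2 ^ (k + 1 + 1) := pow_le_pow_right₀ (by norm_num) (by omega)
  set Q := restrictShell s' α (hFresh α β θ K ζ) with hQ
  -- rows: outside the shell `Q m = 0`; inside, `|α+m| ≥ 4`
  have hrow : ∀ m : ℤ, Q m = 0 ∨ (4 ≤ |α + (m : ℝ)| ∧ m ∈ win K ∧ Q m = hFresh α β θ K ζ m) := by
    intro m
    by_cases hsh : shellLo s' ≤ |α + (m : ℝ)| ∧ |α + (m : ℝ)| < shellHi s'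
    · by_cases hm : m ∈ win K
      · right; refine ⟨hlo.trans hsh.1, hm, ?_⟩; rw [hQ]; funext i; simp [restrictShell, hsh]
      · left; rw [hQ]; funext i; simp [restrictShell, hFresh, hm]
    · left; rw [hQ]; funext i; simp only [restrictShell, if_neg hsh]
  have hq0 : ∀ m ∈ win K, α + (m : ℝ) = 0 → Q m = 0 := by
    intro m _ h0
    rcases hrow m with h | ⟨h4, _, _⟩
    · exact h
    · rw [h0, abs_zero] at h4; linarith
  refine (cEnergy_hPairState_le hβ0 hβ1 α ℓ K Q hq0).trans ?_
  -- per row: `(‖Q m 0‖² + ‖Q m 1‖²)(π/|a| + 4/a²) ≤ 16000(π+1)·S_m`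
  have hc : 0 < 4 * Real.pi ^ 2 * (4 : ℝ) ^ ℓ := by positivity
  have hper : ∀ m ∈ win K, (‖Q m 0‖ ^ 2 + ‖Q m 1‖ ^ 2) * (Real.pi / |α + m| + 4 / (α + m) ^ 2) ≤
      16000 * (Real.pi + 1) * ∑ n ∈ win K, ‖ζ m n‖ ^ 2 / ((α + m) ^ 2 + (β + n) ^ 2) := by
    intro m hm
    have hS0 : 0 ≤ ∑ n ∈ win K, ‖ζ m n‖ ^ 2 / ((α + m) ^ 2 + (β + n) ^ 2) := Finset.sum_nonneg fun n _ => by positivity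
    rcases hrow m with h | ⟨h4, _, hQm⟩
    · rw [h]; simp; positivity
    · set S := ∑ n ∈ win K, ‖ζ m n‖ ^ 2 / ((α + m) ^ 2 + (β + n) ^ 2) with hS
      have ha0 : 0 < |α + (m : ℝ)| := by linarith
      have h0 : ‖Q m 0‖ ^ 2 ≤ 8000 * |α + m| * S := by rw [hQm]; exact norm_sq_hFresh_le α hβ hθ0 hθ K ζ hm h4 0
      have h1 : ‖Q m 1‖ ^ 2 ≤ 8000 * |α + m| * S := by rw [hQm]; exact norm_sq_hFresh_le α hβ hθ0 hθ K ζ hm h4 1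
      have hw : Real.pi / |α + m| + 4 / (α + m) ^ 2 ≤ (Real.pi + 1) / |α + m| := by
        rw [← sq_abs, div_add_div _ _ ha0.ne' (by positivity), div_le_div_iff₀ (by positivity) ha0]
        nlinarith [Real.pi_pos]
      have hw0 : 0 ≤ Real.pi / |α + m| + 4 / (α + m) ^ 2 := by positivity
      calc (‖Q m 0‖ ^ 2 + ‖Q m 1‖ ^ 2) * (Real.pi / |α + m| + 4 / (α + m) ^ 2)
          ≤ (2 * (8000 * |α + m| * S)) * ((Real.pi + 1) / |α + m|) := mul_le_mul (by linarith) hw hw0 (by positivity)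
        _ = 16000 * (Real.pi + 1) * S := by field_simp; ring
  calc 1 / (4 * Real.pi ^ 2 * (4 : ℝ) ^ ℓ) * ∑ m ∈ win K, (‖Q m 0‖ ^ 2 + ‖Q m 1‖ ^ 2) * (Real.pi / |α + m| + 4 / (α + m) ^ 2)
      ≤ 1 / (4 * Real.pi ^ 2 * (4 : ℝ) ^ ℓ) * ∑ m ∈ win K, 16000 * (Real.pi + 1) * ∑ n ∈ win K, ‖ζ m n‖ ^ 2 / ((α + m) ^ 2 + (β + n) ^ 2) :=
        mul_le_mul_of_nonneg_left (Finset.sum_le_sum hper) (by positivity)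
    _ = 16000 * (Real.pi + 1) * cEnergy α β ℓ K ζ := by
        unfold cEnergy
        simp only [Finset.mul_sum]
        refine Finset.sum_congr rfl fun m _ => Finset.sum_congr rfl fun n _ => ?_
        field_simp

/-- **The output H piece of one phase in energy form** (target shell `s′ ≥ 3`, strain `0 ≤ θ ≤ 8`, class `(α,β)` with `β ∈ [0,1]`):
`outEnergy α β θ K s′ (phasePieces α β θ K ζ) H ≤ (θ²+2)·16000(π+1)·cEnergy α β 1 K ζ`. -/
theorem outEnergy_H_le_cEnergy {α β : ℝ} (hβ0 : 0 ≤ β) (hβ1 : β ≤ 1) {θ : ℝ} (hθ0 : 0 ≤ θ) (hθ : θ ≤ 8) (K : ℕ) {s' : ℕ} (hs' : 3 ≤ s')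
    (ζ : CState) :
    outEnergy α β θ K s' (phasePieces α β θ K ζ) PType.H ≤ (θ ^ 2 + 2) * (16000 * (Real.pi + 1)) * cEnergy α β 1 K ζ := by
  simp only [outEnergy, outEnergyAt, phasePieces]
  refine (cEnergy_vTransport_le α β θ 1 K _).trans ?_
  rw [mul_assoc]
  exact mul_le_mul_of_nonneg_left (cEnergy_hPairState_fresh_le hβ0 hβ1 hθ0 hθ 1 K hs' ζ) (by positivity)


/-- The H output of a phase at any level: `outEnergyAt … ℓ s′ (phasePieces … ζ) H ≤ (θ²+2)·16000(π+1)·cEnergy α β ℓ K ζ` (`s′ ≥ 3`, `β ∈ [0,1]`, `θ ∈ [0,8]`). -/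
theorem outEnergyAt_H_le_cEnergy {α β : ℝ} (hβ0 : 0 ≤ β) (hβ1 : β ≤ 1) {θ : ℝ} (hθ0 : 0 ≤ θ) (hθ : θ ≤ 8) (K ℓ : ℕ) {s' : ℕ} (hs' : 3 ≤ s')
    (ζ : CState) :
    outEnergyAt α β θ K ℓ s' (phasePieces α β θ K ζ) PType.H ≤ (θ ^ 2 + 2) * (16000 * (Real.pi + 1)) * cEnergy α β ℓ K ζ := by
  simp only [outEnergyAt, phasePieces]
  refine (cEnergy_vTransport_le α β θ ℓ K _).trans ?_
  rw [mul_assoc]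
  exact mul_le_mul_of_nonneg_left (cEnergy_hPairState_fresh_le hβ0 hβ1 hθ0 hθ ℓ K hs' ζ) (by positivity)


/-! # Verbatim copies: the LINE LAW vocabulary and the one-phase output law given a line law (`K2CreationLaws.lean` §24/§27) -/

/-- **Young's inequality for the lattice energy:** `E(x + y) ≤ (1 + 1/t)E(x) + (1 + t)E(y)`. -/
theorem cEnergy_add_le_young (α β : ℝ) (ℓ K : ℕ) (x y : CState) {t : ℝ} (ht : 0 < t) :
    cEnergy α β ℓ K (fun m n => x m n + y m n) ≤ (1 + 1 / t) * cEnergy α β ℓ K x + (1 + t) * cEnergy α β ℓ K y := by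
  unfold cEnergy
  rw [Finset.mul_sum, Finset.mul_sum, ← Finset.sum_add_distrib]
  refine Finset.sum_le_sum fun m _ => ?_
  rw [Finset.mul_sum, Finset.mul_sum, ← Finset.sum_add_distrib]
  refine Finset.sum_le_sum fun n _ => ?_
  rw [mul_div_assoc', mul_div_assoc', ← add_div]
  refine div_le_div_of_nonneg_right ?_ (by positivity)
  show ‖x m n + y m n‖ ^ 2 ≤ _
  calc ‖x m n + y m n‖ ^ 2 ≤ (‖x m n‖ + ‖y m n‖) ^ 2 := pow_le_pow_left₀ (norm_nonneg _) (norm_add_le _ _) 2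
    _ ≤ (1 + 1 / t) * ‖x m n‖ ^ 2 + (1 + t) * ‖y m n‖ ^ 2 := add_sq_le_young ht

/-- **The zero line creates nothing** (the forcing carries the factor `2πa`). -/
theorem sheetAmps_zero_line (b θ : ℝ) (st : LamState) : sheetAmps 0 b θ st = 0 := by
  have hf : ∀ s : ℝ, forcing 0 b st s = 0 := by
    intro s; funext i
    simp only [forcing, mul_zero, Complex.ofReal_zero, zero_mul, Pi.zero_apply]
    fin_cases i <;> simp
  unfold sheetAmps
  simp only [hf, Matrix.mulVec_zero, intervalIntegral.integral_zero]

/-- The (level-stripped) LATTICE LINE ENERGY of a straight sheet pair with amplitudes `q` on the line `a`, Bloch offset `b`, window `K`: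
`Σ_{|n| ≤ K} ‖q₀e^{−iπ(b+n)/2} + q₁e^{iπ(b+n)/2}‖²/(a² + (b+n)²)` — one row of `cEnergy (hPairState …)`, one column of `cEnergy (vPairState …)`, times `4π²4^ℓ`. -/
def lineEnergyOut (a b : ℝ) (K : ℕ) (q : Fin 2 → ℂ) : ℝ :=
  ∑ n ∈ win K, ‖q 0 * Complex.exp (-(Real.pi * (b + n) / 2 : ℝ) * Complex.I) + q 1 * Complex.exp ((Real.pi * (b + n) / 2 : ℝ) * Complex.I)‖ ^ 2 /
    (a ^ 2 + (b + n) ^ 2)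

/-- **B1 AS ONE PROP — the CORE-LINE CREATION LAW on the unit strip, exact energy form, constant `C`:** on every line `|a| < 1`, for every Bloch offset
`b ∈ [0,1]`, strain `θ ∈ [0,8]`, window `K` and profile `c`, the lattice line energy of the created straight pair is at most `C ×` the line's input energy
`Σ_{|n| ≤ K} ‖c n‖²/(a² + (b+n)²)` (uniformity in `K`, in `b`, and in `a → 0⁺` is the content; the zero line itself creates nothing). -/
def CoreLineLaw (C : ℝ) : Prop :=
  ∀ (a b θ : ℝ) (K : ℕ) (c : ℤ → ℂ), |a| < 1 → 0 ≤ b → b ≤ 1 → 0 ≤ θ → θ ≤ 8 →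
    lineEnergyOut a b K (sheetAmps a b θ ⟨modeProfile b K c, []⟩) ≤ C * ∑ n ∈ win K, ‖c n‖ ^ 2 / (a ^ 2 + (b + n) ^ 2)

/-- The same law on EVERY line. -/
def LineLaw (C : ℝ) : Prop :=
  ∀ (a b θ : ℝ) (K : ℕ) (c : ℤ → ℂ), 0 ≤ b → b ≤ 1 → 0 ≤ θ → θ ≤ 8 →
    lineEnergyOut a b K (sheetAmps a b θ ⟨modeProfile b K c, []⟩) ≤ C * ∑ n ∈ win K, ‖c n‖ ^ 2 / (a ^ 2 + (b + n) ^ 2)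

/-- The line energy against the lossy weight (`vPair_column_energy_upper`): `≤ (‖q₀‖² + ‖q₁‖²)(π/|a| + 4/a²)` off the zero line. -/
theorem lineEnergyOut_le_weight {a : ℝ} (ha : a ≠ 0) {b : ℝ} (hb0 : 0 ≤ b) (hb1 : b ≤ 1) (K : ℕ) (q : Fin 2 → ℂ) :
    lineEnergyOut a b K q ≤ (‖q 0‖ ^ 2 + ‖q 1‖ ^ 2) * (Real.pi / |a| + 4 / a ^ 2) := by
  have h := vPair_column_energy_upper hb0 hb1 ha K (q 0) (q 1)
  refine le_of_eq_of_le ?_ h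
  unfold lineEnergyOut
  exact Finset.sum_congr rfl fun n _ => by rw [add_comm (a ^ 2)]

/-- `cEnergy` of an H pair, row by row, IS the sum of the line energies. -/
theorem cEnergy_hPairState_eq (α β : ℝ) (ℓ K : ℕ) (Q : ℤ → Fin 2 → ℂ) :
    cEnergy α β ℓ K (hPairState β Q) = (1 / (4 * Real.pi ^ 2 * (4 : ℝ) ^ ℓ)) * ∑ m ∈ win K, lineEnergyOut (α + m) β K (Q m) := by
  unfold cEnergy lineEnergyOut
  simp only [hPairState]
  rw [Finset.mul_sum]
  refine Finset.sum_congr rfl fun m _ => ?_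
  rw [Finset.mul_sum]
  refine Finset.sum_congr rfl fun n _ => ?_
  rw [mul_comm (4 * Real.pi ^ 2 * (4 : ℝ) ^ ℓ) ((α + (m : ℝ)) ^ 2 + (β + n) ^ 2), ← div_div, div_eq_mul_one_div, mul_comm]

/-- `cEnergy` of a V pair, column by column, IS the sum of the line energies. -/
theorem cEnergy_vPairState_eq (α β : ℝ) (ℓ K : ℕ) (P : ℤ → Fin 2 → ℂ) :
    cEnergy α β ℓ K (vPairState α P) = (1 / (4 * Real.pi ^ 2 * (4 : ℝ) ^ ℓ)) * ∑ n ∈ win K, lineEnergyOut (β + n) α K (P n) := by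
  unfold cEnergy lineEnergyOut
  rw [Finset.sum_comm]
  simp only [vPairState]
  rw [Finset.mul_sum]
  refine Finset.sum_congr rfl fun n _ => ?_
  rw [Finset.mul_sum]
  refine Finset.sum_congr rfl fun m _ => ?_
  rw [add_comm ((β + (n : ℝ)) ^ 2), mul_comm (4 * Real.pi ^ 2 * (4 : ℝ) ^ ℓ) ((α + (m : ℝ)) ^ 2 + (β + n) ^ 2), ← div_div,
    div_eq_mul_one_div, mul_comm]

/-- The empty pair has no line energy. -/
theorem lineEnergyOut_zero (a b : ℝ) (K : ℕ) : lineEnergyOut a b K 0 = 0 := by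
  unfold lineEnergyOut; simp

/-- **Rows:** an H pair whose densities are, row by row, either zero or the fresh densities of `ζ`, has energy `≤ C·E(ζ)`. -/
theorem cEnergy_hPairState_le_of_rows {C : ℝ} (hL : LineLaw C) (hC : 0 ≤ C) {α β : ℝ} (hβ0 : 0 ≤ β) (hβ1 : β ≤ 1) {θ : ℝ} (hθ0 : 0 ≤ θ)
    (hθ : θ ≤ 8) (ℓ K : ℕ) (ζ : CState) (Q : ℤ → Fin 2 → ℂ) (hQ : ∀ m : ℤ, Q m = 0 ∨ (m ∈ win K ∧ Q m = hFresh α β θ K ζ m)) :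
    cEnergy α β ℓ K (hPairState β Q) ≤ C * cEnergy α β ℓ K ζ := by
  rw [cEnergy_hPairState_eq]
  have hper : ∀ m ∈ win K, lineEnergyOut (α + m) β K (Q m) ≤ C * ∑ n ∈ win K, ‖ζ m n‖ ^ 2 / ((α + m) ^ 2 + (β + n) ^ 2) := by
    intro m hm
    rcases hQ m with h | ⟨_, h⟩
    · rw [h, lineEnergyOut_zero]
      exact mul_nonneg hC (Finset.sum_nonneg fun _ _ => by positivity)
    · rw [h]; simp only [hFresh, if_pos hm]
      exact hL (α + m) β θ K (ζ m) hβ0 hβ1 hθ0 hθ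
  calc 1 / (4 * Real.pi ^ 2 * (4 : ℝ) ^ ℓ) * ∑ m ∈ win K, lineEnergyOut (α + m) β K (Q m)
      ≤ 1 / (4 * Real.pi ^ 2 * (4 : ℝ) ^ ℓ) * ∑ m ∈ win K, C * ∑ n ∈ win K, ‖ζ m n‖ ^ 2 / ((α + m) ^ 2 + (β + n) ^ 2) :=
        mul_le_mul_of_nonneg_left (Finset.sum_le_sum hper) (by positivity)
    _ = C * cEnergy α β ℓ K ζ := by
        unfold cEnergy
        simp only [Finset.mul_sum]
        refine Finset.sum_congr rfl fun m _ => Finset.sum_congr rfl fun n _ => ?_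
        field_simp

/-- **Columns:** a V pair whose densities are, column by column, either zero or the fresh V densities of `S`, has energy `≤ C·E(S)` (`α ∈ [0,1]`). -/
theorem cEnergy_vPairState_le_of_cols {C : ℝ} (hL : LineLaw C) (hC : 0 ≤ C) {α β : ℝ} (hα0 : 0 ≤ α) (hα1 : α ≤ 1) {θ : ℝ} (hθ0 : 0 ≤ θ)
    (hθ : θ ≤ 8) (ℓ K : ℕ) (S : CState) (P : ℤ → Fin 2 → ℂ) (hP : ∀ n : ℤ, P n = 0 ∨ (n ∈ win K ∧ P n = vFresh α β θ K S n)) :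
    cEnergy α β ℓ K (vPairState α P) ≤ C * cEnergy α β ℓ K S := by
  rw [cEnergy_vPairState_eq]
  have hper : ∀ n ∈ win K, lineEnergyOut (β + n) α K (P n) ≤ C * ∑ m ∈ win K, ‖S m n‖ ^ 2 / ((β + n) ^ 2 + (α + m) ^ 2) := by
    intro n hn
    rcases hP n with h | ⟨_, h⟩
    · rw [h, lineEnergyOut_zero]
      exact mul_nonneg hC (Finset.sum_nonneg fun _ _ => by positivity)
    · rw [h]; simp only [vFresh, if_pos hn]
      exact hL (β + n) α θ K (fun m => S m n) hα0 hα1 hθ0 hθ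
  calc 1 / (4 * Real.pi ^ 2 * (4 : ℝ) ^ ℓ) * ∑ n ∈ win K, lineEnergyOut (β + n) α K (P n)
      ≤ 1 / (4 * Real.pi ^ 2 * (4 : ℝ) ^ ℓ) * ∑ n ∈ win K, C * ∑ m ∈ win K, ‖S m n‖ ^ 2 / ((β + n) ^ 2 + (α + m) ^ 2) :=
        mul_le_mul_of_nonneg_left (Finset.sum_le_sum hper) (by positivity)
    _ = ∑ n ∈ win K, ∑ m ∈ win K, C * (‖S m n‖ ^ 2 / (4 * Real.pi ^ 2 * (4 : ℝ) ^ ℓ * ((α + m) ^ 2 + (β + n) ^ 2))) := by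
        rw [Finset.mul_sum]
        refine Finset.sum_congr rfl fun n _ => ?_
        rw [Finset.mul_sum, Finset.mul_sum]
        refine Finset.sum_congr rfl fun m _ => ?_
        rw [add_comm ((β + (n : ℝ)) ^ 2) ((α + (m : ℝ)) ^ 2)]
        field_simp
    _ = C * cEnergy α β ℓ K S := by
        unfold cEnergy
        rw [Finset.sum_comm, Finset.mul_sum]
        refine Finset.sum_congr rfl fun m _ => ?_
        rw [Finset.mul_sum]

/-- The shell-restricted fresh H densities are row-wise zero or fresh. -/
theorem restrictShell_hFresh_rows (s' : ℕ) (α β θ : ℝ) (K : ℕ) (ζ : CState) (m : ℤ) :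
    restrictShell s' α (hFresh α β θ K ζ) m = 0 ∨ (m ∈ win K ∧ restrictShell s' α (hFresh α β θ K ζ) m = hFresh α β θ K ζ m) := by
  by_cases hsh : shellLo s' ≤ |α + (m : ℝ)| ∧ |α + (m : ℝ)| < shellHi s'
  · by_cases hm : m ∈ win K
    · right; exact ⟨hm, by funext i; simp [restrictShell, hsh]⟩
    · left; funext i; simp [restrictShell, hFresh, hm]
  · left; funext i; simp only [restrictShell, if_neg hsh, Pi.zero_apply]

/-- The shell-restricted fresh V densities are column-wise zero or fresh. -/
theorem restrictShell_vFresh_cols (s' : ℕ) (α β θ : ℝ) (K : ℕ) (S : CState) (n : ℤ) :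
    restrictShell s' β (vFresh α β θ K S) n = 0 ∨ (n ∈ win K ∧ restrictShell s' β (vFresh α β θ K S) n = vFresh α β θ K S n) := by
  by_cases hsh : shellLo s' ≤ |β + (n : ℝ)| ∧ |β + (n : ℝ)| < shellHi s'
  · by_cases hn : n ∈ win K
    · right; exact ⟨hn, by funext i; simp [restrictShell, hsh]⟩
    · left; funext i; simp [restrictShell, vFresh, hn]
  · left; funext i; simp only [restrictShell, if_neg hsh, Pi.zero_apply]

/-- **Every output piece of one phase, GIVEN the line law:** `outEnergyAt … ℓ s′ (phasePieces … ζ) t′ ≤ C(2C + 3(θ²+2))·E_ℓ(ζ)` (both types, every target shell). -/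
theorem outEnergyAt_le_of_lineLaw {C : ℝ} (hL : LineLaw C) (hC : 0 ≤ C) {α β : ℝ} (hα0 : 0 ≤ α) (hα1 : α ≤ 1) (hβ0 : 0 ≤ β) (hβ1 : β ≤ 1)
    {θ : ℝ} (hθ0 : 0 ≤ θ) (hθ : θ ≤ 8) (K ℓ s' : ℕ) (ζ : CState) (t' : PType) :
    outEnergyAt α β θ K ℓ s' (phasePieces α β θ K ζ) t' ≤ C * (2 * C + 3 * (θ ^ 2 + 2)) * cEnergy α β ℓ K ζ := by
  have hE0 : 0 ≤ cEnergy α β ℓ K ζ := Finset.sum_nonneg fun _ _ => Finset.sum_nonneg fun _ _ => by positivity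
  cases t' with
  | H =>
    simp only [outEnergyAt, phasePieces]
    refine (cEnergy_vTransport_le α β θ ℓ K _).trans ?_
    have h := cEnergy_hPairState_le_of_rows hL hC hβ0 hβ1 hθ0 hθ ℓ K ζ _ (restrictShell_hFresh_rows s' α β θ K ζ)
    calc (θ ^ 2 + 2) * cEnergy α β ℓ K (hPairState β (restrictShell s' α (hFresh α β θ K ζ))) ≤ (θ ^ 2 + 2) * (C * cEnergy α β ℓ K ζ) :=
          mul_le_mul_of_nonneg_left h (by positivity)
      _ ≤ C * (2 * C + 3 * (θ ^ 2 + 2)) * cEnergy α β ℓ K ζ := by nlinarith [mul_nonneg hC hE0, mul_nonneg (mul_nonneg hC hC) hE0, sq_nonneg θ]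
  | V =>
    simp only [outEnergyAt, phasePieces]
    set S : CState := fun m n => hTransport α β θ K ζ m n + hPairState β (hFresh α β θ K ζ) m n with hS
    have h1 := cEnergy_vPairState_le_of_cols hL hC hα0 hα1 hθ0 hθ ℓ K S _ (restrictShell_vFresh_cols s' α β θ K S)
    have h2 : cEnergy α β ℓ K S ≤ (1 + 1 / 1) * cEnergy α β ℓ K (hTransport α β θ K ζ) + (1 + 1) * cEnergy α β ℓ K (hPairState β (hFresh α β θ K ζ)) :=
      cEnergy_add_le_young α β ℓ K _ _ one_pos
    have h3 := cEnergy_hTransport_le α β θ ℓ K ζ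
    have h4 := cEnergy_hPairState_le_of_rows hL hC hβ0 hβ1 hθ0 hθ ℓ K ζ (hFresh α β θ K ζ) fun m => by
      by_cases hm : m ∈ win K
      · exact Or.inr ⟨hm, rfl⟩
      · exact Or.inl (by funext i; simp [hFresh, hm])
    have hS4 : cEnergy α β ℓ K S ≤ (2 * (θ ^ 2 + 2) + 2 * C) * cEnergy α β ℓ K ζ := by norm_num at h2; nlinarith
    calc cEnergy α β ℓ K (vPairState α (restrictShell s' β (vFresh α β θ K S))) ≤ C * cEnergy α β ℓ K S := h1
      _ ≤ C * ((2 * (θ ^ 2 + 2) + 2 * C) * cEnergy α β ℓ K ζ) := mul_le_mul_of_nonneg_left hS4 hC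
      _ ≤ C * (2 * C + 3 * (θ ^ 2 + 2)) * cEnergy α β ℓ K ζ := by nlinarith [mul_nonneg hC hE0, mul_nonneg (mul_nonneg hC hC) hE0, sq_nonneg θ]


/-! ## §1 (p2 g14) Windowed ENSTROPHY is non-increasing along the debris path -/

/-- Windowed enstrophy (plain `ℓ²` size of the lattice vorticity on the window): `Σ_{|m|,|n| ≤ K} ‖ζ(m,n)‖²`.  Level-free. -/
def ens (K : ℕ) (ζ : CState) : ℝ := ∑ m ∈ win K, ∑ n ∈ win K, ‖ζ m n‖ ^ 2

theorem ens_nonneg (K : ℕ) (ζ : CState) : 0 ≤ ens K ζ :=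
  Finset.sum_nonneg fun _ _ => Finset.sum_nonneg fun _ _ => by positivity

theorem cEnergy_nonneg (α β : ℝ) (ℓ K : ℕ) (ζ : CState) : 0 ≤ cEnergy α β ℓ K ζ :=
  Finset.sum_nonneg fun _ _ => Finset.sum_nonneg fun _ _ => by positivity

/-- H transport does not increase the windowed enstrophy (Bessel per row). -/
theorem ens_hTransport_le (α β θ : ℝ) (K : ℕ) (ζ : CState) : ens K (hTransport α β θ K ζ) ≤ ens K ζ := by
  unfold ens
  exact Finset.sum_le_sum fun m _ => sum_norm_sq_hTransport_row_le α β θ K ζ m (win K) (subset_refl _)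

/-- **Bessel per column.** `Σ_{m′ ∈ S} ‖vTransport … K ζ m′ n‖² ≤ Σ_{m ∈ win K} ‖ζ m n‖²`. -/
theorem sum_norm_sq_vTransport_col_le (α β θ : ℝ) (K : ℕ) (ζ : CState) (n : ℤ) (S : Finset ℤ) (hS : S ⊆ win K) :
    ∑ m' ∈ S, ‖vTransport α β θ K ζ m' n‖ ^ 2 ≤ ∑ m ∈ win K, ‖ζ m n‖ ^ 2 := by
  by_cases hn : n ∈ win K
  · rw [Finset.sum_congr rfl fun m' hm' => by rw [vTransport_apply_of_mem α β θ K ζ (hS hm') hn]]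
    exact transport_bessel (β + n) θ α (win K) S (fun m => ζ m n)
  · have h0 : ∀ m' ∈ S, vTransport α β θ K ζ m' n = 0 := fun m' _ => by
      unfold vTransport; rw [if_neg (fun h => hn h.2)]
    rw [Finset.sum_congr rfl fun m' hm' => by rw [h0 m' hm']]
    simp only [norm_zero, ne_eq, OfNat.ofNat_ne_zero, not_false_eq_true, zero_pow, Finset.sum_const_zero]
    exact Finset.sum_nonneg fun _ _ => by positivity

/-- V transport does not increase the windowed enstrophy (Bessel per column). -/
theorem ens_vTransport_le (α β θ : ℝ) (K : ℕ) (ζ : CState) : ens K (vTransport α β θ K ζ) ≤ ens K ζ := by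
  unfold ens
  rw [Finset.sum_comm]
  conv_rhs => rw [Finset.sum_comm]
  exact Finset.sum_le_sum fun n _ => sum_norm_sq_vTransport_col_le α β θ K ζ n (win K) (subset_refl _)

/-- **Re-framing does not increase enstrophy:** the windowed enstrophies of the four children of a windowed state sum to at most its own. -/
theorem sum_ens_child_le (K : ℕ) (Z : CState) (hZ : ∀ m n : ℤ, (m ∉ win K ∨ n ∉ win K) → Z m n = 0) :
    ∑ pm ∈ parities, ∑ pn ∈ parities, ens K (child pm pn Z) ≤ ens K Z := by
  set T : ℤ → ℤ → ℝ := fun M N => ‖Z M N‖ ^ 2 with hT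
  have hT0 : ∀ M N, 0 ≤ T M N := fun M N => by rw [hT]; positivity
  have hTz : ∀ M N, (M ∉ win K ∨ N ∉ win K) → T M N = 0 := fun M N h => by rw [hT]; simp only; rw [hZ M N h]; simp
  have hchild : ∀ pm pn : ℤ, ens K (child pm pn Z) = ∑ m ∈ win K, ∑ n ∈ win K, T (2 * m + pm) (2 * n + pn) := by
    intro pm pn; rfl
  simp_rw [hchild]
  have step1 : ∀ pm ∈ parities, ∀ m ∈ win K, ∑ pn ∈ parities, ∑ n ∈ win K, T (2 * m + pm) (2 * n + pn) ≤ ∑ N ∈ win K, T (2 * m + pm) N :=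
    fun pm _ m _ => sum_parities_win_le K (fun N => T (2 * m + pm) N) (fun N => hT0 _ N) (fun N hN => hTz _ N (Or.inr hN))
  have step2 : ∀ N ∈ win K, ∑ pm ∈ parities, ∑ m ∈ win K, T (2 * m + pm) N ≤ ∑ M ∈ win K, T M N :=
    fun N _ => sum_parities_win_le K (fun M => T M N) (fun M => hT0 M N) (fun M hM => hTz M N (Or.inl hM))
  calc ∑ pm ∈ parities, ∑ pn ∈ parities, ∑ m ∈ win K, ∑ n ∈ win K, T (2 * m + pm) (2 * n + pn)
      = ∑ pm ∈ parities, ∑ m ∈ win K, ∑ pn ∈ parities, ∑ n ∈ win K, T (2 * m + pm) (2 * n + pn) := by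
        refine Finset.sum_congr rfl fun pm _ => ?_; rw [Finset.sum_comm]
    _ ≤ ∑ pm ∈ parities, ∑ m ∈ win K, ∑ N ∈ win K, T (2 * m + pm) N :=
        Finset.sum_le_sum fun pm hpm => Finset.sum_le_sum fun m hm => step1 pm hpm m hm
    _ = ∑ N ∈ win K, ∑ pm ∈ parities, ∑ m ∈ win K, T (2 * m + pm) N := by
        rw [show (∑ pm ∈ parities, ∑ m ∈ win K, ∑ N ∈ win K, T (2 * m + pm) N) =
          ∑ pm ∈ parities, ∑ N ∈ win K, ∑ m ∈ win K, T (2 * m + pm) N from Finset.sum_congr rfl fun pm _ => Finset.sum_comm,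
          Finset.sum_comm]
    _ ≤ ∑ N ∈ win K, ∑ M ∈ win K, T M N := Finset.sum_le_sum step2
    _ = ens K Z := by rw [Finset.sum_comm]; rfl

/-- The debris of one phase has at most the enstrophy of the entering state. -/
theorem ens_debris_le (α β θ : ℝ) (K : ℕ) (ζ : CState) : ens K (phasePieces α β θ K ζ).debris ≤ ens K ζ := by
  simp only [phasePieces]
  exact (ens_vTransport_le α β θ K _).trans (ens_hTransport_le α β θ K ζ)

/-! ## §2 (p2 g14) THE FREEZING BOUND in p4's vocabulary: one slot at level `ℓ` moves the energy by at most `θ²/(16·4^ℓ) ×` the windowed enstrophy -/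

/-- **Freezing, H slot.** `cEnergy α β ℓ K (hTransport ζ − ζ) ≤ θ²/(16·4^ℓ) · ens K ζ` (row by row `…KHTransportFreezing.transport_freezing_energy`:
phase depth `2π|α+m|θ/4` against the row weight `≤ 1/(4π²4^ℓ(α+m)²)`).  No window hypothesis: the energy only reads the window. -/
theorem cEnergy_hTransport_sub_le (α β θ : ℝ) (ℓ K : ℕ) (ζ : CState) :
    cEnergy α β ℓ K (fun m n => hTransport α β θ K ζ m n - ζ m n) ≤ θ ^ 2 / (16 * (4 : ℝ) ^ ℓ) * ens K ζ := by
  unfold cEnergy ens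
  rw [Finset.mul_sum]
  refine Finset.sum_le_sum fun m hm => ?_
  have e : ∀ (v : ℂ) (n : ℤ), ‖v‖ ^ 2 / (4 * Real.pi ^ 2 * (4 : ℝ) ^ ℓ * ((α + m) ^ 2 + (β + n) ^ 2)) =
      (1 / (4 * Real.pi ^ 2 * (4 : ℝ) ^ ℓ)) * (‖v‖ ^ 2 / ((α + m) ^ 2 + (β + n) ^ 2)) := by
    intro v n
    rw [mul_comm (4 * Real.pi ^ 2 * (4 : ℝ) ^ ℓ) ((α + (m : ℝ)) ^ 2 + (β + n) ^ 2), ← div_div, div_eq_mul_one_div, mul_comm]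
  simp_rw [e, ← Finset.mul_sum]
  have key : ∑ n' ∈ win K, ‖hTransport α β θ K ζ m n' - ζ m n'‖ ^ 2 / ((α + m) ^ 2 + (β + n') ^ 2) ≤
      (Real.pi * |θ| / 2) ^ 2 * ∑ n ∈ win K, ‖ζ m n‖ ^ 2 := by
    have h := transport_freezing_energy (α + m) θ β (win K) (win K) (fun n => ζ m n)
    refine le_of_eq_of_le (Finset.sum_congr rfl fun n' hn' => ?_) h
    rw [hTransport_apply_of_mem α β θ K ζ hm hn', if_pos hn']
  calc (1 / (4 * Real.pi ^ 2 * (4 : ℝ) ^ ℓ)) * ∑ n' ∈ win K, ‖hTransport α β θ K ζ m n' - ζ m n'‖ ^ 2 / ((α + m) ^ 2 + (β + n') ^ 2)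
      ≤ (1 / (4 * Real.pi ^ 2 * (4 : ℝ) ^ ℓ)) * ((Real.pi * |θ| / 2) ^ 2 * ∑ n ∈ win K, ‖ζ m n‖ ^ 2) :=
        mul_le_mul_of_nonneg_left key (by positivity)
    _ = θ ^ 2 / (16 * (4 : ℝ) ^ ℓ) * ∑ n ∈ win K, ‖ζ m n‖ ^ 2 := by
        have hsq : (Real.pi * |θ| / 2) ^ 2 = Real.pi ^ 2 * θ ^ 2 / 4 := by rw [div_pow, mul_pow, sq_abs]; ring
        rw [hsq]
        field_simp
        ring

/-- **Freezing, V slot.** `cEnergy α β ℓ K (vTransport ζ − ζ) ≤ θ²/(16·4^ℓ) · ens K ζ`. -/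
theorem cEnergy_vTransport_sub_le (α β θ : ℝ) (ℓ K : ℕ) (ζ : CState) :
    cEnergy α β ℓ K (fun m n => vTransport α β θ K ζ m n - ζ m n) ≤ θ ^ 2 / (16 * (4 : ℝ) ^ ℓ) * ens K ζ := by
  unfold cEnergy ens
  rw [Finset.sum_comm]
  conv_rhs => rw [Finset.sum_comm]
  rw [Finset.mul_sum]
  refine Finset.sum_le_sum fun n hn => ?_
  have e : ∀ (v : ℂ) (m : ℤ), ‖v‖ ^ 2 / (4 * Real.pi ^ 2 * (4 : ℝ) ^ ℓ * ((α + m) ^ 2 + (β + n) ^ 2)) =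
      (1 / (4 * Real.pi ^ 2 * (4 : ℝ) ^ ℓ)) * (‖v‖ ^ 2 / ((β + n) ^ 2 + (α + m) ^ 2)) := by
    intro v m
    rw [add_comm ((α + (m : ℝ)) ^ 2), mul_comm (4 * Real.pi ^ 2 * (4 : ℝ) ^ ℓ) ((β + (n : ℝ)) ^ 2 + (α + m) ^ 2), ← div_div,
      div_eq_mul_one_div, mul_comm]
  simp_rw [e, ← Finset.mul_sum]
  have key : ∑ m' ∈ win K, ‖vTransport α β θ K ζ m' n - ζ m' n‖ ^ 2 / ((β + n) ^ 2 + (α + m') ^ 2) ≤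
      (Real.pi * |θ| / 2) ^ 2 * ∑ m ∈ win K, ‖ζ m n‖ ^ 2 := by
    have h := transport_freezing_energy (β + n) θ α (win K) (win K) (fun m => ζ m n)
    refine le_of_eq_of_le (Finset.sum_congr rfl fun m' hm' => ?_) h
    rw [vTransport_apply_of_mem α β θ K ζ hm' hn, if_pos hm']
  calc (1 / (4 * Real.pi ^ 2 * (4 : ℝ) ^ ℓ)) * ∑ m' ∈ win K, ‖vTransport α β θ K ζ m' n - ζ m' n‖ ^ 2 / ((β + n) ^ 2 + (α + m') ^ 2)
      ≤ (1 / (4 * Real.pi ^ 2 * (4 : ℝ) ^ ℓ)) * ((Real.pi * |θ| / 2) ^ 2 * ∑ m ∈ win K, ‖ζ m n‖ ^ 2) :=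
        mul_le_mul_of_nonneg_left key (by positivity)
    _ = θ ^ 2 / (16 * (4 : ℝ) ^ ℓ) * ∑ m ∈ win K, ‖ζ m n‖ ^ 2 := by
        have hsq : (Real.pi * |θ| / 2) ^ 2 = Real.pi ^ 2 * θ ^ 2 / 4 := by rw [div_pow, mul_pow, sq_abs]; ring
        rw [hsq]
        field_simp
        ring

/-! ## §3 (p2 g14) The slot INCREMENT: `√E(Tζ) ≤ √E(ζ) + min(δ_ℓ·√Ens ζ, (1+√(θ²+2))·√E ζ)` and its `(1/4, 3/4)` interpolation -/

/-- The energy is a weighted sum of squares over the window (product form). -/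
theorem cEnergy_eq_sum_product (α β : ℝ) (ℓ K : ℕ) (ζ : CState) :
    cEnergy α β ℓ K ζ = ∑ p ∈ win K ×ˢ win K, (1 / (4 * Real.pi ^ 2 * (4 : ℝ) ^ ℓ * ((α + p.1) ^ 2 + (β + p.2) ^ 2))) * ‖ζ p.1 p.2‖ ^ 2 := by
  unfold cEnergy
  rw [Finset.sum_product]
  refine Finset.sum_congr rfl fun m _ => Finset.sum_congr rfl fun n _ => ?_
  rw [div_eq_mul_one_div, mul_comm]

/-- **Minkowski for the level energy:** `√E(x + y) ≤ √E(x) + √E(y)`. -/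
theorem sqrt_cEnergy_add_le (α β : ℝ) (ℓ K : ℕ) (x y : CState) :
    Real.sqrt (cEnergy α β ℓ K (fun m n => x m n + y m n)) ≤ Real.sqrt (cEnergy α β ℓ K x) + Real.sqrt (cEnergy α β ℓ K y) := by
  rw [cEnergy_eq_sum_product, cEnergy_eq_sum_product, cEnergy_eq_sum_product]
  exact sqrt_sum_mul_norm_add_sq_le (win K ×ˢ win K) _ (fun p _ => by positivity) (fun p => x p.1 p.2) (fun p => y p.1 p.2)

/-- `E(−ζ) = E(ζ)`. -/
theorem cEnergy_neg (α β : ℝ) (ℓ K : ℕ) (ζ : CState) : cEnergy α β ℓ K (fun m n => -ζ m n) = cEnergy α β ℓ K ζ := by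
  unfold cEnergy
  simp_rw [norm_neg]

/-- **The H-slot increment.**  `√E(hTransport ζ) ≤ √E(ζ) + min(|θ|/4/2^ℓ · √Ens ζ, (1 + √(θ²+2)) · √E ζ)` (freezing, resp. duality + Minkowski). -/
theorem sqrt_cEnergy_hTransport_le (α β θ : ℝ) (ℓ K : ℕ) (ζ : CState) :
    Real.sqrt (cEnergy α β ℓ K (hTransport α β θ K ζ)) ≤ Real.sqrt (cEnergy α β ℓ K ζ) +
      min (|θ| / 4 / 2 ^ ℓ * Real.sqrt (ens K ζ)) ((1 + Real.sqrt (θ ^ 2 + 2)) * Real.sqrt (cEnergy α β ℓ K ζ)) := by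
  set D : CState := fun m n => hTransport α β θ K ζ m n - ζ m n with hD
  have hsplit : hTransport α β θ K ζ = fun m n => ζ m n + D m n := by
    funext m n; rw [hD]; simp only; ring
  have hE0 := cEnergy_nonneg α β ℓ K ζ
  -- freezing
  have h1 : Real.sqrt (cEnergy α β ℓ K D) ≤ |θ| / 4 / 2 ^ ℓ * Real.sqrt (ens K ζ) := by
    have hf := cEnergy_hTransport_sub_le α β θ ℓ K ζ
    rw [← hD] at hf
    calc Real.sqrt (cEnergy α β ℓ K D) ≤ Real.sqrt (θ ^ 2 / (16 * (4 : ℝ) ^ ℓ) * ens K ζ) := Real.sqrt_le_sqrt hf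
      _ = |θ| / 4 / 2 ^ ℓ * Real.sqrt (ens K ζ) := by
          rw [Real.sqrt_mul (by positivity), Real.sqrt_div (sq_nonneg θ), Real.sqrt_sq_eq_abs,
            show (16 * (4 : ℝ) ^ ℓ) = (4 * 2 ^ ℓ) ^ 2 by rw [mul_pow, ← pow_mul, show (4:ℝ)^2 = 16 by norm_num,
              show (2:ℝ) ^ (ℓ * 2) = 4 ^ ℓ by rw [mul_comm, pow_mul]; norm_num],
            Real.sqrt_sq (by positivity), div_div]
  -- duality + Minkowski
  have h2 : Real.sqrt (cEnergy α β ℓ K D) ≤ (1 + Real.sqrt (θ ^ 2 + 2)) * Real.sqrt (cEnergy α β ℓ K ζ) := by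
    have hD' : D = fun m n => hTransport α β θ K ζ m n + (fun m n => -ζ m n) m n := by
      funext m n; rw [hD]; simp only; ring
    have hdual : Real.sqrt (cEnergy α β ℓ K (hTransport α β θ K ζ)) ≤ Real.sqrt (θ ^ 2 + 2) * Real.sqrt (cEnergy α β ℓ K ζ) := by
      rw [← Real.sqrt_mul (by positivity)]
      exact Real.sqrt_le_sqrt (cEnergy_hTransport_le α β θ ℓ K ζ)
    calc Real.sqrt (cEnergy α β ℓ K D)
        ≤ Real.sqrt (cEnergy α β ℓ K (hTransport α β θ K ζ)) + Real.sqrt (cEnergy α β ℓ K (fun m n => -ζ m n)) := by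
          rw [hD']; exact sqrt_cEnergy_add_le α β ℓ K _ _
      _ ≤ Real.sqrt (θ ^ 2 + 2) * Real.sqrt (cEnergy α β ℓ K ζ) + Real.sqrt (cEnergy α β ℓ K ζ) := by
          rw [cEnergy_neg]; exact add_le_add hdual le_rfl
      _ = (1 + Real.sqrt (θ ^ 2 + 2)) * Real.sqrt (cEnergy α β ℓ K ζ) := by ring
  calc Real.sqrt (cEnergy α β ℓ K (hTransport α β θ K ζ)) = Real.sqrt (cEnergy α β ℓ K (fun m n => ζ m n + D m n)) := by rw [hsplit]
    _ ≤ Real.sqrt (cEnergy α β ℓ K ζ) + Real.sqrt (cEnergy α β ℓ K D) := sqrt_cEnergy_add_le α β ℓ K ζ D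
    _ ≤ _ := add_le_add le_rfl (le_min h1 h2)

/-- **The V-slot increment.**  `√E(vTransport ζ) ≤ √E(ζ) + min(|θ|/4/2^ℓ · √Ens ζ, (1 + √(θ²+2)) · √E ζ)`. -/
theorem sqrt_cEnergy_vTransport_le (α β θ : ℝ) (ℓ K : ℕ) (ζ : CState) :
    Real.sqrt (cEnergy α β ℓ K (vTransport α β θ K ζ)) ≤ Real.sqrt (cEnergy α β ℓ K ζ) +
      min (|θ| / 4 / 2 ^ ℓ * Real.sqrt (ens K ζ)) ((1 + Real.sqrt (θ ^ 2 + 2)) * Real.sqrt (cEnergy α β ℓ K ζ)) := by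
  set D : CState := fun m n => vTransport α β θ K ζ m n - ζ m n with hD
  have hsplit : vTransport α β θ K ζ = fun m n => ζ m n + D m n := by
    funext m n; rw [hD]; simp only; ring
  have hE0 := cEnergy_nonneg α β ℓ K ζ
  have h1 : Real.sqrt (cEnergy α β ℓ K D) ≤ |θ| / 4 / 2 ^ ℓ * Real.sqrt (ens K ζ) := by
    have hf := cEnergy_vTransport_sub_le α β θ ℓ K ζ
    rw [← hD] at hf
    calc Real.sqrt (cEnergy α β ℓ K D) ≤ Real.sqrt (θ ^ 2 / (16 * (4 : ℝ) ^ ℓ) * ens K ζ) := Real.sqrt_le_sqrt hf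
      _ = |θ| / 4 / 2 ^ ℓ * Real.sqrt (ens K ζ) := by
          rw [Real.sqrt_mul (by positivity), Real.sqrt_div (sq_nonneg θ), Real.sqrt_sq_eq_abs,
            show (16 * (4 : ℝ) ^ ℓ) = (4 * 2 ^ ℓ) ^ 2 by rw [mul_pow, ← pow_mul, show (4:ℝ)^2 = 16 by norm_num,
              show (2:ℝ) ^ (ℓ * 2) = 4 ^ ℓ by rw [mul_comm, pow_mul]; norm_num],
            Real.sqrt_sq (by positivity), div_div]
  have h2 : Real.sqrt (cEnergy α β ℓ K D) ≤ (1 + Real.sqrt (θ ^ 2 + 2)) * Real.sqrt (cEnergy α β ℓ K ζ) := by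
    have hD' : D = fun m n => vTransport α β θ K ζ m n + (fun m n => -ζ m n) m n := by
      funext m n; rw [hD]; simp only; ring
    have hdual : Real.sqrt (cEnergy α β ℓ K (vTransport α β θ K ζ)) ≤ Real.sqrt (θ ^ 2 + 2) * Real.sqrt (cEnergy α β ℓ K ζ) := by
      rw [← Real.sqrt_mul (by positivity)]
      exact Real.sqrt_le_sqrt (cEnergy_vTransport_le α β θ ℓ K ζ)
    calc Real.sqrt (cEnergy α β ℓ K D)
        ≤ Real.sqrt (cEnergy α β ℓ K (vTransport α β θ K ζ)) + Real.sqrt (cEnergy α β ℓ K (fun m n => -ζ m n)) := by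
          rw [hD']; exact sqrt_cEnergy_add_le α β ℓ K _ _
      _ ≤ Real.sqrt (θ ^ 2 + 2) * Real.sqrt (cEnergy α β ℓ K ζ) + Real.sqrt (cEnergy α β ℓ K ζ) := by
          rw [cEnergy_neg]; exact add_le_add hdual le_rfl
      _ = (1 + Real.sqrt (θ ^ 2 + 2)) * Real.sqrt (cEnergy α β ℓ K ζ) := by ring
  calc Real.sqrt (cEnergy α β ℓ K (vTransport α β θ K ζ)) = Real.sqrt (cEnergy α β ℓ K (fun m n => ζ m n + D m n)) := by rw [hsplit]
    _ ≤ Real.sqrt (cEnergy α β ℓ K ζ) + Real.sqrt (cEnergy α β ℓ K D) := sqrt_cEnergy_add_le α β ℓ K ζ D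
    _ ≤ _ := add_le_add le_rfl (le_min h1 h2)

/-! ## §4 (p2 g14, v4: interpolation exponent s = 5/8) THE AGE LAW FOR EVERY WINDOWED STATE: `debrisOut θ K tgt s′ k ℓ α β ζ ≤ C_out·(√E + 2κ₀·12^k·2^{−3ℓ/8}·Ens^{3/16}E^{5/16})²` -/

/-- `x^{1/4}`, written `√√x`. -/
def qrt (x : ℝ) : ℝ := Real.sqrt (Real.sqrt x)

/-- `x^{3/4}`, written `√(x√x)`. -/
def tqr (x : ℝ) : ℝ := Real.sqrt (x * Real.sqrt x)

/-- The interpolation functional `Y(N, E) = N^{1/8}E^{3/8} = √(N^{1/4}E^{3/4})` (N = windowed enstrophy, E = level energy). -/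
def Yfun (N E : ℝ) : ℝ := Real.sqrt (qrt N * tqr E)

theorem qrt_nonneg (x : ℝ) : 0 ≤ qrt x := Real.sqrt_nonneg _
theorem tqr_nonneg (x : ℝ) : 0 ≤ tqr x := Real.sqrt_nonneg _
theorem Yfun_nonneg (N E : ℝ) : 0 ≤ Yfun N E := Real.sqrt_nonneg _

theorem qrt_mul {x : ℝ} (hx : 0 ≤ x) (y : ℝ) : qrt (x * y) = qrt x * qrt y := by
  unfold qrt; rw [Real.sqrt_mul hx, Real.sqrt_mul (Real.sqrt_nonneg x)]

theorem tqr_mul {x y : ℝ} (hx : 0 ≤ x) (hy : 0 ≤ y) : tqr (x * y) = tqr x * tqr y := by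
  unfold tqr
  have hy' : 0 ≤ y * Real.sqrt y := mul_nonneg hy (Real.sqrt_nonneg y)
  rw [Real.sqrt_mul hx, show x * y * (Real.sqrt x * Real.sqrt y) = (x * Real.sqrt x) * (y * Real.sqrt y) by ring,
    Real.sqrt_mul' _ hy']

theorem qrt_le_qrt {x y : ℝ} (h : x ≤ y) : qrt x ≤ qrt y := Real.sqrt_le_sqrt (Real.sqrt_le_sqrt h)

theorem tqr_le_tqr {x y : ℝ} (hx : 0 ≤ x) (h : x ≤ y) : tqr x ≤ tqr y :=
  Real.sqrt_le_sqrt (mul_le_mul h (Real.sqrt_le_sqrt h) (Real.sqrt_nonneg _) (hx.trans h))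

theorem qrt_mul_tqr {x : ℝ} (hx : 0 ≤ x) : qrt x * tqr x = x := by
  unfold qrt tqr
  rw [← Real.sqrt_mul (Real.sqrt_nonneg x), show Real.sqrt x * (x * Real.sqrt x) = x * x by
    rw [mul_left_comm, Real.mul_self_sqrt hx], Real.sqrt_mul_self hx]

theorem Yfun_sq (N E : ℝ) : Yfun N E ^ 2 = qrt N * tqr E := by
  unfold Yfun; rw [Real.sq_sqrt (mul_nonneg (qrt_nonneg _) (tqr_nonneg _))]

/-! ### Eighth roots: the exponent `s = 5/8` -/

/-- `x^{1/8}`, written `√(x^{1/4})`. -/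
def oct (x : ℝ) : ℝ := Real.sqrt (qrt x)

/-- `x^{3/8} = x^{1/4}·x^{1/8}`. -/
def p38 (x : ℝ) : ℝ := qrt x * oct x

/-- `x^{5/8} = x^{1/2}·x^{1/8}`. -/
def p58 (x : ℝ) : ℝ := Real.sqrt x * oct x

/-- The interpolation functional `Y(N, E) = N^{3/16}E^{5/16} = √(N^{3/8}E^{5/8})`. -/
def Y58 (N E : ℝ) : ℝ := Real.sqrt (p38 N * p58 E)

theorem oct_nonneg (x : ℝ) : 0 ≤ oct x := Real.sqrt_nonneg _
theorem p38_nonneg (x : ℝ) : 0 ≤ p38 x := mul_nonneg (qrt_nonneg _) (oct_nonneg _)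
theorem p58_nonneg (x : ℝ) : 0 ≤ p58 x := mul_nonneg (Real.sqrt_nonneg _) (oct_nonneg _)
theorem Y58_nonneg (N E : ℝ) : 0 ≤ Y58 N E := Real.sqrt_nonneg _

theorem oct_mul {x : ℝ} (hx : 0 ≤ x) (y : ℝ) : oct (x * y) = oct x * oct y := by
  unfold oct; rw [qrt_mul hx, Real.sqrt_mul (qrt_nonneg x)]

theorem p38_mul {x : ℝ} (hx : 0 ≤ x) (y : ℝ) : p38 (x * y) = p38 x * p38 y := by
  unfold p38; rw [qrt_mul hx, oct_mul hx]; ring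

theorem p58_mul {x : ℝ} (hx : 0 ≤ x) (y : ℝ) : p58 (x * y) = p58 x * p58 y := by
  unfold p58; rw [Real.sqrt_mul hx, oct_mul hx]; ring

theorem oct_le_oct {x y : ℝ} (h : x ≤ y) : oct x ≤ oct y := Real.sqrt_le_sqrt (qrt_le_qrt h)

theorem p38_le_p38 {x y : ℝ} (h : x ≤ y) : p38 x ≤ p38 y :=
  mul_le_mul (qrt_le_qrt h) (oct_le_oct h) (oct_nonneg _) (qrt_nonneg _)

theorem p58_le_p58 {x y : ℝ} (h : x ≤ y) : p58 x ≤ p58 y :=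
  mul_le_mul (Real.sqrt_le_sqrt h) (oct_le_oct h) (oct_nonneg _) (Real.sqrt_nonneg _)

theorem oct_sq (x : ℝ) : oct x ^ 2 = qrt x := by unfold oct; rw [Real.sq_sqrt (qrt_nonneg x)]
theorem qrt_sq (x : ℝ) : qrt x ^ 2 = Real.sqrt x := by unfold qrt; rw [Real.sq_sqrt (Real.sqrt_nonneg x)]

/-- `x^{3/8}·x^{5/8} = x`. -/
theorem p38_mul_p58 {x : ℝ} (hx : 0 ≤ x) : p38 x * p58 x = x := by
  unfold p38 p58
  have h1 : oct x * oct x = qrt x := by rw [← sq, oct_sq]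
  have h2 : qrt x * qrt x = Real.sqrt x := by rw [← sq, qrt_sq]
  calc qrt x * oct x * (Real.sqrt x * oct x) = (oct x * oct x) * qrt x * Real.sqrt x := by ring
    _ = (qrt x * qrt x) * Real.sqrt x := by rw [h1]
    _ = Real.sqrt x * Real.sqrt x := by rw [h2]
    _ = x := Real.mul_self_sqrt hx

/-- `p58 (G²) = (p58 G)²`. -/
theorem p58_sq_eq {G : ℝ} (hG : 0 ≤ G) : p58 (G ^ 2) = p58 G ^ 2 := by
  have h1 : p58 (G ^ 2) = p58 G * p58 G := by rw [sq, p58_mul hG]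
  rw [h1, sq]

theorem Y58_le_Y58 {N N' E E' : ℝ} (h1 : N ≤ N') (h2 : E ≤ E') : Y58 N E ≤ Y58 N' E' :=
  Real.sqrt_le_sqrt (mul_le_mul (p38_le_p38 h1) (p58_le_p58 h2) (p58_nonneg _) (p38_nonneg _))

theorem Y58_sq (N E : ℝ) : Y58 N E ^ 2 = p38 N * p58 E := by
  unfold Y58; rw [Real.sq_sqrt (mul_nonneg (p38_nonneg _) (p58_nonneg _))]

/-- Energy scaling: `Y(N, G²E) = G^{5/8}·Y(N, E)`. -/
theorem Y58_scale {G : ℝ} (hG : 0 ≤ G) (N E : ℝ) : Y58 N (G ^ 2 * E) = p58 G * Y58 N E := by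
  unfold Y58
  rw [p58_mul (by positivity), p58_sq_eq hG, mul_left_comm, Real.sqrt_mul (by positivity), Real.sqrt_sq (p58_nonneg _)]

/-- `p38 (√N) · p58 (√E) = Y(N, E)`. -/
theorem p38_sqrt_mul_p58_sqrt {N E : ℝ} (hN : 0 ≤ N) (hE : 0 ≤ E) : p38 (Real.sqrt N) * p58 (Real.sqrt E) = Y58 N E := by
  have h1 : p38 (Real.sqrt N) ^ 2 = p38 N := by rw [sq, ← p38_mul (Real.sqrt_nonneg N), Real.mul_self_sqrt hN]
  have h2 : p58 (Real.sqrt E) ^ 2 = p58 E := by rw [sq, ← p58_mul (Real.sqrt_nonneg E), Real.mul_self_sqrt hE]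
  unfold Y58
  rw [← h1, ← h2, ← mul_pow, Real.sqrt_sq (mul_nonneg (p38_nonneg _) (p58_nonneg _))]

/-- `min x y ≤ x^{3/8}·y^{5/8}` for `x, y ≥ 0`. -/
theorem min_le_p38_mul_p58 {x y : ℝ} (hx : 0 ≤ x) (hy : 0 ≤ y) : min x y ≤ p38 x * p58 y := by
  rcases le_total x y with h | h
  · rw [min_eq_left h]
    calc x = p38 x * p58 x := (p38_mul_p58 hx).symm
      _ ≤ p38 x * p58 y := mul_le_mul_of_nonneg_left (p58_le_p58 h) (p38_nonneg _)
  · rw [min_eq_right h]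
    calc y = p38 y * p58 y := (p38_mul_p58 hy).symm
      _ ≤ p38 x * p58 y := mul_le_mul_of_nonneg_right (p38_le_p38 h) (p58_nonneg _)

/-- The interpolation step at `s = 5/8`: `min(a√N, b√E) ≤ a^{3/8} b^{5/8} · Y(N, E)`. -/
theorem min_le_Y58 {a b N E : ℝ} (ha : 0 ≤ a) (hb : 0 ≤ b) (hN : 0 ≤ N) (hE : 0 ≤ E) :
    min (a * Real.sqrt N) (b * Real.sqrt E) ≤ p38 a * p58 b * Y58 N E := by
  refine (min_le_p38_mul_p58 (mul_nonneg ha (Real.sqrt_nonneg N)) (by positivity)).trans (le_of_eq ?_)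
  rw [p38_mul ha, p58_mul hb, ← p38_sqrt_mul_p58_sqrt hN hE]; ring

/-- Hölder over the children in `Y` form (exponent 3/4): `Σ_c Y(N_c, E_c)² ≤ Y(Σ N_c, Σ E_c)²`. -/
theorem sum_Yfun_sq_le {ι : Type*} (T : Finset ι) (N E : ι → ℝ) (hN : ∀ i ∈ T, 0 ≤ N i) (hE : ∀ i ∈ T, 0 ≤ E i) :
    ∑ i ∈ T, Yfun (N i) (E i) ^ 2 ≤ Yfun (∑ i ∈ T, N i) (∑ i ∈ T, E i) ^ 2 := by
  simp_rw [Yfun_sq]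
  exact sum_sqrt_sqrt_mul_le T N E hN hE

/-- `p38 a · p58 b = Y(a,b)_{1/4,3/4} · √(√a·√b)` — the Cauchy–Schwarz factorisation of the `(3/8, 5/8)` mean. -/
theorem p38_mul_p58_eq {a b : ℝ} (_ha : 0 ≤ a) (hb : 0 ≤ b) : p38 a * p58 b = Yfun a b * Real.sqrt (Real.sqrt a * Real.sqrt b) := by
  have hL : 0 ≤ p38 a * p58 b := mul_nonneg (p38_nonneg _) (p58_nonneg _)
  have hR : 0 ≤ Yfun a b * Real.sqrt (Real.sqrt a * Real.sqrt b) := mul_nonneg (Yfun_nonneg _ _) (Real.sqrt_nonneg _)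
  have hL2 : (p38 a * p58 b) ^ 2 = Real.sqrt a * qrt a * (b * qrt b) := by
    unfold p38 p58
    rw [show (qrt a * oct a * (Real.sqrt b * oct b)) ^ 2 = (qrt a ^ 2 * oct a ^ 2) * (Real.sqrt b ^ 2 * oct b ^ 2) by ring,
      oct_sq, oct_sq, qrt_sq, Real.sq_sqrt hb]
  have hR2 : (Yfun a b * Real.sqrt (Real.sqrt a * Real.sqrt b)) ^ 2 = Real.sqrt a * qrt a * (b * qrt b) := by
    rw [mul_pow, Yfun_sq, Real.sq_sqrt (by positivity)]
    have htb : tqr b = Real.sqrt b * qrt b := by unfold tqr qrt; rw [Real.sqrt_mul hb]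
    rw [htb, show qrt a * (Real.sqrt b * qrt b) * (Real.sqrt a * Real.sqrt b) = Real.sqrt a * qrt a * ((Real.sqrt b * Real.sqrt b) * qrt b) by ring,
      Real.mul_self_sqrt hb]
  rw [← Real.sqrt_sq hL, ← Real.sqrt_sq hR, hL2, hR2]

/-- **Hölder `(8/3, 8/5)` with roots:** `Σ_i p38(a_i)·p58(b_i) ≤ p38(Σ a)·p58(Σ b)` (Cauchy–Schwarz on the `(1/4,3/4)` and `(1/2,1/2)` means). -/
theorem sum_p38_mul_p58_le {ι : Type*} (T : Finset ι) (a b : ι → ℝ) (ha : ∀ i ∈ T, 0 ≤ a i) (hb : ∀ i ∈ T, 0 ≤ b i) :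
    ∑ i ∈ T, p38 (a i) * p58 (b i) ≤ p38 (∑ i ∈ T, a i) * p58 (∑ i ∈ T, b i) := by
  have hA : 0 ≤ ∑ i ∈ T, a i := Finset.sum_nonneg ha
  have hB : 0 ≤ ∑ i ∈ T, b i := Finset.sum_nonneg hb
  rw [Finset.sum_congr rfl fun i hi => p38_mul_p58_eq (ha i hi) (hb i hi), p38_mul_p58_eq hA hB]
  -- Cauchy–Schwarz
  have cs : (∑ i ∈ T, Yfun (a i) (b i) * Real.sqrt (Real.sqrt (a i) * Real.sqrt (b i))) ^ 2 ≤
      (∑ i ∈ T, Yfun (a i) (b i) ^ 2) * (∑ i ∈ T, Real.sqrt (Real.sqrt (a i) * Real.sqrt (b i)) ^ 2) := Finset.sum_mul_sq_le_sq_mul_sq T _ _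
  have h1 : ∑ i ∈ T, Yfun (a i) (b i) ^ 2 ≤ Yfun (∑ i ∈ T, a i) (∑ i ∈ T, b i) ^ 2 := sum_Yfun_sq_le T a b ha hb
  have h2 : ∑ i ∈ T, Real.sqrt (Real.sqrt (a i) * Real.sqrt (b i)) ^ 2 ≤ Real.sqrt (Real.sqrt (∑ i ∈ T, a i) * Real.sqrt (∑ i ∈ T, b i)) ^ 2 := by
    rw [Finset.sum_congr rfl fun i hi => Real.sq_sqrt (mul_nonneg (Real.sqrt_nonneg _) (Real.sqrt_nonneg _)), Real.sq_sqrt (by positivity)]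
    have cs2 : (∑ i ∈ T, Real.sqrt (a i) * Real.sqrt (b i)) ^ 2 ≤ (∑ i ∈ T, Real.sqrt (a i) ^ 2) * (∑ i ∈ T, Real.sqrt (b i) ^ 2) :=
      Finset.sum_mul_sq_le_sq_mul_sq T _ _
    rw [Finset.sum_congr rfl fun i hi => Real.sq_sqrt (ha i hi), Finset.sum_congr rfl fun i hi => Real.sq_sqrt (hb i hi)] at cs2
    have h0 : 0 ≤ ∑ i ∈ T, Real.sqrt (a i) * Real.sqrt (b i) := Finset.sum_nonneg fun i _ => by positivity
    rw [← Real.sqrt_mul hA, ← Real.sqrt_sq h0]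
    exact Real.sqrt_le_sqrt cs2
  have hL0 : 0 ≤ ∑ i ∈ T, Yfun (a i) (b i) * Real.sqrt (Real.sqrt (a i) * Real.sqrt (b i)) := Finset.sum_nonneg fun i _ => mul_nonneg (Yfun_nonneg _ _) (Real.sqrt_nonneg _)
  have hR0 : 0 ≤ Yfun (∑ i ∈ T, a i) (∑ i ∈ T, b i) * Real.sqrt (Real.sqrt (∑ i ∈ T, a i) * Real.sqrt (∑ i ∈ T, b i)) :=
    mul_nonneg (Yfun_nonneg _ _) (Real.sqrt_nonneg _)
  have h3 : (∑ i ∈ T, Yfun (a i) (b i) * Real.sqrt (Real.sqrt (a i) * Real.sqrt (b i))) ^ 2 ≤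
      (Yfun (∑ i ∈ T, a i) (∑ i ∈ T, b i) * Real.sqrt (Real.sqrt (∑ i ∈ T, a i) * Real.sqrt (∑ i ∈ T, b i))) ^ 2 := by
    rw [mul_pow]
    exact cs.trans (mul_le_mul h1 h2 (Finset.sum_nonneg fun i _ => sq_nonneg _) (sq_nonneg _))
  calc _ = Real.sqrt ((∑ i ∈ T, Yfun (a i) (b i) * Real.sqrt (Real.sqrt (a i) * Real.sqrt (b i))) ^ 2) := (Real.sqrt_sq hL0).symm
    _ ≤ _ := Real.sqrt_le_sqrt h3
    _ = _ := Real.sqrt_sq hR0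

/-- Hölder over the children in `Y58` form: `Σ_c Y58(N_c, E_c)² ≤ Y58(Σ N_c, Σ E_c)²`. -/
theorem sum_Y58_sq_le {ι : Type*} (T : Finset ι) (N E : ι → ℝ) (hN : ∀ i ∈ T, 0 ≤ N i) (hE : ∀ i ∈ T, 0 ≤ E i) :
    ∑ i ∈ T, Y58 (N i) (E i) ^ 2 ≤ Y58 (∑ i ∈ T, N i) (∑ i ∈ T, E i) ^ 2 := by
  simp_rw [Y58_sq]
  exact sum_p38_mul_p58_le T N E hN hE

/-- The level-`ℓ` slot constant `κ(θ, ℓ) = (|θ|/4·2^{−ℓ})^{3/8} · (1+√(θ²+2))^{5/8} · (1 + (θ²+2)^{5/16})` (two slots: H then V; exponent `s = 5/8`). -/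
def kap (θ : ℝ) (ℓ : ℕ) : ℝ := p38 (|θ| / 4 / 2 ^ ℓ) * p58 (1 + Real.sqrt (θ ^ 2 + 2)) * (1 + p58 (Real.sqrt (θ ^ 2 + 2)))

theorem kap_nonneg (θ : ℝ) (ℓ : ℕ) : 0 ≤ kap θ ℓ := by
  unfold kap; exact mul_nonneg (mul_nonneg (p38_nonneg _) (p58_nonneg _)) (add_nonneg zero_le_one (p58_nonneg _))

/-- `κ(θ, ℓ) = κ(θ, 0) · (2^{−ℓ})^{3/8}`. -/
theorem kap_level (θ : ℝ) (ℓ : ℕ) : kap θ ℓ = kap θ 0 * p38 ((2 : ℝ)⁻¹ ^ ℓ) := by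
  unfold kap
  rw [pow_zero, div_one, show |θ| / 4 / 2 ^ ℓ = |θ| / 4 * (2 : ℝ)⁻¹ ^ ℓ by rw [inv_pow, div_eq_mul_inv], p38_mul (by positivity)]
  ring

/-- **The H-slot increment in `Y` form:** `√E(hTransport ζ) ≤ √E ζ + (|θ|/4/2^ℓ)^{3/8}(1+√(θ²+2))^{5/8}·Y(Ens ζ, E ζ)`. -/
theorem sqrt_cEnergy_hTransport_le_Y (α β θ : ℝ) (ℓ K : ℕ) (ζ : CState) :
    Real.sqrt (cEnergy α β ℓ K (hTransport α β θ K ζ)) ≤ Real.sqrt (cEnergy α β ℓ K ζ) +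
      p38 (|θ| / 4 / 2 ^ ℓ) * p58 (1 + Real.sqrt (θ ^ 2 + 2)) * Y58 (ens K ζ) (cEnergy α β ℓ K ζ) :=
  (sqrt_cEnergy_hTransport_le α β θ ℓ K ζ).trans (add_le_add le_rfl
    (min_le_Y58 (by positivity) (by positivity) (ens_nonneg K ζ) (cEnergy_nonneg α β ℓ K ζ)))

/-- **The V-slot increment in `Y` form.** -/
theorem sqrt_cEnergy_vTransport_le_Y (α β θ : ℝ) (ℓ K : ℕ) (ζ : CState) :
    Real.sqrt (cEnergy α β ℓ K (vTransport α β θ K ζ)) ≤ Real.sqrt (cEnergy α β ℓ K ζ) +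
      p38 (|θ| / 4 / 2 ^ ℓ) * p58 (1 + Real.sqrt (θ ^ 2 + 2)) * Y58 (ens K ζ) (cEnergy α β ℓ K ζ) :=
  (sqrt_cEnergy_vTransport_le α β θ ℓ K ζ).trans (add_le_add le_rfl
    (min_le_Y58 (by positivity) (by positivity) (ens_nonneg K ζ) (cEnergy_nonneg α β ℓ K ζ)))

/-- **The PHASE increment along the debris path:** `√E(debris of ζ) ≤ √E(ζ) + κ(θ, ℓ)·Y(Ens ζ, E ζ)` (H slot then V slot at level `ℓ`). -/
theorem sqrt_cEnergy_debris_le_Y (α β θ : ℝ) (ℓ K : ℕ) (ζ : CState) :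
    Real.sqrt (cEnergy α β ℓ K (phasePieces α β θ K ζ).debris) ≤
      Real.sqrt (cEnergy α β ℓ K ζ) + kap θ ℓ * Y58 (ens K ζ) (cEnergy α β ℓ K ζ) := by
  simp only [phasePieces]
  set X : CState := hTransport α β θ K ζ with hX
  set G : ℝ := θ ^ 2 + 2 with hG
  have hG0 : 0 ≤ G := by positivity
  have hE0 := cEnergy_nonneg α β ℓ K ζ
  have hEX : cEnergy α β ℓ K X ≤ Real.sqrt G ^ 2 * cEnergy α β ℓ K ζ := by
    rw [Real.sq_sqrt hG0]; exact cEnergy_hTransport_le α β θ ℓ K ζ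
  have hNX : ens K X ≤ ens K ζ := ens_hTransport_le α β θ K ζ
  have hYX : Y58 (ens K X) (cEnergy α β ℓ K X) ≤ p58 (Real.sqrt G) * Y58 (ens K ζ) (cEnergy α β ℓ K ζ) := by
    rw [← Y58_scale (Real.sqrt_nonneg G)]
    exact Y58_le_Y58 hNX hEX
  have h1 := sqrt_cEnergy_hTransport_le_Y α β θ ℓ K ζ
  have h2 := sqrt_cEnergy_vTransport_le_Y α β θ ℓ K X
  rw [← hX] at h1
  set q := p38 (|θ| / 4 / 2 ^ ℓ) * p58 (1 + Real.sqrt (θ ^ 2 + 2)) with hq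
  have hq0 : 0 ≤ q := mul_nonneg (p38_nonneg _) (p58_nonneg _)
  have hkap : kap θ ℓ = q * (1 + p58 (Real.sqrt G)) := by rw [hq, hG]; rfl
  calc Real.sqrt (cEnergy α β ℓ K (vTransport α β θ K X))
      ≤ Real.sqrt (cEnergy α β ℓ K X) + q * Y58 (ens K X) (cEnergy α β ℓ K X) := h2
    _ ≤ (Real.sqrt (cEnergy α β ℓ K ζ) + q * Y58 (ens K ζ) (cEnergy α β ℓ K ζ)) + q * (p58 (Real.sqrt G) * Y58 (ens K ζ) (cEnergy α β ℓ K ζ)) :=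
        add_le_add h1 (mul_le_mul_of_nonneg_left hYX hq0)
    _ = Real.sqrt (cEnergy α β ℓ K ζ) + kap θ ℓ * Y58 (ens K ζ) (cEnergy α β ℓ K ζ) := by rw [hkap]; ring

/-! ### Numerics: `2^{−3/8} ≤ 0.78`, `66^{5/8} ≤ 14` -/

theorem sqrt_le_of_sq_le {x y : ℝ} (hy : 0 ≤ y) (h : x ≤ y ^ 2) : Real.sqrt x ≤ y :=
  (Real.sqrt_le_sqrt h).trans (le_of_eq (Real.sqrt_sq hy))

/-- `(1/2)^{1/4} ≤ 0.841`. -/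
theorem qrt_half_le : qrt (2 : ℝ)⁻¹ ≤ 841 / 1000 := by
  unfold qrt
  have h1 : Real.sqrt (2 : ℝ)⁻¹ ≤ 7072 / 10000 := sqrt_le_of_sq_le (by norm_num) (by norm_num)
  exact sqrt_le_of_sq_le (by norm_num) (h1.trans (by norm_num))

/-- `(1/2)^{3/8} ≤ 0.78`. -/
theorem p38_half_le : p38 (2 : ℝ)⁻¹ ≤ 39 / 50 := by
  unfold p38 oct
  have h1 := qrt_half_le
  have h2 : Real.sqrt (qrt (2 : ℝ)⁻¹) ≤ 9171 / 10000 := sqrt_le_of_sq_le (by norm_num) (h1.trans (by norm_num))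
  have h0 : 0 ≤ qrt (2 : ℝ)⁻¹ := qrt_nonneg _
  nlinarith [Real.sqrt_nonneg (qrt (2 : ℝ)⁻¹)]

/-- `66^{5/8} ≤ 14`. -/
theorem p58_66_le : p58 66 ≤ 14 := by
  unfold p58 oct qrt
  have h1 : Real.sqrt 66 ≤ 65 / 8 := sqrt_le_of_sq_le (by norm_num) (by norm_num)
  have h2 : Real.sqrt (Real.sqrt 66) ≤ 2851 / 1000 := sqrt_le_of_sq_le (by norm_num) (h1.trans (by norm_num))
  have h3 : Real.sqrt (Real.sqrt (Real.sqrt 66)) ≤ 16885 / 10000 := sqrt_le_of_sq_le (by norm_num) (h2.trans (by norm_num))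
  have h0 : 0 ≤ Real.sqrt (Real.sqrt (Real.sqrt 66)) := Real.sqrt_nonneg _
  nlinarith [Real.sqrt_nonneg 66]

/-- **The rate inequality at `s = 5/8`:** `(1/2)^{3/8}·(1 + 2·(θ²+2)^{5/8}·12^k) ≤ 24·12^k` for `|θ| ≤ 8` (`2^{−3/8}·66^{5/8} ≈ 10.58 < 12`). -/
theorem rate_le_12 {θ : ℝ} (hθ : θ ^ 2 ≤ 64) (k : ℕ) : p38 (2 : ℝ)⁻¹ * (1 + p58 (θ ^ 2 + 2) * (2 * 12 ^ k)) ≤ 2 * 12 ^ (k + 1) := by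
  have h1 : p58 (θ ^ 2 + 2) ≤ 14 := (p58_le_p58 (by linarith)).trans p58_66_le
  have h2 := p38_half_le
  have h3 : 0 ≤ p38 (2 : ℝ)⁻¹ := p38_nonneg _
  have hpow : (1 : ℝ) ≤ 12 ^ k := one_le_pow₀ (by norm_num)
  have hX : (0 : ℝ) ≤ 12 ^ k := by positivity
  have h5 : 1 + p58 (θ ^ 2 + 2) * (2 * 12 ^ k) ≤ 1 + 14 * (2 * 12 ^ k) := by nlinarith
  calc p38 (2 : ℝ)⁻¹ * (1 + p58 (θ ^ 2 + 2) * (2 * 12 ^ k)) ≤ (39 / 50) * (1 + 14 * (2 * 12 ^ k)) :=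
        mul_le_mul h2 h5 (add_nonneg zero_le_one (mul_nonneg (p58_nonneg _) (by positivity))) (by norm_num)
    _ ≤ 2 * 12 ^ (k + 1) := by rw [pow_succ]; nlinarith

/-- The age-law coefficient `B(k, ℓ) = 2κ(θ, 0) · 12^k · (2^{−ℓ})^{3/8}`. -/
def Bcoef (θ : ℝ) (k ℓ : ℕ) : ℝ := 2 * kap θ 0 * 12 ^ k * p38 ((2 : ℝ)⁻¹ ^ ℓ)

theorem Bcoef_nonneg (θ : ℝ) (k ℓ : ℕ) : 0 ≤ Bcoef θ k ℓ := by
  unfold Bcoef; exact mul_nonneg (mul_nonneg (mul_nonneg (by norm_num) (kap_nonneg θ 0)) (by positivity)) (p38_nonneg _)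

/-- **The recursion of the coefficient:** `κ(θ, ℓ+1) + (θ²+2)^{5/8}·B(k, ℓ+1) ≤ B(k+1, ℓ)` for `|θ| ≤ 8`. -/
theorem Bcoef_step {θ : ℝ} (hθ : θ ^ 2 ≤ 64) (k ℓ : ℕ) : kap θ (ℓ + 1) + p58 (θ ^ 2 + 2) * Bcoef θ k (ℓ + 1) ≤ Bcoef θ (k + 1) ℓ := by
  rw [kap_level θ (ℓ + 1)]
  unfold Bcoef
  have hq : p38 ((2 : ℝ)⁻¹ ^ (ℓ + 1)) = p38 (2 : ℝ)⁻¹ * p38 ((2 : ℝ)⁻¹ ^ ℓ) := by rw [pow_succ, mul_comm, p38_mul (by positivity)]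
  rw [hq]
  set k0 := kap θ 0 with hk0
  set qℓ := p38 ((2 : ℝ)⁻¹ ^ ℓ) with hqℓ
  set qh := p38 (2 : ℝ)⁻¹ with hqh
  set tG := p58 (θ ^ 2 + 2) with htG
  have hk00 : 0 ≤ k0 := kap_nonneg θ 0
  have hqℓ0 : 0 ≤ qℓ := p38_nonneg _
  have key : qh * (1 + tG * (2 * 12 ^ k)) ≤ 2 * 12 ^ (k + 1) := rate_le_12 hθ k
  have : k0 * (qh * qℓ) + tG * (2 * k0 * 12 ^ k * (qh * qℓ)) = (k0 * qℓ) * (qh * (1 + tG * (2 * 12 ^ k))) := by ring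
  rw [this]
  calc (k0 * qℓ) * (qh * (1 + tG * (2 * 12 ^ k))) ≤ (k0 * qℓ) * (2 * 12 ^ (k + 1)) := mul_le_mul_of_nonneg_left key (by positivity)
    _ = 2 * k0 * 12 ^ (k + 1) * qℓ := by ring

/-! ### Minkowski and Hölder over the four children -/

/-- `Σ_c (x_c + B·y_c)² ≤ (√(Σ x_c²) + B·√(Σ y_c²))²` for nonnegative reals. -/
theorem sum_add_mul_sq_le {ι : Type*} (T : Finset ι) (x y : ι → ℝ) {B : ℝ} (hB : 0 ≤ B) :
    ∑ i ∈ T, (x i + B * y i) ^ 2 ≤ (Real.sqrt (∑ i ∈ T, x i ^ 2) + B * Real.sqrt (∑ i ∈ T, y i ^ 2)) ^ 2 := by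
  have h := sqrt_sum_mul_norm_add_sq_le T (fun _ => (1 : ℝ)) (fun _ _ => zero_le_one) (fun i => ((x i : ℝ) : ℂ)) (fun i => (((B * y i) : ℝ) : ℂ))
  simp only [one_mul, ← Complex.ofReal_add, Complex.norm_real, Real.norm_eq_abs, sq_abs] at h
  have e : Real.sqrt (∑ i ∈ T, (B * y i) ^ 2) = B * Real.sqrt (∑ i ∈ T, y i ^ 2) := by
    rw [show ∑ i ∈ T, (B * y i) ^ 2 = B ^ 2 * ∑ i ∈ T, y i ^ 2 by rw [Finset.mul_sum]; exact Finset.sum_congr rfl fun i _ => by ring,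
      Real.sqrt_mul (sq_nonneg B), Real.sqrt_sq hB]
  rw [e] at h
  have h0 : 0 ≤ ∑ i ∈ T, (x i + B * y i) ^ 2 := Finset.sum_nonneg fun i _ => sq_nonneg _
  calc ∑ i ∈ T, (x i + B * y i) ^ 2 = Real.sqrt (∑ i ∈ T, (x i + B * y i) ^ 2) ^ 2 := (Real.sq_sqrt h0).symm
    _ ≤ _ := pow_le_pow_left₀ (Real.sqrt_nonneg _) h 2

/-! ### The age law -/

/-- Monotonicity of the bound shape `(√E + B·Y)²` in `(E, Y)`-data. -/
theorem bound_mono {a a' b b' B : ℝ} (ha : 0 ≤ a) (hb : 0 ≤ b) (hB : 0 ≤ B) (h1 : a ≤ a') (h2 : b ≤ b') :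
    (a + B * b) ^ 2 ≤ (a' + B * b') ^ 2 :=
  pow_le_pow_left₀ (by positivity) (add_le_add h1 (mul_le_mul_of_nonneg_left h2 hB)) 2

/-- **THE AGE LAW FOR EVERY WINDOWED STATE (P2-D structure theorem #6).**  `0 ≤ θ ≤ 8`; modulo the one-phase output law of the target piece `(tgt, s′)`
(H, `s′ ≥ 3`: `outEnergyAt_H_le_cEnergy`; V: `outEnergyAt_le_of_lineLaw`), for every age `k`, level `ℓ`, class in `[0,1)²` and windowed state `ζ`:
`debrisOut θ K tgt s′ k ℓ α β ζ ≤ C_out·(√E + B(k,ℓ)·Ens^{3/16}E^{5/16})²`, `B(k,ℓ) = 2κ₀·12^k·2^{−3ℓ/8}` — rate 12 per age (duality: 66). -/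
theorem debrisOut_ageLaw_of_out {θ : ℝ} (hθ0 : 0 ≤ θ) (hθ : θ ≤ 8) {K : ℕ} {tgt : PType} {s' : ℕ} {Cout : ℝ} (hC : 0 ≤ Cout)
    (hout : ∀ (α β : ℝ) (ℓ : ℕ) (ζ : CState), 0 ≤ α → α ≤ 1 → 0 ≤ β → β ≤ 1 →
      outEnergyAt α β θ K ℓ s' (phasePieces α β θ K ζ) tgt ≤ Cout * cEnergy α β ℓ K ζ) :
    ∀ (k ℓ : ℕ) (α β : ℝ) (ζ : CState), 0 ≤ α → α < 1 → 0 ≤ β → β < 1 → (∀ m n : ℤ, (m ∉ win K ∨ n ∉ win K) → ζ m n = 0) →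
      debrisOut θ K tgt s' k ℓ α β ζ ≤
        Cout * (Real.sqrt (cEnergy α β ℓ K ζ) + Bcoef θ k ℓ * Y58 (ens K ζ) (cEnergy α β ℓ K ζ)) ^ 2 := by
  have hθ2 : θ ^ 2 ≤ 64 := by nlinarith
  intro k
  induction k with
  | zero =>
    intro ℓ α β ζ hα0 hα1 hβ0 hβ1 hζ
    simp only [debrisOut]
    have hchild : ∀ pm ∈ parities, ∀ pn ∈ parities,
        outEnergyAt ((α + pm) / 2) ((β + pn) / 2) θ K (ℓ + 1) s' (phasePieces ((α + pm) / 2) ((β + pn) / 2) θ K (child pm pn ζ)) tgt ≤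
          Cout * cEnergy ((α + pm) / 2) ((β + pn) / 2) (ℓ + 1) K (child pm pn ζ) := by
      intro pm hpm pn hpn
      have hpn' : (pn : ℝ) = 0 ∨ (pn : ℝ) = 1 := by
        have : pn = 0 ∨ pn = 1 := by simpa [parities] using hpn
        rcases this with h | h <;> simp [h]
      have hpm' : (pm : ℝ) = 0 ∨ (pm : ℝ) = 1 := by
        have : pm = 0 ∨ pm = 1 := by simpa [parities] using hpm
        rcases this with h | h <;> simp [h]
      have hb0 : 0 ≤ (β + pn) / 2 := by rcases hpn' with h | h <;> rw [h] <;> linarith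
      have hb1 : (β + pn) / 2 ≤ 1 := by rcases hpn' with h | h <;> rw [h] <;> linarith
      have ha0 : 0 ≤ (α + pm) / 2 := by rcases hpm' with h | h <;> rw [h] <;> linarith
      have ha1 : (α + pm) / 2 ≤ 1 := by rcases hpm' with h | h <;> rw [h] <;> linarith
      exact hout _ _ (ℓ + 1) _ ha0 ha1 hb0 hb1
    have hE0 := cEnergy_nonneg α β ℓ K ζ
    calc (∑ pm ∈ parities, ∑ pn ∈ parities,
            outEnergyAt ((α + pm) / 2) ((β + pn) / 2) θ K (ℓ + 1) s' (phasePieces ((α + pm) / 2) ((β + pn) / 2) θ K (child pm pn ζ)) tgt)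
        ≤ ∑ pm ∈ parities, ∑ pn ∈ parities, Cout * cEnergy ((α + pm) / 2) ((β + pn) / 2) (ℓ + 1) K (child pm pn ζ) :=
          Finset.sum_le_sum fun pm hpm => Finset.sum_le_sum fun pn hpn => hchild pm hpm pn hpn
      _ = Cout * ∑ pm ∈ parities, ∑ pn ∈ parities, cEnergy ((α + pm) / 2) ((β + pn) / 2) (ℓ + 1) K (child pm pn ζ) := by
          rw [Finset.mul_sum]; refine Finset.sum_congr rfl fun pm _ => ?_; rw [Finset.mul_sum]
      _ ≤ Cout * cEnergy α β ℓ K ζ := mul_le_mul_of_nonneg_left (sum_cEnergy_child_le α β ℓ K ζ hζ) hC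
      _ = Cout * Real.sqrt (cEnergy α β ℓ K ζ) ^ 2 := by rw [Real.sq_sqrt hE0]
      _ ≤ Cout * (Real.sqrt (cEnergy α β ℓ K ζ) + Bcoef θ 0 ℓ * Y58 (ens K ζ) (cEnergy α β ℓ K ζ)) ^ 2 := by
          refine mul_le_mul_of_nonneg_left (pow_le_pow_left₀ (Real.sqrt_nonneg _) ?_ 2) hC
          exact le_add_of_nonneg_right (mul_nonneg (Bcoef_nonneg θ 0 ℓ) (Y58_nonneg _ _))
  | succ k ih =>
    intro ℓ α β ζ hα0 hα1 hβ0 hβ1 hζ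
    simp only [debrisOut]
    set B := Bcoef θ (k + 1) ℓ with hB
    have hB0 : 0 ≤ B := Bcoef_nonneg θ (k + 1) ℓ
    set G : ℝ := θ ^ 2 + 2 with hG
    have hG0 : 0 ≤ G := by positivity
    -- per child
    have hchild : ∀ pm ∈ parities, ∀ pn ∈ parities,
        debrisOut θ K tgt s' k (ℓ + 1) ((α + pm) / 2) ((β + pn) / 2) (phasePieces ((α + pm) / 2) ((β + pn) / 2) θ K (child pm pn ζ)).debris ≤
          Cout * (Real.sqrt (cEnergy ((α + pm) / 2) ((β + pn) / 2) (ℓ + 1) K (child pm pn ζ)) +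
            B * Y58 (ens K (child pm pn ζ)) (cEnergy ((α + pm) / 2) ((β + pn) / 2) (ℓ + 1) K (child pm pn ζ))) ^ 2 := by
      intro pm hpm pn hpn
      have hpn' : (pn : ℝ) = 0 ∨ (pn : ℝ) = 1 := by
        have : pn = 0 ∨ pn = 1 := by simpa [parities] using hpn
        rcases this with h | h <;> simp [h]
      have hpm' : (pm : ℝ) = 0 ∨ (pm : ℝ) = 1 := by
        have : pm = 0 ∨ pm = 1 := by simpa [parities] using hpm
        rcases this with h | h <;> simp [h]
      have hb0 : 0 ≤ (β + pn) / 2 := by rcases hpn' with h | h <;> rw [h] <;> linarith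
      have hb1 : (β + pn) / 2 < 1 := by rcases hpn' with h | h <;> rw [h] <;> linarith
      have ha0 : 0 ≤ (α + pm) / 2 := by rcases hpm' with h | h <;> rw [h] <;> linarith
      have ha1 : (α + pm) / 2 < 1 := by rcases hpm' with h | h <;> rw [h] <;> linarith
      set α' := (α + pm) / 2
      set β' := (β + pn) / 2
      set Z := child pm pn ζ with hZ
      set D := (phasePieces α' β' θ K Z).debris with hD
      have hDw : ∀ m n : ℤ, (m ∉ win K ∨ n ∉ win K) → D m n = 0 := fun m n h => phasePieces_debris_apply_eq_zero _ _ θ K _ m n h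
      have hIH := ih (ℓ + 1) α' β' D ha0 ha1 hb0 hb1 hDw
      have hEZ := cEnergy_nonneg α' β' (ℓ + 1) K Z
      have hED := cEnergy_nonneg α' β' (ℓ + 1) K D
      -- data of the debris vs data of the child
      have h1 : Real.sqrt (cEnergy α' β' (ℓ + 1) K D) ≤ Real.sqrt (cEnergy α' β' (ℓ + 1) K Z) + kap θ (ℓ + 1) * Y58 (ens K Z) (cEnergy α' β' (ℓ + 1) K Z) :=
        sqrt_cEnergy_debris_le_Y α' β' θ (ℓ + 1) K Z
      have h2 : Y58 (ens K D) (cEnergy α' β' (ℓ + 1) K D) ≤ p58 G * Y58 (ens K Z) (cEnergy α' β' (ℓ + 1) K Z) := by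
        rw [← Y58_scale hG0]
        exact Y58_le_Y58 (ens_debris_le α' β' θ K Z) (cEnergy_debris_le α' β' θ (ℓ + 1) K Z)
      have h3 : Real.sqrt (cEnergy α' β' (ℓ + 1) K D) + Bcoef θ k (ℓ + 1) * Y58 (ens K D) (cEnergy α' β' (ℓ + 1) K D) ≤
          Real.sqrt (cEnergy α' β' (ℓ + 1) K Z) + B * Y58 (ens K Z) (cEnergy α' β' (ℓ + 1) K Z) := by
        have hstep := Bcoef_step hθ2 k ℓ
        have hY0 : 0 ≤ Y58 (ens K Z) (cEnergy α' β' (ℓ + 1) K Z) := Y58_nonneg _ _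
        have hBk0 : 0 ≤ Bcoef θ k (ℓ + 1) := Bcoef_nonneg θ k (ℓ + 1)
        calc Real.sqrt (cEnergy α' β' (ℓ + 1) K D) + Bcoef θ k (ℓ + 1) * Y58 (ens K D) (cEnergy α' β' (ℓ + 1) K D)
            ≤ (Real.sqrt (cEnergy α' β' (ℓ + 1) K Z) + kap θ (ℓ + 1) * Y58 (ens K Z) (cEnergy α' β' (ℓ + 1) K Z)) +
                Bcoef θ k (ℓ + 1) * (p58 G * Y58 (ens K Z) (cEnergy α' β' (ℓ + 1) K Z)) := add_le_add h1 (mul_le_mul_of_nonneg_left h2 hBk0)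
          _ = Real.sqrt (cEnergy α' β' (ℓ + 1) K Z) + (kap θ (ℓ + 1) + p58 G * Bcoef θ k (ℓ + 1)) * Y58 (ens K Z) (cEnergy α' β' (ℓ + 1) K Z) := by ring
          _ ≤ Real.sqrt (cEnergy α' β' (ℓ + 1) K Z) + B * Y58 (ens K Z) (cEnergy α' β' (ℓ + 1) K Z) :=
                add_le_add le_rfl (mul_le_mul_of_nonneg_right hstep hY0)
      have h4 : 0 ≤ Real.sqrt (cEnergy α' β' (ℓ + 1) K D) + Bcoef θ k (ℓ + 1) * Y58 (ens K D) (cEnergy α' β' (ℓ + 1) K D) :=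
        add_nonneg (Real.sqrt_nonneg _) (mul_nonneg (Bcoef_nonneg θ k (ℓ + 1)) (Y58_nonneg _ _))
      exact hIH.trans (mul_le_mul_of_nonneg_left (pow_le_pow_left₀ h4 h3 2) hC)
    -- sum over the children: Minkowski + Hölder + re-framing
    set P := parities ×ˢ parities with hP
    set x : ℤ × ℤ → ℝ := fun c => Real.sqrt (cEnergy ((α + c.1) / 2) ((β + c.2) / 2) (ℓ + 1) K (child c.1 c.2 ζ)) with hx
    set y : ℤ × ℤ → ℝ := fun c => Y58 (ens K (child c.1 c.2 ζ)) (cEnergy ((α + c.1) / 2) ((β + c.2) / 2) (ℓ + 1) K (child c.1 c.2 ζ)) with hy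
    have hsum : (∑ pm ∈ parities, ∑ pn ∈ parities,
        debrisOut θ K tgt s' k (ℓ + 1) ((α + pm) / 2) ((β + pn) / 2) (phasePieces ((α + pm) / 2) ((β + pn) / 2) θ K (child pm pn ζ)).debris) ≤
        Cout * ∑ c ∈ P, (x c + B * y c) ^ 2 := by
      rw [hP, Finset.sum_product, Finset.mul_sum]
      refine Finset.sum_le_sum fun pm hpm => ?_
      rw [Finset.mul_sum]
      exact Finset.sum_le_sum fun pn hpn => hchild pm hpm pn hpn
    refine hsum.trans (mul_le_mul_of_nonneg_left ?_ hC)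
    refine (sum_add_mul_sq_le P x y hB0).trans ?_
    have hE0 := cEnergy_nonneg α β ℓ K ζ
    -- `Σ x_c² = Σ E_c ≤ E`
    have hxx : ∑ c ∈ P, x c ^ 2 ≤ cEnergy α β ℓ K ζ := by
      have e : ∑ c ∈ P, x c ^ 2 = ∑ pm ∈ parities, ∑ pn ∈ parities, cEnergy ((α + pm) / 2) ((β + pn) / 2) (ℓ + 1) K (child pm pn ζ) := by
        rw [hP, Finset.sum_product]
        exact Finset.sum_congr rfl fun pm _ => Finset.sum_congr rfl fun pn _ => Real.sq_sqrt (cEnergy_nonneg _ _ _ _ _)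
      rw [e]; exact sum_cEnergy_child_le α β ℓ K ζ hζ
    -- `Σ y_c² ≤ Y(N, E)²`
    have hyy : ∑ c ∈ P, y c ^ 2 ≤ Y58 (ens K ζ) (cEnergy α β ℓ K ζ) ^ 2 := by
      refine (sum_Y58_sq_le P (fun c => ens K (child c.1 c.2 ζ)) (fun c => cEnergy ((α + c.1) / 2) ((β + c.2) / 2) (ℓ + 1) K (child c.1 c.2 ζ))
        (fun c _ => ens_nonneg _ _) (fun c _ => cEnergy_nonneg _ _ _ _ _)).trans ?_
      have hN : ∑ c ∈ P, ens K (child c.1 c.2 ζ) ≤ ens K ζ := by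
        rw [hP, Finset.sum_product]; exact sum_ens_child_le K ζ hζ
      have hE : ∑ c ∈ P, cEnergy ((α + c.1) / 2) ((β + c.2) / 2) (ℓ + 1) K (child c.1 c.2 ζ) ≤ cEnergy α β ℓ K ζ := by
        rw [hP, Finset.sum_product]; exact sum_cEnergy_child_le α β ℓ K ζ hζ
      exact pow_le_pow_left₀ (Y58_nonneg _ _) (Y58_le_Y58 hN hE) 2
    have hsx : Real.sqrt (∑ c ∈ P, x c ^ 2) ≤ Real.sqrt (cEnergy α β ℓ K ζ) := Real.sqrt_le_sqrt hxx
    have hsy : Real.sqrt (∑ c ∈ P, y c ^ 2) ≤ Y58 (ens K ζ) (cEnergy α β ℓ K ζ) := by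
      rw [← Real.sqrt_sq (Y58_nonneg (ens K ζ) (cEnergy α β ℓ K ζ))]; exact Real.sqrt_le_sqrt hyy
    exact bound_mono (Real.sqrt_nonneg _) (Real.sqrt_nonneg _) hB0 hsx hsy

/-! ## §5 (p2 g14) LINEARITY of the debris path and the age law for a FINITE FAMILY of states (Minkowski over the family) -/

section family

variable {ι : Type*}

/-- Re-framing is linear (definitionally). -/
theorem child_finset_sum (I : Finset ι) (ζ : ι → CState) (pm pn : ℤ) :
    child pm pn (fun m n => ∑ i ∈ I, ζ i m n) = fun m n => ∑ i ∈ I, child pm pn (ζ i) m n := by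
  funext m n; rfl

/-- `hTransport` is linear (finite sums). -/
theorem hTransport_finset_sum (I : Finset ι) (ζ : ι → CState) (α β θ : ℝ) (K : ℕ) :
    hTransport α β θ K (fun m n => ∑ i ∈ I, ζ i m n) = fun m n' => ∑ i ∈ I, hTransport α β θ K (ζ i) m n' := by
  funext m n'
  by_cases h : m ∈ win K ∧ n' ∈ win K
  · rw [hTransport_apply_of_mem α β θ K _ h.1 h.2,
      Finset.sum_congr rfl fun i _ => hTransport_apply_of_mem α β θ K (ζ i) h.1 h.2]
    have hint : ∀ i ∈ I, IntervalIntegrable (fun y : ℝ => (∑ n ∈ win K, ζ i m n * Complex.exp ((2 * Real.pi * (β + n) * y : ℝ) * Complex.I)) *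
        Complex.exp (-((2 * Real.pi * (α + m) * θ * triWave y : ℝ) : ℂ) * Complex.I) * Complex.exp (-(2 * Real.pi * (β + n') * y : ℝ) * Complex.I))
        MeasureTheory.volume (-(1 / 2 : ℝ)) (1 / 2) := by
      intro i _
      apply Continuous.intervalIntegrable
      have := continuous_triWave'
      fun_prop
    rw [← intervalIntegral.integral_finsetSum hint]
    refine intervalIntegral.integral_congr fun y _ => ?_
    simp only [Finset.sum_mul]
    rw [Finset.sum_comm]
  · have h0 : ∀ Z : CState, hTransport α β θ K Z m n' = 0 := fun Z => by unfold hTransport; rw [if_neg h]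
    rw [h0]; simp_rw [h0]; simp

/-- `vTransport` is linear (finite sums). -/
theorem vTransport_finset_sum (I : Finset ι) (ζ : ι → CState) (α β θ : ℝ) (K : ℕ) :
    vTransport α β θ K (fun m n => ∑ i ∈ I, ζ i m n) = fun m' n => ∑ i ∈ I, vTransport α β θ K (ζ i) m' n := by
  funext m' n
  by_cases h : m' ∈ win K ∧ n ∈ win K
  · rw [vTransport_apply_of_mem α β θ K _ h.1 h.2,
      Finset.sum_congr rfl fun i _ => vTransport_apply_of_mem α β θ K (ζ i) h.1 h.2]
    have hint : ∀ i ∈ I, IntervalIntegrable (fun x : ℝ => (∑ m ∈ win K, ζ i m n * Complex.exp ((2 * Real.pi * (α + m) * x : ℝ) * Complex.I)) *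
        Complex.exp (-((2 * Real.pi * (β + n) * θ * triWave x : ℝ) : ℂ) * Complex.I) * Complex.exp (-(2 * Real.pi * (α + m') * x : ℝ) * Complex.I))
        MeasureTheory.volume (-(1 / 2 : ℝ)) (1 / 2) := by
      intro i _
      apply Continuous.intervalIntegrable
      have := continuous_triWave'
      fun_prop
    rw [← intervalIntegral.integral_finsetSum hint]
    refine intervalIntegral.integral_congr fun x _ => ?_
    simp only [Finset.sum_mul]
    rw [Finset.sum_comm]
  · have h0 : ∀ Z : CState, vTransport α β θ K Z m' n = 0 := fun Z => by unfold vTransport; rw [if_neg h]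
    rw [h0]; simp_rw [h0]; simp

/-- The debris of a phase is linear in the entering state (finite sums). -/
theorem debris_finset_sum (I : Finset ι) (ζ : ι → CState) (α β θ : ℝ) (K : ℕ) :
    (phasePieces α β θ K (fun m n => ∑ i ∈ I, ζ i m n)).debris = fun m n => ∑ i ∈ I, (phasePieces α β θ K (ζ i)).debris m n := by
  simp only [phasePieces]
  rw [hTransport_finset_sum, vTransport_finset_sum]

/-- The zero state has zero energy. -/
theorem cEnergy_zero (α β : ℝ) (ℓ K : ℕ) : cEnergy α β ℓ K (fun _ _ => 0) = 0 := by
  unfold cEnergy; simp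

/-- **Minkowski over a finite family:** `√E(Σ_i ζ_i) ≤ Σ_i √E(ζ_i)`. -/
theorem sqrt_cEnergy_finset_sum_le (α β : ℝ) (ℓ K : ℕ) (I : Finset ι) (ζ : ι → CState) :
    Real.sqrt (cEnergy α β ℓ K (fun m n => ∑ i ∈ I, ζ i m n)) ≤ ∑ i ∈ I, Real.sqrt (cEnergy α β ℓ K (ζ i)) := by
  classical
  induction I using Finset.induction_on with
  | empty => simp [cEnergy_zero]
  | @insert j I hj ih =>
    rw [Finset.sum_insert hj]
    have e : (fun m n => ∑ i ∈ insert j I, ζ i m n) = fun m n => ζ j m n + (fun m n => ∑ i ∈ I, ζ i m n) m n := by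
      funext m n; rw [Finset.sum_insert hj]
    rw [e]
    exact (sqrt_cEnergy_add_le α β ℓ K _ _).trans (add_le_add le_rfl ih)

/-- Two-term Minkowski for real families: `√Σ(x+y)² ≤ √Σx² + √Σy²`. -/
theorem sqrt_sum_add_sq_le {κ : Type*} (T : Finset κ) (x y : κ → ℝ) :
    Real.sqrt (∑ c ∈ T, (x c + y c) ^ 2) ≤ Real.sqrt (∑ c ∈ T, x c ^ 2) + Real.sqrt (∑ c ∈ T, y c ^ 2) := by
  have h := sqrt_sum_mul_norm_add_sq_le T (fun _ => (1 : ℝ)) (fun _ _ => zero_le_one) (fun c => ((x c : ℝ) : ℂ)) (fun c => ((y c : ℝ) : ℂ))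
  simpa only [one_mul, ← Complex.ofReal_add, Complex.norm_real, Real.norm_eq_abs, sq_abs] using h

/-- **Minkowski over a finite family, `ℓ²` over the children:** `√(Σ_c (Σ_i a_{i,c})²) ≤ Σ_i √(Σ_c a_{i,c}²)`. -/
theorem sqrt_sum_sq_finset_sum_le {κ : Type*} (T : Finset κ) (I : Finset ι) (a : ι → κ → ℝ) :
    Real.sqrt (∑ c ∈ T, (∑ i ∈ I, a i c) ^ 2) ≤ ∑ i ∈ I, Real.sqrt (∑ c ∈ T, a i c ^ 2) := by
  classical
  induction I using Finset.induction_on with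
  | empty => simp
  | @insert j I hj ih =>
    rw [Finset.sum_insert hj]
    simp_rw [Finset.sum_insert hj]
    exact (sqrt_sum_add_sq_le T (a j) (fun c => ∑ i ∈ I, a i c)).trans (add_le_add le_rfl ih)

/-- The per-child step of the age recursion (`|θ| ≤ 8`). -/
theorem child_step {θ : ℝ} (hθ2 : θ ^ 2 ≤ 64) (k ℓ : ℕ) (α' β' : ℝ) (K : ℕ) (Z : CState) :
    Real.sqrt (cEnergy α' β' (ℓ + 1) K (phasePieces α' β' θ K Z).debris) +
        Bcoef θ k (ℓ + 1) * Y58 (ens K (phasePieces α' β' θ K Z).debris) (cEnergy α' β' (ℓ + 1) K (phasePieces α' β' θ K Z).debris) ≤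
      Real.sqrt (cEnergy α' β' (ℓ + 1) K Z) + Bcoef θ (k + 1) ℓ * Y58 (ens K Z) (cEnergy α' β' (ℓ + 1) K Z) := by
  set D := (phasePieces α' β' θ K Z).debris with hD
  set G : ℝ := θ ^ 2 + 2 with hG
  have hG0 : 0 ≤ G := by positivity
  have hEZ := cEnergy_nonneg α' β' (ℓ + 1) K Z
  have hED := cEnergy_nonneg α' β' (ℓ + 1) K D
  have h1 : Real.sqrt (cEnergy α' β' (ℓ + 1) K D) ≤ Real.sqrt (cEnergy α' β' (ℓ + 1) K Z) + kap θ (ℓ + 1) * Y58 (ens K Z) (cEnergy α' β' (ℓ + 1) K Z) :=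
    sqrt_cEnergy_debris_le_Y α' β' θ (ℓ + 1) K Z
  have h2 : Y58 (ens K D) (cEnergy α' β' (ℓ + 1) K D) ≤ p58 G * Y58 (ens K Z) (cEnergy α' β' (ℓ + 1) K Z) := by
    rw [← Y58_scale hG0]
    exact Y58_le_Y58 (ens_debris_le α' β' θ K Z) (cEnergy_debris_le α' β' θ (ℓ + 1) K Z)
  have hstep := Bcoef_step hθ2 k ℓ
  have hY0 : 0 ≤ Y58 (ens K Z) (cEnergy α' β' (ℓ + 1) K Z) := Y58_nonneg _ _
  have hBk0 : 0 ≤ Bcoef θ k (ℓ + 1) := Bcoef_nonneg θ k (ℓ + 1)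
  calc Real.sqrt (cEnergy α' β' (ℓ + 1) K D) + Bcoef θ k (ℓ + 1) * Y58 (ens K D) (cEnergy α' β' (ℓ + 1) K D)
      ≤ (Real.sqrt (cEnergy α' β' (ℓ + 1) K Z) + kap θ (ℓ + 1) * Y58 (ens K Z) (cEnergy α' β' (ℓ + 1) K Z)) +
          Bcoef θ k (ℓ + 1) * (p58 G * Y58 (ens K Z) (cEnergy α' β' (ℓ + 1) K Z)) := add_le_add h1 (mul_le_mul_of_nonneg_left h2 hBk0)
    _ = Real.sqrt (cEnergy α' β' (ℓ + 1) K Z) + (kap θ (ℓ + 1) + p58 G * Bcoef θ k (ℓ + 1)) * Y58 (ens K Z) (cEnergy α' β' (ℓ + 1) K Z) := by ring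
    _ ≤ Real.sqrt (cEnergy α' β' (ℓ + 1) K Z) + Bcoef θ (k + 1) ℓ * Y58 (ens K Z) (cEnergy α' β' (ℓ + 1) K Z) :=
          add_le_add le_rfl (mul_le_mul_of_nonneg_right hstep hY0)

/-- `√(Σ_c (√E_c + B·Y_c)²) ≤ √E + B·Y` over the four children of a windowed state. -/
theorem children_collect (α β : ℝ) (ℓ K : ℕ) (ζ : CState) (hζ : ∀ m n : ℤ, (m ∉ win K ∨ n ∉ win K) → ζ m n = 0) {B : ℝ} (hB : 0 ≤ B) :
    Real.sqrt (∑ c ∈ parities ×ˢ parities, (Real.sqrt (cEnergy ((α + c.1) / 2) ((β + c.2) / 2) (ℓ + 1) K (child c.1 c.2 ζ)) +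
        B * Y58 (ens K (child c.1 c.2 ζ)) (cEnergy ((α + c.1) / 2) ((β + c.2) / 2) (ℓ + 1) K (child c.1 c.2 ζ))) ^ 2) ≤
      Real.sqrt (cEnergy α β ℓ K ζ) + B * Y58 (ens K ζ) (cEnergy α β ℓ K ζ) := by
  set P := parities ×ˢ parities with hP
  set x : ℤ × ℤ → ℝ := fun c => Real.sqrt (cEnergy ((α + c.1) / 2) ((β + c.2) / 2) (ℓ + 1) K (child c.1 c.2 ζ)) with hx
  set y : ℤ × ℤ → ℝ := fun c => Y58 (ens K (child c.1 c.2 ζ)) (cEnergy ((α + c.1) / 2) ((β + c.2) / 2) (ℓ + 1) K (child c.1 c.2 ζ)) with hy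
  have hxx : ∑ c ∈ P, x c ^ 2 ≤ cEnergy α β ℓ K ζ := by
    have e : ∑ c ∈ P, x c ^ 2 = ∑ pm ∈ parities, ∑ pn ∈ parities, cEnergy ((α + pm) / 2) ((β + pn) / 2) (ℓ + 1) K (child pm pn ζ) := by
      rw [hP, Finset.sum_product]
      exact Finset.sum_congr rfl fun pm _ => Finset.sum_congr rfl fun pn _ => Real.sq_sqrt (cEnergy_nonneg _ _ _ _ _)
    rw [e]; exact sum_cEnergy_child_le α β ℓ K ζ hζ
  have hyy : ∑ c ∈ P, y c ^ 2 ≤ Y58 (ens K ζ) (cEnergy α β ℓ K ζ) ^ 2 := by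
    refine (sum_Y58_sq_le P (fun c => ens K (child c.1 c.2 ζ)) (fun c => cEnergy ((α + c.1) / 2) ((β + c.2) / 2) (ℓ + 1) K (child c.1 c.2 ζ))
      (fun c _ => ens_nonneg _ _) (fun c _ => cEnergy_nonneg _ _ _ _ _)).trans ?_
    have hN : ∑ c ∈ P, ens K (child c.1 c.2 ζ) ≤ ens K ζ := by
      rw [hP, Finset.sum_product]; exact sum_ens_child_le K ζ hζ
    have hE : ∑ c ∈ P, cEnergy ((α + c.1) / 2) ((β + c.2) / 2) (ℓ + 1) K (child c.1 c.2 ζ) ≤ cEnergy α β ℓ K ζ := by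
      rw [hP, Finset.sum_product]; exact sum_cEnergy_child_le α β ℓ K ζ hζ
    exact pow_le_pow_left₀ (Y58_nonneg _ _) (Y58_le_Y58 hN hE) 2
  have hsx : Real.sqrt (∑ c ∈ P, x c ^ 2) ≤ Real.sqrt (cEnergy α β ℓ K ζ) := Real.sqrt_le_sqrt hxx
  have hsy : Real.sqrt (∑ c ∈ P, y c ^ 2) ≤ Y58 (ens K ζ) (cEnergy α β ℓ K ζ) := by
    rw [← Real.sqrt_sq (Y58_nonneg (ens K ζ) (cEnergy α β ℓ K ζ))]; exact Real.sqrt_le_sqrt hyy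
  have h := sum_add_mul_sq_le P x y hB
  have h0 : 0 ≤ Real.sqrt (∑ c ∈ P, x c ^ 2) + B * Real.sqrt (∑ c ∈ P, y c ^ 2) :=
    add_nonneg (Real.sqrt_nonneg _) (mul_nonneg hB (Real.sqrt_nonneg _))
  calc Real.sqrt (∑ c ∈ P, (x c + B * y c) ^ 2) ≤ Real.sqrt ((Real.sqrt (∑ c ∈ P, x c ^ 2) + B * Real.sqrt (∑ c ∈ P, y c ^ 2)) ^ 2) := Real.sqrt_le_sqrt h
    _ = Real.sqrt (∑ c ∈ P, x c ^ 2) + B * Real.sqrt (∑ c ∈ P, y c ^ 2) := Real.sqrt_sq h0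
    _ ≤ _ := add_le_add hsx (mul_le_mul_of_nonneg_left hsy hB)

/-- **THE AGE LAW FOR A FINITE FAMILY OF WINDOWED STATES** `Σ_i ζ_i` (linearity of the debris path + Minkowski over the family). -/
theorem debrisOut_ageLaw_family {θ : ℝ} (hθ0 : 0 ≤ θ) (hθ : θ ≤ 8) {K : ℕ} {tgt : PType} {s' : ℕ} {Cout : ℝ} (hC : 0 ≤ Cout)
    (hout : ∀ (α β : ℝ) (ℓ : ℕ) (ζ : CState), 0 ≤ α → α ≤ 1 → 0 ≤ β → β ≤ 1 →
      outEnergyAt α β θ K ℓ s' (phasePieces α β θ K ζ) tgt ≤ Cout * cEnergy α β ℓ K ζ) (I : Finset ι) :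
    ∀ (k ℓ : ℕ) (α β : ℝ) (ζ : ι → CState), 0 ≤ α → α < 1 → 0 ≤ β → β < 1 → (∀ i ∈ I, ∀ m n : ℤ, (m ∉ win K ∨ n ∉ win K) → ζ i m n = 0) →
      debrisOut θ K tgt s' k ℓ α β (fun m n => ∑ i ∈ I, ζ i m n) ≤
        Cout * (∑ i ∈ I, (Real.sqrt (cEnergy α β ℓ K (ζ i)) + Bcoef θ k ℓ * Y58 (ens K (ζ i)) (cEnergy α β ℓ K (ζ i)))) ^ 2 := by
  have hθ2 : θ ^ 2 ≤ 64 := by nlinarith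
  intro k
  induction k with
  | zero =>
    intro ℓ α β ζ hα0 hα1 hβ0 hβ1 hζ
    set S : CState := fun m n => ∑ i ∈ I, ζ i m n with hS
    have hSw : ∀ m n : ℤ, (m ∉ win K ∨ n ∉ win K) → S m n = 0 := fun m n h => by
      rw [hS]; exact Finset.sum_eq_zero fun i hi => hζ i hi m n h
    simp only [debrisOut]
    have hchild : ∀ pm ∈ parities, ∀ pn ∈ parities,
        outEnergyAt ((α + pm) / 2) ((β + pn) / 2) θ K (ℓ + 1) s' (phasePieces ((α + pm) / 2) ((β + pn) / 2) θ K (child pm pn S)) tgt ≤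
          Cout * cEnergy ((α + pm) / 2) ((β + pn) / 2) (ℓ + 1) K (child pm pn S) := by
      intro pm hpm pn hpn
      have hpn' : (pn : ℝ) = 0 ∨ (pn : ℝ) = 1 := by
        have : pn = 0 ∨ pn = 1 := by simpa [parities] using hpn
        rcases this with h | h <;> simp [h]
      have hpm' : (pm : ℝ) = 0 ∨ (pm : ℝ) = 1 := by
        have : pm = 0 ∨ pm = 1 := by simpa [parities] using hpm
        rcases this with h | h <;> simp [h]
      have hb0 : 0 ≤ (β + pn) / 2 := by rcases hpn' with h | h <;> rw [h] <;> linarith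
      have hb1 : (β + pn) / 2 ≤ 1 := by rcases hpn' with h | h <;> rw [h] <;> linarith
      have ha0 : 0 ≤ (α + pm) / 2 := by rcases hpm' with h | h <;> rw [h] <;> linarith
      have ha1 : (α + pm) / 2 ≤ 1 := by rcases hpm' with h | h <;> rw [h] <;> linarith
      exact hout _ _ (ℓ + 1) _ ha0 ha1 hb0 hb1
    have hE0 := cEnergy_nonneg α β ℓ K S
    have hmink := sqrt_cEnergy_finset_sum_le α β ℓ K I ζ
    rw [← hS] at hmink
    have hsum0 : 0 ≤ ∑ i ∈ I, Real.sqrt (cEnergy α β ℓ K (ζ i)) := Finset.sum_nonneg fun i _ => Real.sqrt_nonneg _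
    calc (∑ pm ∈ parities, ∑ pn ∈ parities,
            outEnergyAt ((α + pm) / 2) ((β + pn) / 2) θ K (ℓ + 1) s' (phasePieces ((α + pm) / 2) ((β + pn) / 2) θ K (child pm pn S)) tgt)
        ≤ ∑ pm ∈ parities, ∑ pn ∈ parities, Cout * cEnergy ((α + pm) / 2) ((β + pn) / 2) (ℓ + 1) K (child pm pn S) :=
          Finset.sum_le_sum fun pm hpm => Finset.sum_le_sum fun pn hpn => hchild pm hpm pn hpn
      _ = Cout * ∑ pm ∈ parities, ∑ pn ∈ parities, cEnergy ((α + pm) / 2) ((β + pn) / 2) (ℓ + 1) K (child pm pn S) := by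
          rw [Finset.mul_sum]; refine Finset.sum_congr rfl fun pm _ => ?_; rw [Finset.mul_sum]
      _ ≤ Cout * cEnergy α β ℓ K S := mul_le_mul_of_nonneg_left (sum_cEnergy_child_le α β ℓ K S hSw) hC
      _ = Cout * Real.sqrt (cEnergy α β ℓ K S) ^ 2 := by rw [Real.sq_sqrt hE0]
      _ ≤ Cout * (∑ i ∈ I, Real.sqrt (cEnergy α β ℓ K (ζ i))) ^ 2 :=
          mul_le_mul_of_nonneg_left (pow_le_pow_left₀ (Real.sqrt_nonneg _) hmink 2) hC
      _ ≤ Cout * (∑ i ∈ I, (Real.sqrt (cEnergy α β ℓ K (ζ i)) + Bcoef θ 0 ℓ * Y58 (ens K (ζ i)) (cEnergy α β ℓ K (ζ i)))) ^ 2 := by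
          refine mul_le_mul_of_nonneg_left (pow_le_pow_left₀ hsum0 (Finset.sum_le_sum fun i _ => ?_) 2) hC
          exact le_add_of_nonneg_right (mul_nonneg (Bcoef_nonneg θ 0 ℓ) (Y58_nonneg _ _))
  | succ k ih =>
    intro ℓ α β ζ hα0 hα1 hβ0 hβ1 hζ
    simp only [debrisOut]
    set B := Bcoef θ (k + 1) ℓ with hB
    have hB0 : 0 ≤ B := Bcoef_nonneg θ (k + 1) ℓ
    -- per child: linearity, the induction hypothesis on the family of debris states, and the per-child step
    have hchild : ∀ pm ∈ parities, ∀ pn ∈ parities,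
        debrisOut θ K tgt s' k (ℓ + 1) ((α + pm) / 2) ((β + pn) / 2)
            (phasePieces ((α + pm) / 2) ((β + pn) / 2) θ K (child pm pn (fun m n => ∑ i ∈ I, ζ i m n))).debris ≤
          Cout * (∑ i ∈ I, (Real.sqrt (cEnergy ((α + pm) / 2) ((β + pn) / 2) (ℓ + 1) K (child pm pn (ζ i))) +
            B * Y58 (ens K (child pm pn (ζ i))) (cEnergy ((α + pm) / 2) ((β + pn) / 2) (ℓ + 1) K (child pm pn (ζ i))))) ^ 2 := by
      intro pm hpm pn hpn
      have hpn' : (pn : ℝ) = 0 ∨ (pn : ℝ) = 1 := by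
        have : pn = 0 ∨ pn = 1 := by simpa [parities] using hpn
        rcases this with h | h <;> simp [h]
      have hpm' : (pm : ℝ) = 0 ∨ (pm : ℝ) = 1 := by
        have : pm = 0 ∨ pm = 1 := by simpa [parities] using hpm
        rcases this with h | h <;> simp [h]
      have hb0 : 0 ≤ (β + pn) / 2 := by rcases hpn' with h | h <;> rw [h] <;> linarith
      have hb1 : (β + pn) / 2 < 1 := by rcases hpn' with h | h <;> rw [h] <;> linarith
      have ha0 : 0 ≤ (α + pm) / 2 := by rcases hpm' with h | h <;> rw [h] <;> linarith
      have ha1 : (α + pm) / 2 < 1 := by rcases hpm' with h | h <;> rw [h] <;> linarith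
      set α' := (α + pm) / 2
      set β' := (β + pn) / 2
      rw [child_finset_sum, debris_finset_sum]
      set D : ι → CState := fun i => (phasePieces α' β' θ K (child pm pn (ζ i))).debris with hD
      have hDw : ∀ i ∈ I, ∀ m n : ℤ, (m ∉ win K ∨ n ∉ win K) → D i m n = 0 :=
        fun i _ m n h => phasePieces_debris_apply_eq_zero _ _ θ K _ m n h
      have hIH := ih (ℓ + 1) α' β' D ha0 ha1 hb0 hb1 hDw
      refine hIH.trans (mul_le_mul_of_nonneg_left (pow_le_pow_left₀ (Finset.sum_nonneg fun i _ =>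
        add_nonneg (Real.sqrt_nonneg _) (mul_nonneg (Bcoef_nonneg θ k (ℓ + 1)) (Y58_nonneg _ _))) (Finset.sum_le_sum fun i _ => ?_) 2) hC)
      exact child_step hθ2 k ℓ α' β' K (child pm pn (ζ i))
    -- sum over the children and collect the family by Minkowski
    set P := parities ×ˢ parities with hP
    set a : ι → ℤ × ℤ → ℝ := fun i c => Real.sqrt (cEnergy ((α + c.1) / 2) ((β + c.2) / 2) (ℓ + 1) K (child c.1 c.2 (ζ i))) +
      B * Y58 (ens K (child c.1 c.2 (ζ i))) (cEnergy ((α + c.1) / 2) ((β + c.2) / 2) (ℓ + 1) K (child c.1 c.2 (ζ i))) with ha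
    have hsum : (∑ pm ∈ parities, ∑ pn ∈ parities, debrisOut θ K tgt s' k (ℓ + 1) ((α + pm) / 2) ((β + pn) / 2)
        (phasePieces ((α + pm) / 2) ((β + pn) / 2) θ K (child pm pn (fun m n => ∑ i ∈ I, ζ i m n))).debris) ≤
        Cout * ∑ c ∈ P, (∑ i ∈ I, a i c) ^ 2 := by
      rw [hP, Finset.sum_product, Finset.mul_sum]
      refine Finset.sum_le_sum fun pm hpm => ?_
      rw [Finset.mul_sum]
      exact Finset.sum_le_sum fun pn hpn => hchild pm hpm pn hpn
    refine hsum.trans (mul_le_mul_of_nonneg_left ?_ hC)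
    have hmink := sqrt_sum_sq_finset_sum_le P I a
    have hcol : ∀ i ∈ I, Real.sqrt (∑ c ∈ P, a i c ^ 2) ≤
        Real.sqrt (cEnergy α β ℓ K (ζ i)) + B * Y58 (ens K (ζ i)) (cEnergy α β ℓ K (ζ i)) :=
      fun i hi => children_collect α β ℓ K (ζ i) (hζ i hi) hB0
    have h0 : 0 ≤ ∑ c ∈ P, (∑ i ∈ I, a i c) ^ 2 := Finset.sum_nonneg fun c _ => sq_nonneg _
    have h1 : 0 ≤ ∑ i ∈ I, Real.sqrt (∑ c ∈ P, a i c ^ 2) := Finset.sum_nonneg fun i _ => Real.sqrt_nonneg _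
    calc ∑ c ∈ P, (∑ i ∈ I, a i c) ^ 2 = Real.sqrt (∑ c ∈ P, (∑ i ∈ I, a i c) ^ 2) ^ 2 := (Real.sq_sqrt h0).symm
      _ ≤ (∑ i ∈ I, Real.sqrt (∑ c ∈ P, a i c ^ 2)) ^ 2 := pow_le_pow_left₀ (Real.sqrt_nonneg _) hmink 2
      _ ≤ _ := pow_le_pow_left₀ h1 (Finset.sum_le_sum hcol) 2

end family

/-! ## §6 (p2 g14) Row blocks of a V-input sheet; `DebrisTransfer α β θ K k V s tgt s′ (√C_out·D_V(θ,s)·12^k)` -/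

section blocks

/-- Dyadic row index `⌈log₂ |m|⌉` (`0` for `|m| ≤ 1`; `i ≥ 1` iff `2^{i−1} < |m| ≤ 2^i`). -/
def rowIdx (m : ℤ) : ℕ := Nat.clog 2 m.natAbs

/-- Row block `i` of a lattice state. -/
def rowBlock (i : ℕ) (Z : CState) : CState := fun m n => if rowIdx m = i then Z m n else 0

theorem rowBlock_windowed {K : ℕ} {Z : CState} (hZ : ∀ m n : ℤ, (m ∉ win K ∨ n ∉ win K) → Z m n = 0) (i : ℕ) :
    ∀ m n : ℤ, (m ∉ win K ∨ n ∉ win K) → rowBlock i Z m n = 0 := by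
  intro m n h; unfold rowBlock; split_ifs <;> simp [hZ m n h]

theorem natAbs_le_of_rowIdx (m : ℤ) : m.natAbs ≤ 2 ^ rowIdx m := Nat.le_pow_clog (by norm_num) _

theorem rowIdx_le_of_mem_win {K : ℕ} {m : ℤ} (hm : m ∈ win K) : rowIdx m ≤ K + 1 := by
  unfold rowIdx
  rw [Nat.clog_le_iff_le_pow (by norm_num)]
  rw [mem_win] at hm
  have h1 : m.natAbs ≤ K := by omega
  calc m.natAbs ≤ K := h1
    _ ≤ K + 1 := Nat.le_succ K
    _ ≤ 2 ^ (K + 1) := Nat.lt_two_pow_self.le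

/-- **The blocks reassemble the state** (windowed states have `rowIdx ≤ K+1` on their support). -/
theorem sum_rowBlock_eq {K : ℕ} {Z : CState} (hZ : ∀ m n : ℤ, (m ∉ win K ∨ n ∉ win K) → Z m n = 0) :
    (fun m n => ∑ i ∈ Finset.range (K + 2), rowBlock i Z m n) = Z := by
  funext m n
  simp only [rowBlock]
  rw [Finset.sum_ite_eq (Finset.range (K + 2)) (rowIdx m) (fun _ => Z m n)]
  split_ifs with h
  · rfl
  · rw [Finset.mem_range, not_lt] at h
    by_cases hm : m ∈ win K
    · have := rowIdx_le_of_mem_win hm; omega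
    · exact (hZ m n (Or.inl hm)).symm

/-- Rows of block `i ≥ 1` are far from the origin: `2^{i−1} ≤ |α + m|` for `α ∈ [0,1)`. -/
theorem abs_row_ge_of_rowIdx {α : ℝ} (hα0 : 0 ≤ α) (hα1 : α < 1) {m : ℤ} {i : ℕ} (hi : 1 ≤ i) (hm : rowIdx m = i) :
    (2 : ℝ) ^ (i - 1) ≤ |α + m| := by
  have hlt : 2 ^ (i - 1) < m.natAbs := by
    have : i - 1 < Nat.clog 2 m.natAbs := by unfold rowIdx at hm; omega
    exact (Nat.lt_clog_iff_pow_lt (by norm_num)).1 this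
  have h2 : ((m.natAbs : ℝ)) = |(m : ℝ)| := by rw [Nat.cast_natAbs, Int.cast_abs]
  have h1 : (2 : ℝ) ^ (i - 1) + 1 ≤ |(m : ℝ)| := by
    rw [← h2]; exact_mod_cast Nat.succ_le_of_lt hlt
  have h3 : |(m : ℝ)| ≤ |α + m| + |α| :=
    calc |(m : ℝ)| = |(α + m) + (-α)| := by ring_nf
      _ ≤ |α + m| + |-α| := abs_add_le _ _
      _ = |α + m| + |α| := by rw [abs_neg]
  rw [abs_of_nonneg hα0] at h3
  linarith

/-- A block has at most `2·2^i + 1` rows inside the window. -/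
theorem card_rowBlock_le (K i : ℕ) : ((((win K).filter fun m : ℤ => rowIdx m = i).card : ℕ) : ℝ) ≤ 2 * 2 ^ i + 1 := by
  have hsub : ((win K).filter fun m : ℤ => rowIdx m = i) ⊆ ((win K).filter fun m : ℤ => |(0 : ℝ) + m| ≤ 2 ^ i) := by
    intro m hm
    rw [Finset.mem_filter] at hm ⊢
    refine ⟨hm.1, ?_⟩
    rw [zero_add]
    have h := natAbs_le_of_rowIdx m
    rw [hm.2] at h
    have h' : ((m.natAbs : ℝ)) ≤ 2 ^ i := by exact_mod_cast h
    rwa [Nat.cast_natAbs, Int.cast_abs] at h'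
  calc ((((win K).filter fun m : ℤ => rowIdx m = i).card : ℕ) : ℝ) ≤ ((((win K).filter fun m : ℤ => |(0 : ℝ) + m| ≤ 2 ^ i).card : ℕ) : ℝ) := by
        exact_mod_cast Finset.card_le_card hsub
    _ ≤ 2 * 2 ^ i + 1 := card_filter_abs_le 0 (by positivity) (win K)

end blocks

section sheet

variable {α β θ : ℝ} {K : ℕ}

/-- The `ℓ²` size of every row of the V-input state: `Σ_n ‖Z(m,n)‖² ≤ 2·Σ_n (‖d n 0‖² + ‖d n 1‖²)`. -/
theorem row_norm_sq_inputState_V_le (α β θ : ℝ) (K : ℕ) (d : ℤ → Fin 2 → ℂ) (m : ℤ) :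
    ∑ n ∈ win K, ‖inputState α β θ K PType.V d m n‖ ^ 2 ≤ 2 * ∑ n ∈ win K, (‖d n 0‖ ^ 2 + ‖d n 1‖ ^ 2) := by
  rw [Finset.mul_sum]
  refine Finset.sum_le_sum fun n hn => ?_
  simp only [inputState, truncW]
  split_ifs with h
  · exact norm_sq_vPairState_le α d m n
  · simp only [norm_zero, ne_eq, OfNat.ofNat_ne_zero, not_false_eq_true, zero_pow]; positivity

/-- Enstrophy of a row block of the V input: `Ens(block i) ≤ (2·2^i+1)·2P₀ ≤ 6·2^i·P₀`. -/
theorem ens_rowBlock_inputState_V_le (α β θ : ℝ) (K : ℕ) (d : ℤ → Fin 2 → ℂ) (i : ℕ) :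
    ens K (rowBlock i (inputState α β θ K PType.V d)) ≤ 6 * 2 ^ i * ∑ n ∈ win K, (‖d n 0‖ ^ 2 + ‖d n 1‖ ^ 2) := by
  set P₀ := ∑ n ∈ win K, (‖d n 0‖ ^ 2 + ‖d n 1‖ ^ 2) with hP
  have hP0 : 0 ≤ P₀ := Finset.sum_nonneg fun _ _ => by positivity
  unfold ens
  have hrow : ∀ m ∈ win K, ∑ n ∈ win K, ‖rowBlock i (inputState α β θ K PType.V d) m n‖ ^ 2 ≤ if rowIdx m = i then 2 * P₀ else 0 := by
    intro m _
    simp only [rowBlock]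
    split_ifs with h
    · exact row_norm_sq_inputState_V_le α β θ K d m
    · simp
  refine (Finset.sum_le_sum hrow).trans ?_
  rw [← Finset.sum_filter]
  rw [Finset.sum_const, nsmul_eq_mul]
  have hc := card_rowBlock_le K i
  have h3 : (2 : ℝ) * 2 ^ i + 1 ≤ 3 * 2 ^ i := by have : (1:ℝ) ≤ 2 ^ i := one_le_pow₀ (by norm_num); linarith
  nlinarith

/-- Energy of a far row block (`i ≥ 1`) of the V input: `E(block i) ≤ 24·2^{−i}·P₀` (rows `|α+m| ≥ 2^{i−1}`, at most `3·2^i` of them). -/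
theorem cEnergy_rowBlock_inputState_V_le (hα0 : 0 ≤ α) (hα1 : α < 1) (β θ : ℝ) (K : ℕ) (d : ℤ → Fin 2 → ℂ) {i : ℕ} (hi : 1 ≤ i) :
    cEnergy α β 0 K (rowBlock i (inputState α β θ K PType.V d)) ≤ 24 * (2 : ℝ)⁻¹ ^ i * ∑ n ∈ win K, (‖d n 0‖ ^ 2 + ‖d n 1‖ ^ 2) := by
  set P₀ := ∑ n ∈ win K, (‖d n 0‖ ^ 2 + ‖d n 1‖ ^ 2) with hP
  have hP0 : 0 ≤ P₀ := Finset.sum_nonneg fun _ _ => by positivity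
  unfold cEnergy
  simp only [pow_zero, mul_one]
  have hpos : (0 : ℝ) < 4 ^ (i - 1) := by positivity
  have hrow : ∀ m ∈ win K, ∑ n ∈ win K, ‖rowBlock i (inputState α β θ K PType.V d) m n‖ ^ 2 / (4 * Real.pi ^ 2 * ((α + m) ^ 2 + (β + n) ^ 2)) ≤
      if rowIdx m = i then 2 * P₀ / 4 ^ (i - 1) else 0 := by
    intro m _
    simp only [rowBlock]
    split_ifs with h
    · have hfar : (2 : ℝ) ^ (i - 1) ≤ |α + m| := abs_row_ge_of_rowIdx hα0 hα1 hi h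
      have h4 : (4 : ℝ) ^ (i - 1) ≤ (α + m) ^ 2 := by
        calc (4 : ℝ) ^ (i - 1) = (2 ^ (i - 1)) ^ 2 := by rw [← pow_mul, show (4:ℝ) = 2^2 by norm_num, ← pow_mul]; ring_nf
          _ ≤ |α + m| ^ 2 := pow_le_pow_left₀ (by positivity) hfar 2
          _ = (α + m) ^ 2 := sq_abs _
      have hw : ∀ n : ℤ, ∀ v : ℂ, ‖v‖ ^ 2 / (4 * Real.pi ^ 2 * ((α + m) ^ 2 + (β + n) ^ 2)) ≤ ‖v‖ ^ 2 / 4 ^ (i - 1) := by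
        intro n v
        refine div_le_div_of_nonneg_left (sq_nonneg _) hpos ?_
        have hπ : (1:ℝ) ≤ Real.pi ^ 2 := by have := Real.pi_gt_three; nlinarith
        nlinarith [sq_nonneg (β + n)]
      calc ∑ n ∈ win K, ‖inputState α β θ K PType.V d m n‖ ^ 2 / (4 * Real.pi ^ 2 * ((α + m) ^ 2 + (β + n) ^ 2))
          ≤ ∑ n ∈ win K, ‖inputState α β θ K PType.V d m n‖ ^ 2 / 4 ^ (i - 1) := Finset.sum_le_sum fun n _ => hw n _
        _ = (∑ n ∈ win K, ‖inputState α β θ K PType.V d m n‖ ^ 2) / 4 ^ (i - 1) := by rw [Finset.sum_div]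
        _ ≤ 2 * P₀ / 4 ^ (i - 1) := div_le_div_of_nonneg_right (row_norm_sq_inputState_V_le α β θ K d m) hpos.le
    · simp
  refine (Finset.sum_le_sum hrow).trans ?_
  rw [← Finset.sum_filter, Finset.sum_const, nsmul_eq_mul]
  have hc := card_rowBlock_le K i
  have h3 : (2 : ℝ) * 2 ^ i + 1 ≤ 3 * 2 ^ i := by have : (1:ℝ) ≤ 2 ^ i := one_le_pow₀ (by norm_num); linarith
  have e4 : (4 : ℝ) ^ i = 4 ^ (i - 1) * 4 := by rw [← pow_succ]; congr 1; omega
  have e2 : (4 : ℝ) ^ i = 2 ^ i * 2 ^ i := by rw [← mul_pow]; norm_num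
  have hq : 0 ≤ 2 * P₀ / 4 ^ (i - 1) := by positivity
  calc ((((win K).filter fun m : ℤ => rowIdx m = i).card : ℕ) : ℝ) * (2 * P₀ / 4 ^ (i - 1))
      ≤ (3 * 2 ^ i) * (2 * P₀ / 4 ^ (i - 1)) := mul_le_mul_of_nonneg_right (hc.trans h3) hq
    _ = 24 * (2 : ℝ)⁻¹ ^ i * P₀ := by
        rw [inv_pow, show (4 : ℝ) ^ (i - 1) = 2 ^ i * 2 ^ i / 4 by rw [← e2, e4]; ring]
        field_simp
        ring

/-- `√x ≤ x^{1/4}` for `x ≤ 1`. -/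
theorem sqrt_le_qrt {x : ℝ} (hx1 : x ≤ 1) : Real.sqrt x ≤ qrt x := by
  unfold qrt
  rcases le_or_gt 0 x with hx | hx
  · refine Real.sqrt_le_sqrt ?_
    calc x = Real.sqrt x * Real.sqrt x := (Real.mul_self_sqrt hx).symm
      _ ≤ Real.sqrt x * 1 := mul_le_mul_of_nonneg_left (Real.sqrt_le_one.mpr hx1 |> fun h => by simpa using h) (Real.sqrt_nonneg x)
      _ = Real.sqrt x := mul_one _
  · rw [Real.sqrt_eq_zero_of_nonpos hx.le]; exact Real.sqrt_nonneg _

/-- `√x ≤ x^{1/8}` for `x ≤ 1`. -/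
theorem sqrt_le_oct {x : ℝ} (hx1 : x ≤ 1) : Real.sqrt x ≤ oct x := by
  have h1 := sqrt_le_qrt hx1
  have hq1 : qrt x ≤ 1 := by
    unfold qrt
    have : Real.sqrt x ≤ 1 := Real.sqrt_le_one.mpr hx1 |> fun h => by simpa using h
    calc Real.sqrt (Real.sqrt x) ≤ Real.sqrt 1 := Real.sqrt_le_sqrt this
      _ = 1 := Real.sqrt_one
  have h2 : qrt x ≤ oct x := by
    unfold oct
    calc qrt x = Real.sqrt (qrt x) * Real.sqrt (qrt x) := (Real.mul_self_sqrt (qrt_nonneg x)).symm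
      _ ≤ Real.sqrt (qrt x) * 1 := mul_le_mul_of_nonneg_left ((Real.sqrt_le_sqrt hq1).trans (le_of_eq Real.sqrt_one)) (Real.sqrt_nonneg _)
      _ = Real.sqrt (qrt x) := mul_one _
  exact h1.trans h2

/-- `oct (x^i) = (oct x)^i`. -/
theorem oct_pow {x : ℝ} (hx : 0 ≤ x) (i : ℕ) : oct (x ^ i) = oct x ^ i := by
  induction i with
  | zero => simp [oct, qrt]
  | succ i ih => rw [pow_succ, oct_mul (pow_nonneg hx i), ih, pow_succ]

/-- `qrt x · qrt x⁻¹ = 1`, `oct x · oct x⁻¹ = 1` (`x > 0`). -/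
theorem qrt_mul_qrt_inv {x : ℝ} (hx : 0 < x) : qrt x * qrt x⁻¹ = 1 := by
  rw [← qrt_mul hx.le, mul_inv_cancel₀ hx.ne']; simp [qrt]

theorem oct_mul_oct_inv {x : ℝ} (hx : 0 < x) : oct x * oct x⁻¹ = 1 := by
  rw [← oct_mul hx.le, mul_inv_cancel₀ hx.ne']; simp [oct, qrt]

/-- `x^{3/8}·(x⁻¹)^{5/8} = (x⁻¹)^{1/4}`. -/
theorem p38_mul_p58_inv {x : ℝ} (hx : 0 < x) : p38 x * p58 x⁻¹ = qrt x⁻¹ := by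
  unfold p38 p58
  have h1 := oct_mul_oct_inv hx
  have h2 := qrt_mul_qrt_inv hx
  -- `√(x⁻¹) = qrt x⁻¹ · qrt x⁻¹`
  have h3 : Real.sqrt x⁻¹ = qrt x⁻¹ * qrt x⁻¹ := by rw [← sq, qrt_sq]
  calc qrt x * oct x * (Real.sqrt x⁻¹ * oct x⁻¹) = (oct x * oct x⁻¹) * (qrt x * Real.sqrt x⁻¹) := by ring
    _ = qrt x * (qrt x⁻¹ * qrt x⁻¹) := by rw [h1, one_mul, h3]
    _ = (qrt x * qrt x⁻¹) * qrt x⁻¹ := by ring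
    _ = qrt x⁻¹ := by rw [h2, one_mul]

/-- `Y(a·2^i, a·2^{−i}) = √a · (2^{−i})^{1/8}`. -/
theorem Y58_dyadic {a : ℝ} (ha : 0 ≤ a) (i : ℕ) : Y58 (a * 2 ^ i) (a * (2 : ℝ)⁻¹ ^ i) = Real.sqrt a * oct ((2 : ℝ)⁻¹ ^ i) := by
  unfold Y58
  have key : p38 (2 ^ i) * p58 ((2 : ℝ)⁻¹ ^ i) = qrt ((2 : ℝ)⁻¹ ^ i) := by
    rw [inv_pow]; exact p38_mul_p58_inv (by positivity)
  rw [p38_mul ha, p58_mul ha, show p38 a * p38 (2 ^ i) * (p58 a * p58 ((2 : ℝ)⁻¹ ^ i)) =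
    (p38 a * p58 a) * (p38 (2 ^ i) * p58 ((2 : ℝ)⁻¹ ^ i)) by ring, p38_mul_p58 ha, key, Real.sqrt_mul ha]
  rfl

/-- `Y(λ·E, E) = √(λ^{3/8}) · √E`. -/
theorem Y58_self_scale {c E : ℝ} (hc : 0 ≤ c) (hE : 0 ≤ E) : Y58 (c * E) E = Real.sqrt (p38 c) * Real.sqrt E := by
  unfold Y58
  rw [p38_mul hc, mul_assoc, p38_mul_p58 hE, Real.sqrt_mul (p38_nonneg c)]

/-- Far row blocks (`i ≥ 1`) of the V input: `√E_i + B·Y(N_i, E_i) ≤ (1 + B)·√(24P₀)·(2^{−i})^{1/8}`. -/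
theorem block_term_far_le (hα0 : 0 ≤ α) (hα1 : α < 1) (β θ : ℝ) (K : ℕ) (d : ℤ → Fin 2 → ℂ) {i : ℕ} (hi : 1 ≤ i) {B : ℝ} (hB : 0 ≤ B) :
    Real.sqrt (cEnergy α β 0 K (rowBlock i (inputState α β θ K PType.V d))) +
        B * Y58 (ens K (rowBlock i (inputState α β θ K PType.V d))) (cEnergy α β 0 K (rowBlock i (inputState α β θ K PType.V d))) ≤
      (1 + B) * Real.sqrt (24 * ∑ n ∈ win K, (‖d n 0‖ ^ 2 + ‖d n 1‖ ^ 2)) * oct ((2 : ℝ)⁻¹ ^ i) := by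
  set P₀ := ∑ n ∈ win K, (‖d n 0‖ ^ 2 + ‖d n 1‖ ^ 2) with hP
  have hP0 : 0 ≤ P₀ := Finset.sum_nonneg fun _ _ => by positivity
  set Z := rowBlock i (inputState α β θ K PType.V d) with hZ
  have hE : cEnergy α β 0 K Z ≤ (24 * P₀) * (2 : ℝ)⁻¹ ^ i := by
    have := cEnergy_rowBlock_inputState_V_le hα0 hα1 β θ K d hi; rw [← hZ] at this; linarith [this]
  have hN : ens K Z ≤ (24 * P₀) * 2 ^ i := by
    have h1 := ens_rowBlock_inputState_V_le α β θ K d i; rw [← hZ] at h1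
    have : (6 : ℝ) * 2 ^ i * P₀ ≤ 24 * P₀ * 2 ^ i := by nlinarith [pow_nonneg (by norm_num : (0:ℝ) ≤ 2) i]
    exact h1.trans this
  have hE0 := cEnergy_nonneg α β 0 K Z
  have hY : Y58 (ens K Z) (cEnergy α β 0 K Z) ≤ Real.sqrt (24 * P₀) * oct ((2 : ℝ)⁻¹ ^ i) := by
    rw [← Y58_dyadic (by positivity) i]
    exact Y58_le_Y58 hN hE
  have hr1 : (2 : ℝ)⁻¹ ^ i ≤ 1 := pow_le_one₀ (by norm_num) (by norm_num)
  have hsE : Real.sqrt (cEnergy α β 0 K Z) ≤ Real.sqrt (24 * P₀) * oct ((2 : ℝ)⁻¹ ^ i) :=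
    calc Real.sqrt (cEnergy α β 0 K Z) ≤ Real.sqrt ((24 * P₀) * (2 : ℝ)⁻¹ ^ i) := Real.sqrt_le_sqrt hE
      _ = Real.sqrt (24 * P₀) * Real.sqrt ((2 : ℝ)⁻¹ ^ i) := Real.sqrt_mul (by positivity) _
      _ ≤ Real.sqrt (24 * P₀) * oct ((2 : ℝ)⁻¹ ^ i) := mul_le_mul_of_nonneg_left (sqrt_le_oct hr1) (Real.sqrt_nonneg _)
  calc Real.sqrt (cEnergy α β 0 K Z) + B * Y58 (ens K Z) (cEnergy α β 0 K Z)
      ≤ Real.sqrt (24 * P₀) * oct ((2 : ℝ)⁻¹ ^ i) + B * (Real.sqrt (24 * P₀) * oct ((2 : ℝ)⁻¹ ^ i)) := add_le_add hsE (mul_le_mul_of_nonneg_left hY hB)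
    _ = (1 + B) * Real.sqrt (24 * P₀) * oct ((2 : ℝ)⁻¹ ^ i) := by ring

/-- Near block (`i = 0`, rows `|m| ≤ 1`): `√E_0 + B·Y(N_0, E_0) ≤ √E + B·Y(24P₀, E)`. -/
theorem block_term_zero_le (α β θ : ℝ) (K : ℕ) (d : ℤ → Fin 2 → ℂ) {B : ℝ} (hB : 0 ≤ B) :
    Real.sqrt (cEnergy α β 0 K (rowBlock 0 (inputState α β θ K PType.V d))) +
        B * Y58 (ens K (rowBlock 0 (inputState α β θ K PType.V d))) (cEnergy α β 0 K (rowBlock 0 (inputState α β θ K PType.V d))) ≤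
      Real.sqrt (cEnergy α β 0 K (inputState α β θ K PType.V d)) +
        B * Y58 (24 * ∑ n ∈ win K, (‖d n 0‖ ^ 2 + ‖d n 1‖ ^ 2)) (cEnergy α β 0 K (inputState α β θ K PType.V d)) := by
  set P₀ := ∑ n ∈ win K, (‖d n 0‖ ^ 2 + ‖d n 1‖ ^ 2) with hP
  set Z₀ := inputState α β θ K PType.V d with hZ₀
  have hE : cEnergy α β 0 K (rowBlock 0 Z₀) ≤ cEnergy α β 0 K Z₀ := by
    unfold cEnergy
    refine Finset.sum_le_sum fun m _ => Finset.sum_le_sum fun n _ => div_le_div_of_nonneg_right ?_ (by positivity)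
    simp only [rowBlock]; split_ifs <;> simp
  have hN : ens K (rowBlock 0 Z₀) ≤ 24 * P₀ := by
    have h1 := ens_rowBlock_inputState_V_le α β θ K d 0
    rw [← hZ₀, pow_zero, mul_one] at h1
    have hP0 : 0 ≤ P₀ := Finset.sum_nonneg fun _ _ => by positivity
    linarith
  have hE0 := cEnergy_nonneg α β 0 K (rowBlock 0 Z₀)
  exact add_le_add (Real.sqrt_le_sqrt hE) (mul_le_mul_of_nonneg_left (Y58_le_Y58 hN hE) hB)

/-- `(1/2)^{1/8} ≤ 0.9171`. -/
theorem oct_half_le : oct (2 : ℝ)⁻¹ ≤ 9171 / 10000 := by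
  unfold oct
  exact sqrt_le_of_sq_le (by norm_num) (qrt_half_le.trans (by norm_num))

/-- The geometric tail at `s = 5/8`: `Σ_{i<n} (2^{−1/8})^{i+1} ≤ 12`. -/
theorem sum_oct_half_pow_le (n : ℕ) : ∑ i ∈ Finset.range n, oct (2 : ℝ)⁻¹ ^ (i + 1) ≤ 12 := by
  set r := oct (2 : ℝ)⁻¹ with hr
  have hr0 : 0 ≤ r := oct_nonneg _
  have hrle : r ≤ 9171 / 10000 := oct_half_le
  have hr1 : r < 1 := hrle.trans_lt (by norm_num)
  have hs : ∑ i ∈ Finset.range n, r ^ i ≤ 1 / (1 - r) := by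
    have h := geom_sum_Ico_le_of_lt_one hr0 hr1 (m := 0) (n := n)
    rw [pow_zero] at h
    rw [Finset.range_eq_Ico]
    exact h
  calc ∑ i ∈ Finset.range n, r ^ (i + 1) = r * ∑ i ∈ Finset.range n, r ^ i := by
        rw [Finset.mul_sum]; exact Finset.sum_congr rfl fun i _ => by ring
    _ ≤ r * (1 / (1 - r)) := mul_le_mul_of_nonneg_left hs hr0
    _ ≤ 12 := by
        rw [mul_one_div, div_le_iff₀ (by linarith)]
        nlinarith

end sheet

/-! ### Input energy of a V source in the small shells (`s ≤ 2`): rows `m = 1, 2` -/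

section smallShells

/-- **Parallelogram for two adjacent rows of a straight V pair:** `‖Z(m,n)‖² + ‖Z(m+1,n)‖² = 2(‖d n 0‖² + ‖d n 1‖²)` (the row phases differ by `π/2`). -/
theorem norm_sq_vPairState_rows_succ (α : ℝ) (d : ℤ → Fin 2 → ℂ) (m n : ℤ) :
    ‖vPairState α d m n‖ ^ 2 + ‖vPairState α d (m + 1) n‖ ^ 2 = 2 * (‖d n 0‖ ^ 2 + ‖d n 1‖ ^ 2) := by
  set u : ℂ := d n 0 * Complex.exp (-((Real.pi * (α + m) / 2 : ℝ) : ℂ) * Complex.I) with hu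
  set v : ℂ := d n 1 * Complex.exp (((Real.pi * (α + m) / 2 : ℝ) : ℂ) * Complex.I) with hv
  have h0 : vPairState α d m n = u + v := by simp only [vPairState, hu, hv]
  have hI1 : Complex.exp (-((Real.pi * (α + ((m + 1 : ℤ) : ℝ)) / 2 : ℝ) : ℂ) * Complex.I) =
      Complex.exp (-((Real.pi * (α + m) / 2 : ℝ) : ℂ) * Complex.I) * (-Complex.I) :=
    calc Complex.exp (-((Real.pi * (α + ((m + 1 : ℤ) : ℝ)) / 2 : ℝ) : ℂ) * Complex.I)
        = Complex.exp (-((Real.pi * (α + m) / 2 : ℝ) : ℂ) * Complex.I + (-Real.pi / 2 * Complex.I)) := by congr 1; push_cast; ring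
      _ = Complex.exp (-((Real.pi * (α + m) / 2 : ℝ) : ℂ) * Complex.I) * Complex.exp (-Real.pi / 2 * Complex.I) := Complex.exp_add _ _
      _ = _ := by rw [Complex.exp_neg_pi_div_two_mul_I]
  have hI2 : Complex.exp (((Real.pi * (α + ((m + 1 : ℤ) : ℝ)) / 2 : ℝ) : ℂ) * Complex.I) =
      Complex.exp (((Real.pi * (α + m) / 2 : ℝ) : ℂ) * Complex.I) * Complex.I :=
    calc Complex.exp (((Real.pi * (α + ((m + 1 : ℤ) : ℝ)) / 2 : ℝ) : ℂ) * Complex.I)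
        = Complex.exp (((Real.pi * (α + m) / 2 : ℝ) : ℂ) * Complex.I + (Real.pi / 2 * Complex.I)) := by congr 1; push_cast; ring
      _ = Complex.exp (((Real.pi * (α + m) / 2 : ℝ) : ℂ) * Complex.I) * Complex.exp (Real.pi / 2 * Complex.I) := Complex.exp_add _ _
      _ = _ := by rw [Complex.exp_pi_div_two_mul_I]
  have h1 : vPairState α d (m + 1) n = Complex.I * (v - u) := by
    simp only [vPairState]
    rw [hI1, hI2, hu, hv]; ring
  have hnu : ‖u‖ = ‖d n 0‖ := by
    rw [hu, norm_mul, show -((Real.pi * (α + m) / 2 : ℝ) : ℂ) * Complex.I = ((-(Real.pi * (α + m) / 2) : ℝ) : ℂ) * Complex.I by push_cast; ring,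
      Complex.norm_exp_ofReal_mul_I, mul_one]
  have hnv : ‖v‖ = ‖d n 1‖ := by rw [hv, norm_mul, Complex.norm_exp_ofReal_mul_I, mul_one]
  rw [h0, h1, norm_mul, Complex.norm_I, one_mul, ← hnu, ← hnv]
  have hpar := parallelogram_law_with_norm ℂ u v
  have e : ‖v - u‖ = ‖u - v‖ := by rw [← norm_neg]; congr 1; ring
  rw [e]
  nlinarith [hpar, sq_nonneg ‖u + v‖, sq_nonneg ‖u - v‖]

/-- **The input energy of a V source supported in the small shells** (`s ≤ 2`: `|β + n| < 4` on the support; `K ≥ 2`, `α ∈ [0,1]`):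
`Σ_n (‖d n 0‖² + ‖d n 1‖²) ≤ 50π² · cEnergy α β 0 K (inputState α β θ K V d)` — rows `m = 1, 2` have wavenumbers `1 ≤ α+m ≤ 3`, weight `≥ 1/(100π²)` each. -/
theorem sum_norm_sq_le_cEnergy_inputState_V_small {α : ℝ} (hα0 : 0 ≤ α) (hα1 : α ≤ 1) (β θ : ℝ) {s K : ℕ} (hs : s ≤ 2) (hK : 2 ≤ K)
    (d : ℤ → Fin 2 → ℂ) (hd : SupportedInW s β K d) :
    ∑ n ∈ win K, (‖d n 0‖ ^ 2 + ‖d n 1‖ ^ 2) ≤ 50 * Real.pi ^ 2 * cEnergy α β 0 K (inputState α β θ K PType.V d) := by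
  rw [cEnergy_inputState_V]
  have h1w : (1 : ℤ) ∈ win K := by rw [mem_win]; omega
  have h2w : (2 : ℤ) ∈ win K := by rw [mem_win]; omega
  -- shells ≤ 2 live inside `|β+n| < 4`
  have hb : ∀ n ∈ win K, d n ≠ 0 → |β + n| < 4 := by
    intro n _ hdn
    by_contra h
    rw [not_lt] at h
    apply hdn
    apply hd.1 n
    intro hin
    have h4 : shellHi s ≤ 4 := by
      interval_cases s <;> norm_num [shellHi, shellLo]
    exact absurd (hin.2.trans_le h4) (not_lt.2 h)
  set T : ℤ → ℤ → ℝ := fun m n => ‖d n 0 * Complex.exp (-(Real.pi * (α + m) / 2 : ℝ) * Complex.I) + d n 1 * Complex.exp ((Real.pi * (α + m) / 2 : ℝ) * Complex.I)‖ ^ 2 /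
      (4 * Real.pi ^ 2 * ((α + m) ^ 2 + (β + n) ^ 2)) with hT
  have hT0 : ∀ m n, 0 ≤ T m n := fun m n => by rw [hT]; positivity
  have hTv : ∀ m n, T m n = ‖vPairState α d m n‖ ^ 2 / (4 * Real.pi ^ 2 * ((α + m) ^ 2 + (β + n) ^ 2)) := fun m n => by rw [hT]; rfl
  have hrows : ∑ n ∈ win K, (T 1 n + T 2 n) ≤ ∑ m ∈ win K, ∑ n ∈ win K, T m n := by
    rw [Finset.sum_comm]
    refine Finset.sum_le_sum fun n _ => ?_
    have hsub : ({1, 2} : Finset ℤ) ⊆ win K := by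
      intro m hm; simp only [Finset.mem_insert, Finset.mem_singleton] at hm; rcases hm with rfl | rfl <;> assumption
    calc T 1 n + T 2 n = ∑ m ∈ ({1, 2} : Finset ℤ), T m n := by rw [Finset.sum_pair (by norm_num)]
      _ ≤ ∑ m ∈ win K, T m n := Finset.sum_le_sum_of_subset_of_nonneg hsub fun m _ _ => hT0 m n
  have hlow : ∀ n ∈ win K, (‖d n 0‖ ^ 2 + ‖d n 1‖ ^ 2) ≤ 50 * Real.pi ^ 2 * (T 1 n + T 2 n) := by
    intro n hn
    by_cases hdn : d n = 0
    · have : T 1 n + T 2 n ≥ 0 := add_nonneg (hT0 1 n) (hT0 2 n)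
      simp only [hdn, Pi.zero_apply, norm_zero]; nlinarith [Real.pi_pos]
    have hbn := hb n hn hdn
    have hbn2 : (β + n) ^ 2 ≤ 16 := by have := abs_lt.1 hbn; nlinarith
    -- rows 1 and 2: weight ≥ 1/(4π²·25)
    have hw : ∀ m : ℤ, (m = 1 ∨ m = 2) → ‖vPairState α d m n‖ ^ 2 ≤ 100 * Real.pi ^ 2 * T m n := by
      intro m hm
      have ham : (α + m) ^ 2 ≤ 9 ∧ 1 ≤ (α + m) ^ 2 := by rcases hm with rfl | rfl <;> push_cast <;> constructor <;> nlinarith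
      have hpos : 0 < 4 * Real.pi ^ 2 * ((α + m) ^ 2 + (β + n) ^ 2) := by
        have : 0 < (α + m) ^ 2 + (β + n) ^ 2 := by nlinarith [sq_nonneg (β + n)]
        positivity
      have hnn := sq_nonneg ‖vPairState α d m n‖
      have hπ := Real.pi_pos
      have : 4 * Real.pi ^ 2 * ((α + ↑m) ^ 2 + (β + ↑n) ^ 2) ≤ 100 * Real.pi ^ 2 := by nlinarith [ham.1, hbn2]
      rw [hTv, mul_div_assoc', le_div_iff₀ hpos]
      calc ‖vPairState α d m n‖ ^ 2 * (4 * Real.pi ^ 2 * ((α + ↑m) ^ 2 + (β + ↑n) ^ 2)) ≤ ‖vPairState α d m n‖ ^ 2 * (100 * Real.pi ^ 2) :=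
            mul_le_mul_of_nonneg_left this hnn
        _ = 100 * Real.pi ^ 2 * ‖vPairState α d m n‖ ^ 2 := by ring
    have h1 := hw 1 (Or.inl rfl)
    have h2 := hw 2 (Or.inr rfl)
    have hpar := norm_sq_vPairState_rows_succ α d 1 n
    norm_num at hpar
    nlinarith [hpar, h1, h2]
  calc ∑ n ∈ win K, (‖d n 0‖ ^ 2 + ‖d n 1‖ ^ 2) ≤ ∑ n ∈ win K, 50 * Real.pi ^ 2 * (T 1 n + T 2 n) := Finset.sum_le_sum hlow
    _ = 50 * Real.pi ^ 2 * ∑ n ∈ win K, (T 1 n + T 2 n) := by rw [Finset.mul_sum]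
    _ ≤ 50 * Real.pi ^ 2 * ∑ m ∈ win K, ∑ n ∈ win K, T m n := mul_le_mul_of_nonneg_left hrows (by positivity)

/-- **The input energy of a V source, ALL shells** (`2^{s+2} ≤ K+1`, `α ∈ [0,1]`): `Σ_n (‖d n 0‖² + ‖d n 1‖²) ≤ 50π²·2^s · cEnergy α β 0 K (inputState α β θ K V d)`. -/
theorem sum_norm_sq_le_cEnergy_inputState_V_all {α : ℝ} (hα0 : 0 ≤ α) (hα1 : α ≤ 1) (β θ : ℝ) {s K : ℕ}
    (hK : (2 : ℝ) ^ (s + 2) ≤ K + 1) (d : ℤ → Fin 2 → ℂ) (hd : SupportedInW s β K d) :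
    ∑ n ∈ win K, (‖d n 0‖ ^ 2 + ‖d n 1‖ ^ 2) ≤ 50 * Real.pi ^ 2 * 2 ^ s * cEnergy α β 0 K (inputState α β θ K PType.V d) := by
  have hE0 : 0 ≤ cEnergy α β 0 K (inputState α β θ K PType.V d) := cEnergy_nonneg _ _ _ _ _
  have h2s : (1 : ℝ) ≤ 2 ^ s := one_le_pow₀ (by norm_num)
  have hπ := Real.pi_pos
  rcases le_or_gt s 2 with hs | hs
  · have hK2 : 2 ≤ K := by
      have h4 : (4 : ℝ) ≤ 2 ^ (s + 2) := by
        calc (4 : ℝ) = 2 ^ 2 := by norm_num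
          _ ≤ 2 ^ (s + 2) := pow_le_pow_right₀ (by norm_num) (by omega)
      have : (3 : ℝ) ≤ K := by linarith
      exact_mod_cast (show (2 : ℝ) ≤ K by linarith)
    have h := sum_norm_sq_le_cEnergy_inputState_V_small hα0 hα1 β θ hs hK2 d hd
    have : 50 * Real.pi ^ 2 * cEnergy α β 0 K (inputState α β θ K PType.V d) ≤ 50 * Real.pi ^ 2 * 2 ^ s * cEnergy α β 0 K (inputState α β θ K PType.V d) := by
      have := mul_le_mul_of_nonneg_left h2s (by positivity : (0:ℝ) ≤ 50 * Real.pi ^ 2 * cEnergy α β 0 K (inputState α β θ K PType.V d))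
      linarith [this]
    exact h.trans this
  · have h := sum_norm_sq_le_cEnergy_inputState_V hα0 hα1 β θ (by omega) hK d hd.1
    have : 8 * Real.pi ^ 2 * 2 ^ s * cEnergy α β 0 K (inputState α β θ K PType.V d) ≤ 50 * Real.pi ^ 2 * 2 ^ s * cEnergy α β 0 K (inputState α β θ K PType.V d) :=
      mul_le_mul_of_nonneg_right (by nlinarith) hE0
    exact h.trans this

end smallShells


section ageLaw

/-- The (truth-sized) constant of the V-input age law: `D_V(θ, s) = 1 + 2κ₀·(24c_s)^{3/16} + 12(1+2κ₀)·(24c_s)^{1/2}`, `c_s = 50π²2^s`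
(`c_s` = the input-energy constant `Σ‖d‖² ≤ c_s·E` of a shell-`s` V source, `κ₀ = kap θ 0`). -/
def DV (θ : ℝ) (s : ℕ) : ℝ :=
  1 + 2 * kap θ 0 * Real.sqrt (p38 (24 * (50 * Real.pi ^ 2 * 2 ^ s))) + 12 * (1 + 2 * kap θ 0) * Real.sqrt (24 * (50 * Real.pi ^ 2 * 2 ^ s))

theorem DV_nonneg (θ : ℝ) (s : ℕ) : 0 ≤ DV θ s := by
  unfold DV
  have := kap_nonneg θ 0
  positivity

theorem Bcoef_zero_level (θ : ℝ) (k : ℕ) : Bcoef θ k 0 = 2 * kap θ 0 * 12 ^ k := by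
  unfold Bcoef p38 oct qrt; simp

/-- **THE DEBRIS AGE LAW BY NAME (P2-D; V sources of ANY shell `s`, any target piece `(tgt, s′)`)**, modulo the target's one-phase output law `C_out`:
`DebrisTransfer α β θ K k V s tgt s′ (√C_out · D_V(θ,s) · 12^k)` for `0 ≤ θ ≤ 8`, `2^{s+2} ≤ K+1`, `(α, β) ∈ [0,1)²`, every age `k` (row blocks + the family
age law + `P₀ ≤ 50π²2^s·E`).  Rate `12 < 13.0` = the v7.2 cone witness's affordable rate at the typed `ρc` (F-p4g21-1). -/
theorem debrisTransfer_V_ageLaw_of_out {θ : ℝ} (hθ0 : 0 ≤ θ) (hθ : θ ≤ 8) {K s : ℕ} {tgt : PType} {s' : ℕ} (hK : (2 : ℝ) ^ (s + 2) ≤ K + 1)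
    {Cout : ℝ} (hC : 0 ≤ Cout)
    (hout : ∀ (α β : ℝ) (ℓ : ℕ) (ζ : CState), 0 ≤ α → α ≤ 1 → 0 ≤ β → β ≤ 1 →
      outEnergyAt α β θ K ℓ s' (phasePieces α β θ K ζ) tgt ≤ Cout * cEnergy α β ℓ K ζ)
    {α β : ℝ} (hα0 : 0 ≤ α) (hα1 : α < 1) (hβ0 : 0 ≤ β) (hβ1 : β < 1) (k : ℕ) :
    DebrisTransfer α β θ K k PType.V s tgt s' (Real.sqrt Cout * DV θ s * 12 ^ k) := by
  intro d hd
  set Z := inputState α β θ K PType.V d with hZ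
  have hZw : ∀ m n : ℤ, (m ∉ win K ∨ n ∉ win K) → Z m n = 0 := fun m n h => inputState_apply_eq_zero α β θ K PType.V d m n h
  set P₀ := ∑ n ∈ win K, (‖d n 0‖ ^ 2 + ‖d n 1‖ ^ 2) with hP
  have hP0 : 0 ≤ P₀ := Finset.sum_nonneg fun _ _ => by positivity
  set E₀ := cEnergy α β 0 K Z with hE
  have hE0 : 0 ≤ E₀ := cEnergy_nonneg α β 0 K Z
  set B := Bcoef θ k 0 with hB
  have hB0 : 0 ≤ B := Bcoef_nonneg θ k 0
  have hBk : B = 2 * kap θ 0 * 12 ^ k := Bcoef_zero_level θ k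
  -- the family age law on the row blocks
  have hfam := debrisOut_ageLaw_family hθ0 hθ hC hout (Finset.range (K + 2)) k 0 α β (fun i => rowBlock i Z) hα0 hα1 hβ0 hβ1
    (fun i _ => rowBlock_windowed hZw i)
  have hfam' : debrisOut θ K tgt s' k 0 α β Z ≤ Cout * (∑ i ∈ Finset.range (K + 2),
      (Real.sqrt (cEnergy α β 0 K (rowBlock i Z)) + B * Y58 (ens K (rowBlock i Z)) (cEnergy α β 0 K (rowBlock i Z)))) ^ 2 := by
    have e : debrisOut θ K tgt s' k 0 α β Z = debrisOut θ K tgt s' k 0 α β (fun m n => ∑ i ∈ Finset.range (K + 2), rowBlock i Z m n) := by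
      rw [sum_rowBlock_eq hZw]
    rw [e]; exact hfam
  -- the block sum
  set r := oct (2 : ℝ)⁻¹ with hr
  have hterm0 := block_term_zero_le α β θ K d hB0
  have htermS : ∀ i ∈ Finset.range (K + 1), Real.sqrt (cEnergy α β 0 K (rowBlock (i + 1) Z)) +
      B * Y58 (ens K (rowBlock (i + 1) Z)) (cEnergy α β 0 K (rowBlock (i + 1) Z)) ≤ (1 + B) * Real.sqrt (24 * P₀) * r ^ (i + 1) := by
    intro i _
    have h := block_term_far_le hα0 hα1 β θ K d (i := i + 1) (by omega) hB0
    rw [oct_pow (by norm_num) (i + 1)] at h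
    exact h
  have hsum : ∑ i ∈ Finset.range (K + 2), (Real.sqrt (cEnergy α β 0 K (rowBlock i Z)) + B * Y58 (ens K (rowBlock i Z)) (cEnergy α β 0 K (rowBlock i Z))) ≤
      Real.sqrt E₀ + B * Y58 (24 * P₀) E₀ + 12 * ((1 + B) * Real.sqrt (24 * P₀)) := by
    rw [Finset.sum_range_succ']
    have h1 : ∑ i ∈ Finset.range (K + 1), (Real.sqrt (cEnergy α β 0 K (rowBlock (i + 1) Z)) +
        B * Y58 (ens K (rowBlock (i + 1) Z)) (cEnergy α β 0 K (rowBlock (i + 1) Z))) ≤ 12 * ((1 + B) * Real.sqrt (24 * P₀)) :=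
      calc _ ≤ ∑ i ∈ Finset.range (K + 1), (1 + B) * Real.sqrt (24 * P₀) * r ^ (i + 1) := Finset.sum_le_sum htermS
        _ = ((1 + B) * Real.sqrt (24 * P₀)) * ∑ i ∈ Finset.range (K + 1), r ^ (i + 1) :=
          (Finset.mul_sum (Finset.range (K + 1)) (fun i => r ^ (i + 1)) ((1 + B) * Real.sqrt (24 * P₀))).symm
        _ ≤ ((1 + B) * Real.sqrt (24 * P₀)) * 12 := mul_le_mul_of_nonneg_left (sum_oct_half_pow_le (K + 1)) (by positivity)
        _ = 12 * ((1 + B) * Real.sqrt (24 * P₀)) := by ring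
    linarith [hterm0, h1]
  -- `P₀ ≤ c·E₀`
  set c : ℝ := 50 * Real.pi ^ 2 * 2 ^ s with hc
  have hc0 : 0 ≤ c := by positivity
  have hPE : P₀ ≤ c * E₀ := sum_norm_sq_le_cEnergy_inputState_V_all hα0 hα1.le β θ hK d hd
  have h24 : 24 * P₀ ≤ 24 * c * E₀ := by rw [mul_assoc]; exact mul_le_mul_of_nonneg_left hPE (by norm_num)
  have hY : Y58 (24 * P₀) E₀ ≤ Real.sqrt (p38 (24 * c)) * Real.sqrt E₀ := by
    rw [← Y58_self_scale (by positivity) hE0]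
    exact Y58_le_Y58 h24 le_rfl
  have hS : Real.sqrt (24 * P₀) ≤ Real.sqrt (24 * c) * Real.sqrt E₀ := by
    rw [← Real.sqrt_mul (by positivity)]; exact Real.sqrt_le_sqrt h24
  have hpow : (1 : ℝ) ≤ 12 ^ k := one_le_pow₀ (by norm_num)
  have hk0 := kap_nonneg θ 0
  have htot : Real.sqrt E₀ + B * Y58 (24 * P₀) E₀ + 12 * ((1 + B) * Real.sqrt (24 * P₀)) ≤ Real.sqrt E₀ * 12 ^ k * DV θ s := by
    unfold DV
    rw [hBk]
    have e1 : Real.sqrt E₀ ≤ Real.sqrt E₀ * 12 ^ k * 1 := by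
      rw [mul_one]; exact le_mul_of_one_le_right (Real.sqrt_nonneg _) hpow
    have e2 : 2 * kap θ 0 * 12 ^ k * Y58 (24 * P₀) E₀ ≤ Real.sqrt E₀ * 12 ^ k * (2 * kap θ 0 * Real.sqrt (p38 (24 * c))) := by
      have := mul_le_mul_of_nonneg_left hY (mul_nonneg (mul_nonneg (by norm_num : (0:ℝ) ≤ 2) hk0) (by positivity : (0:ℝ) ≤ 12 ^ k))
      exact this.trans (le_of_eq (by ring))
    have e3 : 12 * ((1 + 2 * kap θ 0 * 12 ^ k) * Real.sqrt (24 * P₀)) ≤ Real.sqrt E₀ * 12 ^ k * (12 * (1 + 2 * kap θ 0) * Real.sqrt (24 * c)) := by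
      have h1 : 1 + 2 * kap θ 0 * 12 ^ k ≤ (1 + 2 * kap θ 0) * 12 ^ k := by
        have : (1 + 2 * kap θ 0) * 12 ^ k = 12 ^ k + 2 * kap θ 0 * 12 ^ k := by ring
        rw [this]; linarith
      have h2 : (1 + 2 * kap θ 0 * 12 ^ k) * Real.sqrt (24 * P₀) ≤ ((1 + 2 * kap θ 0) * 12 ^ k) * (Real.sqrt (24 * c) * Real.sqrt E₀) :=
        mul_le_mul h1 hS (Real.sqrt_nonneg _) (by positivity)
      exact (mul_le_mul_of_nonneg_left h2 (by norm_num : (0:ℝ) ≤ 12)).trans (le_of_eq (by ring))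
    exact (add_le_add (add_le_add e1 e2) e3).trans (le_of_eq (by ring))
  -- conclude
  have hfin : debrisOut θ K tgt s' k 0 α β Z ≤ Cout * (Real.sqrt E₀ * 12 ^ k * DV θ s) ^ 2 := by
    refine hfam'.trans (mul_le_mul_of_nonneg_left (pow_le_pow_left₀ ?_ (hsum.trans htot) 2) hC)
    exact Finset.sum_nonneg fun i _ => add_nonneg (Real.sqrt_nonneg _) (mul_nonneg hB0 (Y58_nonneg _ _))
  refine hfin.trans (le_of_eq ?_)
  rw [mul_pow, mul_pow, mul_pow, mul_pow, Real.sq_sqrt hC, Real.sq_sqrt hE0]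
  ring

end ageLaw

/-! ## §7 (p2 g14, v2) THE AGE LAW UNCONDITIONALLY, IN ONE FILE: the one-phase H-output law is `outEnergyAt_H_le_cEnergy` (copied chain §8–§23 of `K2CreationLaws.lean`) -/

section unconditional

/-- `DebrisTransfer` is monotone in the constant. -/
theorem debrisTransfer_mono {α β θ : ℝ} {K k : ℕ} {t : PType} {s : ℕ} {t' : PType} {s' : ℕ} {D D' : ℝ} (hD : 0 ≤ D) (hDD' : D ≤ D')
    (h : DebrisTransfer α β θ K k t s t' s' D) : DebrisTransfer α β θ K k t s t' s' D' := by
  intro d hd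
  refine (h d hd).trans (mul_le_mul_of_nonneg_right (pow_le_pow_left₀ hD hDD' 2) ?_)
  exact Finset.sum_nonneg fun _ _ => Finset.sum_nonneg fun _ _ => by positivity

/-- **THE DEBRIS AGE LAW BY NAME, UNCONDITIONAL (V sources of any shell, H targets `s′ ≥ 3`):** `DebrisTransfer α β θ K k V s H s′ (2100·D_V(θ,s)·12^k)`
for `0 ≤ θ ≤ 8`, `2^{s+2} ≤ K+1`, `(α, β) ∈ [0,1)²`, every age `k` (output law = `outEnergyAt_H_le_cEnergy`, `C_out ≤ 2100²`). -/
theorem debrisTransfer_V_H_ageLaw {θ : ℝ} (hθ0 : 0 ≤ θ) (hθ : θ ≤ 8) {K s s' : ℕ} (hK : (2 : ℝ) ^ (s + 2) ≤ K + 1) (hs' : 3 ≤ s')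
    {α β : ℝ} (hα0 : 0 ≤ α) (hα1 : α < 1) (hβ0 : 0 ≤ β) (hβ1 : β < 1) (k : ℕ) :
    DebrisTransfer α β θ K k PType.V s PType.H s' (2100 * DV θ s * 12 ^ k) := by
  set Cout : ℝ := (θ ^ 2 + 2) * (16000 * (Real.pi + 1)) with hCout
  have hC : 0 ≤ Cout := by positivity
  have hout : ∀ (α β : ℝ) (ℓ : ℕ) (ζ : CState), 0 ≤ α → α ≤ 1 → 0 ≤ β → β ≤ 1 →
      outEnergyAt α β θ K ℓ s' (phasePieces α β θ K ζ) PType.H ≤ Cout * cEnergy α β ℓ K ζ :=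
    fun α β ℓ ζ _ _ hb0 hb1 => outEnergyAt_H_le_cEnergy hb0 hb1 hθ0 hθ K ℓ hs' ζ
  have h := debrisTransfer_V_ageLaw_of_out hθ0 hθ hK hC hout hα0 hα1 hβ0 hβ1 k
  have hsqrt : Real.sqrt Cout ≤ 2100 := by
    refine sqrt_le_of_sq_le (by norm_num) ?_
    have hπ : Real.pi < 3.1416 := Real.pi_lt_d4
    have hθ2 : θ ^ 2 ≤ 64 := by nlinarith
    rw [hCout]; nlinarith
  have hDV := DV_nonneg θ s
  refine debrisTransfer_mono (by positivity) ?_ h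
  exact mul_le_mul_of_nonneg_right (mul_le_mul_of_nonneg_right hsqrt hDV) (by positivity)

end unconditional

/-! ## §8′ (p2 g14, v3) V TARGETS modulo the LINE LAW: `LineLaw C → DebrisTransfer α β θ K k V s tgt s′ (√(C(2C+3·66))·D_V·12^k)` for BOTH target types
(the line law of record `LineLaw (max C_B1 (1280000(π+4)))` = `K2CreationLaws.lineLaw_of_core` ∘ `K2CoreLineLaw.coreLineLaw_B1`, B1 PROVED, p2 g13) -/

section lineLawTargets

/-- **THE DEBRIS AGE LAW FOR EVERY TARGET PIECE, GIVEN THE LINE LAW** (`LineLaw C` = B1 of record via `K2CreationLaws.lineLaw_of_core` ∘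
`K2CoreLineLaw.coreLineLaw_B1`): `DebrisTransfer α β θ K k V s tgt s′ (√(C(2C+3(θ²+2))) · D_V(θ,s) · 12^k)`. -/
theorem debrisTransfer_V_ageLaw_of_lineLaw {C : ℝ} (hL : LineLaw C) (hC : 0 ≤ C) {θ : ℝ} (hθ0 : 0 ≤ θ) (hθ : θ ≤ 8) {K s : ℕ} (tgt : PType) (s' : ℕ)
    (hK : (2 : ℝ) ^ (s + 2) ≤ K + 1) {α β : ℝ} (hα0 : 0 ≤ α) (hα1 : α < 1) (hβ0 : 0 ≤ β) (hβ1 : β < 1) (k : ℕ) :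
    DebrisTransfer α β θ K k PType.V s tgt s' (Real.sqrt (C * (2 * C + 3 * (θ ^ 2 + 2))) * DV θ s * 12 ^ k) := by
  have hCout : 0 ≤ C * (2 * C + 3 * (θ ^ 2 + 2)) := by positivity
  have hout : ∀ (α β : ℝ) (ℓ : ℕ) (ζ : CState), 0 ≤ α → α ≤ 1 → 0 ≤ β → β ≤ 1 →
      outEnergyAt α β θ K ℓ s' (phasePieces α β θ K ζ) tgt ≤ C * (2 * C + 3 * (θ ^ 2 + 2)) * cEnergy α β ℓ K ζ :=
    fun α β ℓ ζ ha0 ha1 hb0 hb1 => outEnergyAt_le_of_lineLaw hL hC ha0 ha1 hb0 hb1 hθ0 hθ K ℓ s' ζ tgt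
  exact debrisTransfer_V_ageLaw_of_out hθ0 hθ hK hCout hout hα0 hα1 hβ0 hβ1 k

end lineLawTargets


end

end Summit.AnomalousDissipation.AnomalousDissipation.Cruxes.K1LocalisedCascade.K2DebrisAgeLaw
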